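import Literature.Barriers.CriticalPhenomena.PlaquetteWalkHoleRootFarCellLaw
import HarnessLib

/-!
# Barrier catalogue (SAWScalingLimit): the TURNING RIGIDITY and the CLASS DIRECTIONS at the DIAGONAL cell of a hole root

Companion of `PlaquetteWalkHoleRootFarCellLaw` (the far cell `(w.1 − 2, w.2)` of the hole root `a = w.side W`, hole
`h = holeFaceW w = (w.1 − 1, w.2) ∉ D`: sign law at every plaquette, the turning rigidity (R2) by two discrete
Umlaufsätze, the far-cell law) and of `PlaquetteWalkHoleRootLateralCellLaw` (the lateral cell). Here the rhombus is the
DIAGONAL cell `d = farSW w = (w.1 − 2, w.2 − 1)`, south-west of the hole and touching it at ONE CORNER only: it has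
NO dead side, so the chord rule (R1) of the companion files says nothing, and all four sides may be the first side
`z₀` of a class-`B2a` excursion rooted at `a`.

## Method: a generic closed-polygon engine with finite tables

For a walk `γ` from the root and a list `cl` of closing offsets (relative to `d.base`, mesh `4`), `YBWalk.diagCyc γ cl`
is the periodic lattice polygon «walk polyline, then the closing points». ★ `YBWalk.diagCyc_hopf`: if the inner
vertices of the walk are inner points of faces other than `d` and `h` except for listed special offsets, and the
closing passes four FINITE TABLES (safe and fresh points `safeOffsets` — the odd-odd points and the centre of `d`,
the corner `d ∩ h`, two points inside `h` —, no repeated point, short closing edges seen acutely from every special or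
closing point, short special chords seen acutely from every closing point; all decided by `decide` in each instance
— the cell and its safe list are PARAMETERS, so the engine serves the other ring cells as well), then the polygon is
injective on a period and satisfies the acute-angle hypothesis of the tree's discrete Umlaufsatz
`hopf_cyclic_int` (`PlaquetteWalkHoleRootFarCellLaw`, from `HopfClosed`), so its exterior angles add up to `±2π`.
★ `YBWalk.sum_extAng_diagCyc`: that sum is the walk's right-angle winding (`YBWalk.sum_ext_angles_eq_winding`) plus
`triplesTurn(…)·π/4`, an INTEGER computed from the octants of the closing directions (`dirOct`, `arg_toC_of_dirOct`,
`toReal_octant_sub`). The generic coordinate input is `five_le_dsq_innerPt_safe`: inner points of faces other than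
`d`, `h` are at squared distance `≥ 5` from every safe closing point.

## Results (all unconditional; axioms `propext`, `Classical.choice`, `Quot.sound`)

* ★★ `ΩG.WP_farSW_pi_div_two_mem` — Hopf for the closed PREFIX polygon (prefix, then `midPt(d.side z₀) → (3,3) →
  corner (4,4) → (5,5) → ctr h → root`, with an extra point `ctr d` for `z₀ ∈ {S, W}`): the right-angle turning `WP`
  of the prefix is one of TWO values `4π` apart — `N`: `{3π/2, −5π/2}`, `E`: `{3π, −π}`, `S`: `{5π/2, −3π/2}`,
  `W`: `{2π, −2π}`.
* `ΩG.winding_farSW_XYZ` (twelve patterns `(z₀, z₁, z₂)` = (first, exit, return side), one orientation per class) —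
  Hopf for the closed WHOLE-WALK polygon (closing from `midPt(d.side z₂)` through `d` to the corner and the hole, chosen
  per pattern to avoid the two inner points of the arc inside `d`): `winding(π/2)` is one of two values.
* ★★★ `ΩG.WP_farSW_pi_div_two_eq_of_wound`, `ΩG.WP_farSW_eq_of_wound` — **THE TURNING RIGIDITY AT THE DIAGONAL
  CELL**: for every WOUND class-`B2a` walk at `d` (`WE ≠ excursionWinding`), the prefix turning is fixed by the first
  side alone: `WP(θ) = π + θ` (`N`, over the hole), `−π` (`E`, under it), `θ − 2π` (`S`, from below), `2π` (`W`, once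
  around) — in the lane's bookkeeping `WP = aθ + b(π − θ)`: `(a, b) = (2, 1), (−1, −1), (−1, −2), (2, 2)`. The
  selection: `winding = WP + arcTurn(z₀ → z₁) + WE` (`ΩG.winding_eq_WP_add_farSW`) and the companion file's sign law
  (`ΩG.sign_law`: wound ⇒ `WE(π/2) = excursionWinding(π/2) + 4π·ε(z₀; z₁, z₂)`) turn the whole-walk Umlaufsatz into two
  candidates for `WP` that meet the prefix polygon's two candidates in exactly one value (eight patterns,
  `ΩG.WP_farSW_XYZ`); the other orientation of each class is the reversed companion's (`ΩG.rev`: same prefix, same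
  first side, same woundness). ALL FOUR first sides are rigid — the question left open by the venture lane's design
  note (entries from the outer sides do occur: the lane's data show a `W`-entry at the mirror-image NW diagonal).
* ★★ `ΩG.farSW_entry_exit_exclusion` (`ΩG.farSW_no_SNE`, `_SEW`, `_WNE`, `_WSN`) — **ENTRY–EXIT EXCLUSION**: a
  class-`B2a` walk at `d`, wound or not, that entered from `S` never uses the side `E`, and one that entered from `W`
  never uses `N` (for these four classes the two Umlaufsätze and the sign law admit NO value of `WP`: the prefix and
  the diagonal closing separate the start of the excursion from the far side of `d`).
* ★★ `diag_term`, `diagDir` — THE CLASS DIRECTIONS: with the turning pinned, the companion file's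
  `ΩG.classTerm_dichotomy` and the tree's twelve `backBracket_*` closed forms give
  `phase(WP)·ε(z₀; z₁, z₂)·backBracket(θ; z₀, z₁, z₂, z₃) = v(θ)·diagDir(θ; z₀, z₁, z₂)` for the sixteen realizable
  patterns, `diagDir` a unit complex number symmetric in exit/return: `N`: `{S,W} ↦ 1`, `{E,S} ↦ e^{iπ/8}`,
  `{E,W} ↦ e^{i(3θ/8 − π/8)}`; `E`: `{N,S} ↦ e^{−i7π/8}`, `{S,W} ↦ e^{i(3θ/8 − π)}`, `{N,W} ↦ e^{i(3θ/8 − 9π/8)}`;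
  `S`: `{N,W} ↦ −1`; `W`: `{E,S} ↦ e^{i3θ/8}`.
* ★★★ `ΩG.classTerm_farSW` — for every class-`B2a` walk at `d`: `classTerm = v(θ)·diagClassTerm`, i.e. `0` if unwound
  and `v(θ)·extWeight·diagDir(θ; z₀, z₁, z₂)` if wound; `ΩG.sum_classTerm_farSW`.
* ★★★★ `PlaquetteWalk.vertexFunctional_printed_farSW_eq` — **THE DIAGONAL-CELL LAW**: for `θ ∈ [π/3, 2π/3]`,
  `farSW w ∈ Dl`, `holeFaceW w ∉ dom Dl`:
  `vertexFunctional (printedWeights θ) tFiveEighths (ybCoeff θ) Dl (w.side W) (farSW w)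
     = i·v(θ)·Σ_{ω ∈ B2a(d)} diagClassTerm θ ω`
  — every wound walk contributes its exterior weight along one of EIGHT explicit unit directions; and the bound
  `PlaquetteWalk.norm_vertexFunctional_printed_farSW_le`: `‖VF_D(w.side W, d)‖ ≤ v(θ)·Σ_{B2a(d)} extWeight`.
* ★★★ `PlaquetteWalk.vertexFunctional_printed_farSW_ne_zero_of_N_or_W` / `…_of_E_or_S` — **THE CONE LAWS**
  (sufficient-half instances of the lane's encircling criterion at a plaquette other than the root's own): the four
  `N/W` directions lie in the cone `[0, π/4]` and the four `E/S` directions in `[π, 5π/4]`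
  (`re_rot_diagDir_pos_of_N_or_W` / `_of_E_or_S`); so on the open range `θ ∈ (π/3, 2π/3)`, if every wound walk at `d`
  entered from `N` or `W` (resp. from `E` or `S`) and one wound walk exists, then `VF_D(w.side W, d) ≠ 0`.

Data (venture lane «pcv-sawmu», seat b-step0 gen 18, HOME `code/step0/g18/explore/`, `FINDING-YB-HONEYCOMB-FAR-CELL.md`
§5): exact enumeration on three hole-rooted domains found the turning at the SW diagonal rigid per first side with the
values `(−1, −1)` (`E`) and `(2, 1)` (`N`) — and, at the mirror-image NW diagonal of the domain «asym», entry from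
the outer side `W` with `(−2, −2)`, the mirror of this file's `(2, 2)` —, and the eight class directions above to
`1e−16` against the directly computed vertex functional; the entries from `S`/`W` into the SW diagonal did not fit in
those boxes. The finite tables of this file were designed by the script `code/step0/g19/turning/diag_design.py`
(seat b-step0 gen 19).

References, as printed: A. Glazman, I. Manolescu, arXiv:1708.00395v3, Lemma 2.1 (p. 6, stated «in the form given in
[Gl]») [GlazmanManolescu2019]; A. Glazman, Electron. Commun. Probab. 20 (2015) no. 86, Lemma 3.1 and its proof
pp. 6–7 (the classes of walks through a rhombus; eq. (1): the weights) [Glazman2015WeightedSAW]; H. Duminil-Copin,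
S. Smirnov, Ann. of Math. 175 (2012), Lemma 1, proof («In order to evaluate the winding of γ₁ between p and q above, we
used the fact that a is on the boundary and Ω is simply connected») [DuminilCopinSmirnov2012]; H. Hopf, Compositio
Math. 2 (1935) 50–62, Nr. 2 (Umlaufsatz, p. 53) and Nr. 4 eq. (22) (curves with corners, pp. 60–61) [Hopf1935].
Status: lane theorems, not located in print (hole roots are outside the printed simply-connected setting; the
turning rigidity is the discrete Umlaufsatz applied to two explicit lattice polygons per pattern, the directions are
the tree's closed forms of Glazman's bracket). NOT claimed: anything about the relative sizes of the eight class
masses beyond the two one-sided cones (no vanishing statement for `VF(d)`; the `N/W` and `E/S` cones are nearly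
antipodal and CAN cancel against each other), the other three diagonal cells
(reflections of this one, not spelled out), cells outside the ring of the hole. Written for the venture lane
«pcv-sawmu» (Tier B, b-step0 gen 19).
-/

noncomputable section

namespace Literature.Probability.RandomPlanarGeometry.SAW.YangBaxter

open Real Complex

section LatticeToolsD

/-- `dsq` is symmetric. [folklore] -/
private theorem dsq_commD (p q : ℤ × ℤ) : dsq p q = dsq q p := by unfold dsq; ring

/-- Polarization: `2·sdot A B v = |A − v|² + |B − v|² − |A − B|²`. [folklore] -/
private theorem two_mul_sdotD (A B v : ℤ × ℤ) : 2 * sdot A B v = dsq A v + dsq B v - dsq A B := by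
  unfold sdot dsq; ring

/-- Distinct lattice points are at squared distance `≥ 1`. [folklore] -/
private theorem one_le_dsq_of_neD {p q : ℤ × ℤ} (h : p ≠ q) : 1 ≤ dsq p q := by
  unfold dsq
  by_contra hlt
  push Not at hlt
  have h1 : (p.1 - q.1) ^ 2 = 0 := by nlinarith [sq_nonneg (p.1 - q.1), sq_nonneg (p.2 - q.2)]
  have h2 : (p.2 - q.2) ^ 2 = 0 := by nlinarith [sq_nonneg (p.1 - q.1), sq_nonneg (p.2 - q.2)]
  exact h (Prod.ext (by nlinarith [pow_eq_zero_iff (n := 2) (a := p.1 - q.1) two_ne_zero])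
    (by nlinarith [pow_eq_zero_iff (n := 2) (a := p.2 - q.2) two_ne_zero]))

/-- `dsq p p = 0`. [folklore] -/
private theorem dsq_selfD (p : ℤ × ℤ) : dsq p p = 0 := by unfold dsq; ring

/-- The acute-angle test from distances: `|A − B|² < |A − v|² + |B − v|² ⇒ sdot A B v > 0`. [folklore] -/
private theorem sdot_pos_of_dsqD {A B v : ℤ × ℤ} (h : dsq A B < dsq A v + dsq B v) : 0 < sdot A B v := by
  have := two_mul_sdotD A B v; omega

/-- `dsq` is translation invariant. [folklore] -/
private theorem dsq_add_leftD (b u v : ℤ × ℤ) : dsq (b + u) (b + v) = dsq u v := by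
  simp only [dsq, Prod.fst_add, Prod.snd_add]; ring

/-- Squared length of a step. [folklore] -/
private theorem dsq_self_addD (m n : ℤ × ℤ) : dsq m (m + n) = n.1 ^ 2 + n.2 ^ 2 := by
  simp only [dsq, Prod.fst_add, Prod.snd_add]; ring

/-- The inner offsets lie in `{1, 2, 3}²`, one coordinate being `2`. [folklore] -/
private theorem inOff_casesD (s : Side) :
    (s.inOff.1 = 2 ∧ (s.inOff.2 = 1 ∨ s.inOff.2 = 3)) ∨ (s.inOff.2 = 2 ∧ (s.inOff.1 = 1 ∨ s.inOff.1 = 3)) := by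
  cases s <;> simp [Side.inOff, Side.offset, Side.nIn]

/-- The inward normals are unit lattice vectors. [folklore] -/
private theorem nIn_boundsD (s : Side) :
    -1 ≤ s.nIn.1 ∧ s.nIn.1 ≤ 1 ∧ -1 ≤ s.nIn.2 ∧ s.nIn.2 ≤ 1 ∧ s.nIn.1 ^ 2 + s.nIn.2 ^ 2 = 1 := by
  cases s <;> simp [Side.nIn]

/-- Two inner offsets are at squared distance `≤ 4`. [folklore] -/
private theorem dsq_inOff_leD (s t : Side) : dsq s.inOff t.inOff ≤ 4 := by
  cases s <;> cases t <;> simp [dsq, Side.inOff, Side.offset, Side.nIn]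

/-- Two inward normals are at squared distance `≤ 4`. [folklore] -/
private theorem dsq_nIn_leD (s t : Side) : dsq s.nIn t.nIn ≤ 4 := by
  cases s <;> cases t <;> simp [dsq, Side.nIn]

/-- `x² + y² ≥ 5` from a linear case description of `(x, y)` being outside the radius-`2` cross. [folklore] -/
private theorem five_le_sq_add_sq_cross {x y : ℤ}
    (h : 3 ≤ x ∨ x ≤ -3 ∨ 3 ≤ y ∨ y ≤ -3 ∨ ((2 ≤ x ∨ x ≤ -2) ∧ (1 ≤ y ∨ y ≤ -1)) ∨
      ((1 ≤ x ∨ x ≤ -1) ∧ (2 ≤ y ∨ y ≤ -2))) : 5 ≤ x ^ 2 + y ^ 2 := by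
  rcases h with h | h | h | h | ⟨h1, h2⟩ | ⟨h1, h2⟩
  · nlinarith [sq_nonneg y, mul_nonneg (show (0:ℤ) ≤ x - 3 by omega) (show (0:ℤ) ≤ x + 3 by omega)]
  · nlinarith [sq_nonneg y, mul_nonneg (show (0:ℤ) ≤ -x - 3 by omega) (show (0:ℤ) ≤ -x + 3 by omega)]
  · nlinarith [sq_nonneg x, mul_nonneg (show (0:ℤ) ≤ y - 3 by omega) (show (0:ℤ) ≤ y + 3 by omega)]
  · nlinarith [sq_nonneg x, mul_nonneg (show (0:ℤ) ≤ -y - 3 by omega) (show (0:ℤ) ≤ -y + 3 by omega)]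
  · have hx : 4 ≤ x ^ 2 := by rcases h1 with h1 | h1 <;> nlinarith
    have hy : 1 ≤ y ^ 2 := by rcases h2 with h2 | h2 <;> nlinarith
    omega
  · have hx : 1 ≤ x ^ 2 := by rcases h1 with h1 | h1 <;> nlinarith
    have hy : 4 ≤ y ^ 2 := by rcases h2 with h2 | h2 <;> nlinarith
    omega

/-- **The safe closing offsets** (relative to the base corner of the diagonal cell `d`): the odd-odd points and the
centre of `d`, the corner `d ∩ h`, and two points inside the hole `h`. [folklore] -/
def safeOffsets : List (ℤ × ℤ) := [(1, 1), (1, 3), (3, 1), (3, 3), (2, 2), (4, 4), (5, 5), (6, 6)]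

/-- ★ **Inner points of faces other than `d` and its `NE`-neighbour `h` stay at squared distance `≥ 5` from every safe
closing point.** [folklore] -/
private theorem five_le_dsq_innerPt_safe {g d : Face} (hg : g ≠ d) (hh : g ≠ (d.1 + 1, d.2 + 1)) (s : Side)
    {q : ℤ × ℤ} (hq : q ∈ safeOffsets) : 5 ≤ dsq (innerPt g s) (d.base + q) := by
  obtain ⟨k, j⟩ := g
  obtain ⟨k', j'⟩ := d
  have hne : ¬(k = k' ∧ j = j') := fun e => hg (Prod.ext e.1 e.2)
  have hne' : ¬(k = k' + 1 ∧ j = j' + 1) := fun e => hh (Prod.ext e.1 e.2)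
  have hs := inOff_casesD s
  simp only [dsq, innerPt, Face.base, Prod.fst_add, Prod.snd_add]
  set ox := s.inOff.1
  set oy := s.inOff.2
  apply five_le_sq_add_sq_cross
  simp only [safeOffsets, List.mem_cons, List.mem_nil_iff, or_false] at hq
  rcases hq with rfl | rfl | rfl | rfl | rfl | rfl | rfl | rfl <;> simp only <;> omega

end LatticeToolsD

/-! ## Octant directions: exterior angles of short lattice closings are computable -/

section Octants

/-- The octant index of the sixteen short lattice directions (`none` otherwise). [folklore] -/
def dirOct (u : ℤ × ℤ) : Option ℤ :=
  if u = (1, 0) ∨ u = (2, 0) then some 0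
  else if u = (1, 1) ∨ u = (2, 2) then some 1
  else if u = (0, 1) ∨ u = (0, 2) then some 2
  else if u = (-1, 1) ∨ u = (-2, 2) then some 3
  else if u = (-1, 0) ∨ u = (-2, 0) then some 4
  else if u = (-1, -1) ∨ u = (-2, -2) then some (-3)
  else if u = (0, -1) ∨ u = (0, -2) then some (-2)
  else if u = (1, -1) ∨ u = (2, -2) then some (-1)
  else none

/-- Doubling a lattice vector does not change its argument. [folklore] -/
private theorem arg_toC_double (x y : ℤ) : Complex.arg (toC (2 * x, 2 * y)) = Complex.arg (toC (x, y)) := by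
  rw [toC_mk, toC_mk]
  rw [show ((2 * x : ℤ) : ℂ) + ((2 * y : ℤ) : ℂ) * Complex.I = ((2 : ℝ) : ℂ) * ((x : ℂ) + (y : ℂ) * Complex.I) by
    push_cast; ring]
  exact Complex.arg_real_mul _ two_pos

/-- ★ **The argument of a short lattice direction is its octant index times `π/4`.** [cite: Hopf1935, Nr. 4 eq. (22) (curves with corners: the exterior angle at a corner); lane plumbing] -/
theorem arg_toC_of_dirOct {u : ℤ × ℤ} {m : ℤ} (h : dirOct u = some m) : Complex.arg (toC u) = m * (π / 4) := by
  unfold dirOct at h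
  have e1 : Complex.arg (toC ((1 : ℤ), (0 : ℤ))) = 0 := by
    rw [toC_mk]; push_cast; simp
  have e2 : Complex.arg (toC ((1 : ℤ), (1 : ℤ))) = π / 4 := by
    rw [toC_mk]; push_cast; rw [one_mul]; exact arg_one_add_I
  have e3 : Complex.arg (toC ((0 : ℤ), (1 : ℤ))) = π / 2 := by
    rw [toC_mk]; push_cast; simp [Complex.arg_I]
  have e4 : Complex.arg (toC ((-1 : ℤ), (1 : ℤ))) = 3 * π / 4 := by
    rw [toC_mk]; push_cast; rw [one_mul]; exact arg_neg_one_add_I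
  have e5 : Complex.arg (toC ((-1 : ℤ), (0 : ℤ))) = π := by
    rw [toC_mk]; push_cast; simp [Complex.arg_neg_one]
  have e6 : Complex.arg (toC ((-1 : ℤ), (-1 : ℤ))) = -(3 * π / 4) := by
    rw [toC_mk]; push_cast; rw [show (-1 : ℂ) + -1 * Complex.I = -1 - Complex.I by ring]; exact arg_neg_one_sub_I
  have e7 : Complex.arg (toC ((0 : ℤ), (-1 : ℤ))) = -(π / 2) := by
    rw [toC_mk]; push_cast; simp [Complex.arg_neg_I]
  have e8 : Complex.arg (toC ((1 : ℤ), (-1 : ℤ))) = -(π / 4) := by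
    rw [toC_mk]; push_cast; rw [show (1 : ℂ) + -1 * Complex.I = 1 - Complex.I by ring]; exact arg_one_sub_I
  have d := arg_toC_double
  split_ifs at h with h1 h2 h3 h4 h5 h6 h7 h8 <;> simp only [Option.some.injEq] at h <;> (try subst h) <;>
    first
    | (rcases h1 with rfl | rfl <;> [rw [e1]; rw [show ((2:ℤ), (0:ℤ)) = (2 * 1, 2 * 0) by norm_num, d, e1]] <;>
        push_cast <;> ring)
    | (rcases h2 with rfl | rfl <;> [rw [e2]; rw [show ((2:ℤ), (2:ℤ)) = (2 * 1, 2 * 1) by norm_num, d, e2]] <;>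
        push_cast <;> ring)
    | (rcases h3 with rfl | rfl <;> [rw [e3]; rw [show ((0:ℤ), (2:ℤ)) = (2 * 0, 2 * 1) by norm_num, d, e3]] <;>
        push_cast <;> ring)
    | (rcases h4 with rfl | rfl <;> [rw [e4]; rw [show ((-2:ℤ), (2:ℤ)) = (2 * (-1), 2 * 1) by norm_num, d, e4]] <;>
        push_cast <;> ring)
    | (rcases h5 with rfl | rfl <;> [rw [e5]; rw [show ((-2:ℤ), (0:ℤ)) = (2 * (-1), 2 * 0) by norm_num, d, e5]] <;>
        push_cast <;> ring)
    | (rcases h6 with rfl | rfl <;> [rw [e6]; rw [show ((-2:ℤ), (-2:ℤ)) = (2 * (-1), 2 * (-1)) by norm_num, d, e6]] <;>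
        push_cast <;> ring)
    | (rcases h7 with rfl | rfl <;> [rw [e7]; rw [show ((0:ℤ), (-2:ℤ)) = (2 * 0, 2 * (-1)) by norm_num, d, e7]] <;>
        push_cast <;> ring)
    | (rcases h8 with rfl | rfl <;> [rw [e8]; rw [show ((2:ℤ), (-2:ℤ)) = (2 * 1, 2 * (-1)) by norm_num, d, e8]] <;>
        push_cast <;> ring)

/-- The turning between two octants, normalised to `(−4, 4)`. [folklore] -/
def octDiff (m n : ℤ) : ℤ := (n - m + 4) % 8 - 4

/-- ★ **The exterior angle between two short lattice directions** with octants `m`, `n` (not opposite) is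
`octDiff m n · π/4`. [cite: Hopf1935, Nr. 4 eq. (22) (curves with corners: the exterior angle at a corner); lane plumbing] -/
theorem toReal_octant_sub {m n : ℤ} (h : (n - m) % 8 ≠ 4) :
    ((((n : ℝ) * (π / 4) : ℝ) : Real.Angle) - (((m : ℝ) * (π / 4) : ℝ) : Real.Angle)).toReal =
      (octDiff m n : ℝ) * (π / 4) := by
  have hπ := Real.pi_pos
  have h1 : -3 ≤ octDiff m n ∧ octDiff m n ≤ 3 := by unfold octDiff; omega
  have h2 : (n - m : ℤ) = 8 * ((n - m + 4) / 8) + octDiff m n := by unfold octDiff; omega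
  rw [← Real.Angle.coe_sub]
  have e : (((n : ℝ) * (π / 4) - (m : ℝ) * (π / 4) : ℝ) : Real.Angle) = (((octDiff m n : ℝ) * (π / 4) : ℝ) : Real.Angle) := by
    rw [Real.Angle.angle_eq_iff_two_pi_dvd_sub]
    refine ⟨(n - m + 4) / 8, ?_⟩
    have h2' : ((n : ℝ) - m) = 8 * (((n - m + 4) / 8 : ℤ) : ℝ) + (octDiff m n : ℝ) := by exact_mod_cast h2
    linear_combination (π / 4) * h2'
  rw [e]
  have h1' : (-3 : ℝ) ≤ octDiff m n ∧ (octDiff m n : ℝ) ≤ 3 := by exact_mod_cast h1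
  exact Real.Angle.toReal_coe_eq_self_iff.2 ⟨by nlinarith, by nlinarith⟩

/-- The turning (in octants) from direction `u` to direction `v`; junk `0` off the table. [folklore] -/
def turnOct (u v : ℤ × ℤ) : ℤ :=
  match dirOct u, dirOct v with
  | some m, some n => octDiff m n
  | _, _ => 0

/-- Both directions are short lattice directions and not opposite. [folklore] -/
def turnOK (u v : ℤ × ℤ) : Bool :=
  match dirOct u, dirOct v with
  | some m, some n => decide ((n - m) % 8 ≠ 4)
  | _, _ => false

/-- ★ The exterior angle of a lattice polyline at a corner with tabulated directions. [cite: Hopf1935, Nr. 4 eq. (22) (curves with corners: the exterior angle at a corner); lane plumbing] -/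
theorem extAng_eq_turnOct (p : ℕ → ℤ × ℤ) (j : ℕ) (h : turnOK (p (j + 1) - p j) (p (j + 2) - p (j + 1)) = true) :
    extAng p j = (turnOct (p (j + 1) - p j) (p (j + 2) - p (j + 1)) : ℝ) * (π / 4) := by
  unfold turnOK at h
  unfold turnOct extAng
  rw [← toC_sub, ← toC_sub]
  rcases hu : dirOct (p (j + 1) - p j) with _ | m <;> rcases hv : dirOct (p (j + 2) - p (j + 1)) with _ | n <;>
    simp only [hu, hv] at h ⊢
  · simp at h
  · simp at h
  · simp at h
  · rw [arg_toC_of_dirOct hu, arg_toC_of_dirOct hv]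
    exact toReal_octant_sub (by simpa using h)

/-- The total turning (in octants) along a list of points, summed over consecutive triples. [folklore] -/
def triplesTurn : List (ℤ × ℤ) → ℤ
  | a :: b :: c :: rest => turnOct (b - a) (c - b) + triplesTurn (b :: c :: rest)
  | _ => 0

/-- Every consecutive triple of the list has tabulated, non-opposite directions. [folklore] -/
def triplesOK : List (ℤ × ℤ) → Bool
  | a :: b :: c :: rest => turnOK (b - a) (c - b) && triplesOK (b :: c :: rest)
  | _ => true

/-- `triplesTurn` as an indexed sum. [cite: Hopf1935, Nr. 4 eq. (22) (curves with corners: the sum of the exterior angles); lane plumbing] -/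
theorem triplesTurn_eq_sum (l : List (ℤ × ℤ)) :
    (triplesTurn l : ℝ) = ∑ i ∈ Finset.range (l.length - 2),
      (turnOct (l.getD (i + 1) 0 - l.getD i 0) (l.getD (i + 2) 0 - l.getD (i + 1) 0) : ℝ) := by
  induction l with
  | nil => simp [triplesTurn]
  | cons a t ih =>
    match t, ih with
    | [], _ => simp [triplesTurn]
    | [b], _ => simp [triplesTurn]
    | b :: c :: rest, ih =>
      rw [triplesTurn, Int.cast_add, ih]
      rw [show (a :: b :: c :: rest).length - 2 = (b :: c :: rest).length - 2 + 1 by simp,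
        Finset.sum_range_succ']
      simp only [List.getD_cons_succ, List.getD_cons_zero, zero_add]
      ring

/-- `triplesOK` gives `turnOK` at every index. [cite: Hopf1935, Nr. 4 eq. (22) (curves with corners); lane plumbing] -/
theorem turnOK_of_triplesOK {l : List (ℤ × ℤ)} (h : triplesOK l = true) {i : ℕ} (hi : i + 2 < l.length) :
    turnOK (l.getD (i + 1) 0 - l.getD i 0) (l.getD (i + 2) 0 - l.getD (i + 1) 0) = true := by
  induction l generalizing i with
  | nil => simp at hi
  | cons a t ih =>
    match t, ih, h, hi with
    | [], _, _, hi => simp at hi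
    | [b], _, _, hi => simp at hi
    | b :: c :: rest, ih, h, hi =>
      rw [triplesOK, Bool.and_eq_true] at h
      rcases i with _ | i
      · simpa using h.1
      · have := ih h.2 (i := i) (by simp at hi ⊢; omega)
        simpa only [List.getD_cons_succ] using this

end Octants


/-! ## The diagonal cell in the mesh-`4` grid -/

section DiagCoords

variable (w : Face)

/-- The hole is the `NE`-neighbour of the diagonal cell `farSW w`. [cite: GlazmanManolescu2019, §1 (the lattice of rhombi and its mid-edges)] -/
theorem holeFaceW_eq_farSW : holeFaceW w = ((farSW w).1 + 1, (farSW w).2 + 1) := by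
  obtain ⟨k, j⟩ := w
  refine Prod.ext ?_ ?_
  · show k - 1 = k - 2 + 1
    omega
  · show j = j - 1 + 1
    omega

/-- The root midpoint in diagonal-cell coordinates: `midPt (w.side W) = (farSW w).base + (8, 6)`. [folklore] -/
private theorem midPt_root_eq_farSW : midPt (w.side .W) = (farSW w).base + (8, 6) := by
  obtain ⟨k, j⟩ := w
  refine Prod.ext ?_ ?_
  · show 4 * k = 4 * (k - 2) + 8
    omega
  · show 4 * j + 2 = 4 * (j - 1) + 6
    omega

/-- The side midpoints of the diagonal cell. [folklore] -/
private theorem midPt_farSW_side (s : Side) : midPt ((farSW w).side s) = (farSW w).base + s.offset := midPt_side _ _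

/-- The root plaquette in diagonal-cell coordinates. [folklore] -/
private theorem base_root_eq_farSW : w.base = (farSW w).base + (8, 4) := by
  obtain ⟨k, j⟩ := w
  refine Prod.ext ?_ ?_
  · show 4 * k = 4 * (k - 2) + 8
    omega
  · show 4 * j = 4 * (j - 1) + 4
    omega

end DiagCoords

/-- ★ **The safe closing points of the diagonal cell**: inner points of faces other than `farSW w` and the hole are at
squared distance `≥ 5` from every point of `safeOffsets`. [cite: Hopf1935, Nr. 4 eq. (22) (curves with corners); lane plumbing] -/
theorem five_le_dsq_innerPt_safeOffsets {w : Face} (g : Face) (s : Side) (hg : g ≠ farSW w) (hh : g ≠ holeFaceW w)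
    (q : ℤ × ℤ) (hq : q ∈ safeOffsets) : 5 ≤ dsq (innerPt g s) ((farSW w).base + q) := by
  rw [holeFaceW_eq_farSW] at hh
  exact five_le_dsq_innerPt_safe hg hh s hq

namespace YBWalk

variable {D : Set Face} {w : Face} {z : MidEdge}

/-- The second vertex of a walk from the hole root: one unit east of the root midpoint, `(farSW w).base + (9, 6)`.
[cite: GlazmanManolescu2019, §1 and Fig. 1 (the lattice of rhombi, walks between mid-edges); lane plumbing] -/
theorem vtx_one_eq_farSW (hh : holeFaceW w ∉ D) (γ : YBWalk D (w.side .W) z) (hn : 0 < γ.arcs.length) :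
    γ.vtx 1 = (farSW w).base + (9, 6) := by
  have hlen := γ.length_eq
  obtain ⟨hs, -, -⟩ := YBWalk.side_sIn (γ := γ) (i := 0) hn
  rw [← γ.nth_eq_getElem (by omega), γ.nth_zero] at hs
  have hD := (YBWalk.arcFace_arcAt (γ := γ) hn).2
  have hcases := (Face.exists_side_eq_iff (γ.fc 0) (w.side .W)).1 ⟨_, hs⟩
  rw [root_faces_W] at hcases
  simp only at hcases
  rcases hcases with e | e
  · rw [e] at hD; exact absurd hD hh
  · rw [e] at hs
    have hsIn := Face.side_injective w hs
    have ev := YBWalk.vtx_odd (γ := γ) (i := 0) hn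
    rw [show 2 * 0 + 1 = 1 from rfl] at ev
    rw [ev, YBWalk.ptIn, e, hsIn, innerPt, base_root_eq_farSW, add_assoc]
    rfl

/-- ★ **Consecutive vertices of a walk polyline are at squared distance `≤ 4`.** [cite: GlazmanManolescu2019, §2.1 (wind(γ) computed along the drawn curve); lane plumbing] -/
theorem dsq_vtx_succ_le_four (γ : YBWalk D (w.side .W) z) {k : ℕ} (hk : k ≤ 2 * γ.arcs.length) :
    dsq (γ.vtx k) (γ.vtx (k + 1)) ≤ 4 := by
  have hlen := γ.length_eq
  rcases YBWalk.index_cases (γ := γ) k (by omega) with rfl | ⟨i, hi, rfl⟩ | ⟨i, hi, rfl⟩ | h0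
  · rcases Nat.eq_zero_or_pos γ.arcs.length with h0 | hpos
    · rw [YBWalk.vtx_zero, show (0 : ℕ) + 1 = 2 * γ.arcs.length + 1 by omega, YBWalk.vtx_last]
      have : w.side .W = z := by
        have e := γ.nth_length; rw [h0, γ.nth_zero] at e; exact e
      subst this; simp [dsq]
    · rw [YBWalk.vtx_zero, show (0 : ℕ) + 1 = 2 * 0 + 1 from rfl, YBWalk.vtx_odd hpos, YBWalk.ptIn, innerPt_eq,
        (YBWalk.side_sIn hpos).1, ← γ.nth_eq_getElem (by omega), γ.nth_zero, dsq_self_addD]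
      have hb := nIn_boundsD (γ.sIn 0)
      omega
  · rw [YBWalk.vtx_odd hi, show 2 * i + 1 + 1 = 2 * i + 2 by ring, YBWalk.vtx_even hi, YBWalk.ptIn, YBWalk.ptOut,
      innerPt, innerPt, dsq_add_leftD]
    exact dsq_inOff_leD _ _
  · rcases Nat.lt_or_ge (i + 1) γ.arcs.length with hlt | hge
    · rw [YBWalk.vtx_even hi, show 2 * i + 2 + 1 = 2 * (i + 1) + 1 by ring, YBWalk.vtx_odd hlt, YBWalk.ptIn,
        YBWalk.ptOut, innerPt_eq, innerPt_eq, (YBWalk.side_sIn hi).2.1, (YBWalk.side_sIn hlt).1, dsq_add_leftD]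
      exact dsq_nIn_leD _ _
    · have hi' : i + 1 = γ.arcs.length := by omega
      rw [YBWalk.vtx_even hi, show 2 * i + 2 + 1 = 2 * γ.arcs.length + 1 by omega, YBWalk.vtx_last, YBWalk.ptOut,
        innerPt_eq, (YBWalk.side_sIn hi).2.1, ← γ.nth_eq_getElem (by omega), hi', γ.nth_length, dsq_commD,
        dsq_self_addD]
      have hb := nIn_boundsD (γ.sOut i)
      omega
  · omega

/-! ## The closed lattice polygon built on a walk from the hole root and a closing through `d` and `h` -/

section DiagPolygon

variable (γ : YBWalk D (w.side .W) z) (cl : List (ℤ × ℤ))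

/-- **The closed polygon**: the `2n + 2` vertices of the walk polyline followed by the closing points
`(farSW w).base + q`, `q ∈ cl`, periodically. [cite: Hopf1935, Nr. 2 (Umlaufsatz, p. 53) and Nr. 4 eq. (22) (curves with corners, pp. 60–61)] -/
def diagCyc (j : ℕ) : ℤ × ℤ :=
  if j % (2 * γ.arcs.length + 2 + cl.length) ≤ 2 * γ.arcs.length + 1 then
    γ.vtx (j % (2 * γ.arcs.length + 2 + cl.length))
  else (farSW w).base + cl.getD (j % (2 * γ.arcs.length + 2 + cl.length) - (2 * γ.arcs.length + 2)) 0

variable {γ cl}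

/-- The polygon is periodic. [folklore] -/
private theorem diagCyc_add (j : ℕ) : diagCyc γ cl (j + (2 * γ.arcs.length + 2 + cl.length)) = diagCyc γ cl j := by
  unfold diagCyc; rw [Nat.add_mod_right]

/-- The walk part of the polygon. [folklore] -/
private theorem diagCyc_of_le {j : ℕ} (hj : j ≤ 2 * γ.arcs.length + 1) : diagCyc γ cl j = γ.vtx j := by
  unfold diagCyc; rw [Nat.mod_eq_of_lt (by omega), if_pos hj]

/-- The closing part of the polygon. [folklore] -/
private theorem diagCyc_cl {t : ℕ} (ht : t < cl.length) :
    diagCyc γ cl (2 * γ.arcs.length + 2 + t) = (farSW w).base + cl.getD t 0 := by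
  unfold diagCyc
  rw [Nat.mod_eq_of_lt (by omega), if_neg (by omega)]
  congr 2; omega

/-- After the closing the polygon returns to the root midpoint… [folklore] -/
private theorem diagCyc_period : diagCyc γ cl (2 * γ.arcs.length + 2 + cl.length) = γ.vtx 0 := by
  rw [show 2 * γ.arcs.length + 2 + cl.length = 0 + (2 * γ.arcs.length + 2 + cl.length) by ring, diagCyc_add,
    diagCyc_of_le (by omega)]

/-- … and then to the second vertex of the walk. [folklore] -/
private theorem diagCyc_period_succ : diagCyc γ cl (2 * γ.arcs.length + 2 + cl.length + 1) = γ.vtx 1 := by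
  rw [show 2 * γ.arcs.length + 2 + cl.length + 1 = 1 + (2 * γ.arcs.length + 2 + cl.length) by ring, diagCyc_add,
    diagCyc_of_le (by omega)]

set_option maxHeartbeats 400000 in
/-- ★★ **Hopf's hypotheses from finite tables.** Let the walk's inner vertices be inner points of faces other than
a cell `c` and the hole `h`, except for vertices at the listed special offsets `sp`; let `safe` be a list of closing
offsets at squared distance `≥ 5` from every inner point of a face other than `c`, `h`; let the last vertex sit at
offset `oL`; and let the closing offsets `cl` pass the finite tables (safe and fresh points; no repeated point;
short closing edges seen acutely from every special or closing point; short special chords seen acutely from every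
closing point). Then the closed polygon is injective on a period and every edge is seen from every vertex off it
under an angle `< π/2`, so the tree's discrete Umlaufsatz applies: **the exterior angles add up to `±2π`.**
[cite: Hopf1935, Nr. 2 (Umlaufsatz, p. 53) and Nr. 4 eq. (22) (curves with corners, pp. 60–61)] -/
theorem diagCyc_hopf (hn : 0 < γ.arcs.length) (c : Face) (safe sp : List (ℤ × ℤ)) (oL : ℤ × ℤ)
    (hsafe : ∀ (g : Face) (s : Side), g ≠ c → g ≠ holeFaceW w → ∀ q ∈ safe,
      5 ≤ dsq (innerPt g s) ((farSW w).base + q))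
    (hgen : ∀ j, 1 ≤ j → j ≤ 2 * γ.arcs.length →
      (∃ g s, g ≠ c ∧ g ≠ holeFaceW w ∧ γ.vtx j = innerPt g s) ∨ ∃ p ∈ sp, γ.vtx j = (farSW w).base + p)
    (hL : γ.vtx (2 * γ.arcs.length + 1) = (farSW w).base + oL)
    (hcl : cl ≠ [])
    (hT1 : ∀ q ∈ cl, q ∈ safe ∧ q ∉ sp ++ [oL, (8, 6)])
    (hT2 : cl.Nodup)
    (hT3 : ∀ i < cl.length + 1,
      dsq ((oL :: (cl ++ [(8, 6)])).getD i 0) ((oL :: (cl ++ [(8, 6)])).getD (i + 1) 0) ≤ 4 ∧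
        ∀ p ∈ sp ++ [oL, (8, 6)] ++ cl, p ≠ (oL :: (cl ++ [(8, 6)])).getD i 0 →
          p ≠ (oL :: (cl ++ [(8, 6)])).getD (i + 1) 0 →
            dsq ((oL :: (cl ++ [(8, 6)])).getD i 0) ((oL :: (cl ++ [(8, 6)])).getD (i + 1) 0) <
              dsq ((oL :: (cl ++ [(8, 6)])).getD i 0) p + dsq ((oL :: (cl ++ [(8, 6)])).getD (i + 1) 0) p)
    (hT4 : ∀ p ∈ sp ++ [oL, (8, 6)], ∀ p' ∈ sp ++ [oL, (8, 6)], p ≠ p' → dsq p p' ≤ 4 →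
      ∀ q ∈ cl, dsq p p' < dsq p q + dsq p' q) :
    ∑ v ∈ Finset.range (2 * γ.arcs.length + 2 + cl.length), extAng (diagCyc γ cl) v = 2 * π ∨
      ∑ v ∈ Finset.range (2 * γ.arcs.length + 2 + cl.length), extAng (diagCyc γ cl) v = -(2 * π) := by
  set n := γ.arcs.length with hn'
  set K := cl.length with hK
  set b := (farSW w).base with hb
  set path : List (ℤ × ℤ) := oL :: (cl ++ [(8, 6)]) with hpath
  have hK0 : 0 < K := by rw [hK]; exact List.length_pos_iff.2 hcl
  have hpathlen : path.length = K + 2 := by simp [hpath, hK]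
  have h0 : γ.vtx 0 = b + (8, 6) := by rw [YBWalk.vtx_zero, midPt_root_eq_farSW]
  -- classification of the walk vertices
  have hclass : ∀ j, j ≤ 2 * n + 1 →
      (∃ g s, g ≠ c ∧ g ≠ holeFaceW w ∧ γ.vtx j = innerPt g s) ∨
        ∃ p ∈ sp ++ [oL, (8, 6)], γ.vtx j = b + p := by
    intro j hj
    rcases Nat.eq_zero_or_pos j with rfl | hj0
    · exact Or.inr ⟨(8, 6), by simp, h0⟩
    rcases Nat.lt_or_ge j (2 * n + 1) with hlt | hge
    · rcases hgen j hj0 (by omega) with hg | ⟨p, hp, e⟩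
      · exact Or.inl hg
      · exact Or.inr ⟨p, by simp [hp], e⟩
    · have hj' : j = 2 * n + 1 := by omega
      subst hj'
      exact Or.inr ⟨oL, by simp, hL⟩
  -- distances from walk vertices to closing points
  have hfar : ∀ j, j ≤ 2 * n + 1 → ∀ q ∈ cl,
      1 ≤ dsq (γ.vtx j) (b + q) ∧
        ((∃ g s, g ≠ c ∧ g ≠ holeFaceW w ∧ γ.vtx j = innerPt g s) → 5 ≤ dsq (γ.vtx j) (b + q)) := by
    intro j hj q hq
    obtain ⟨hqs, hqn⟩ := hT1 q hq
    have hgen5 : (∃ g s, g ≠ c ∧ g ≠ holeFaceW w ∧ γ.vtx j = innerPt g s) → 5 ≤ dsq (γ.vtx j) (b + q) := by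
      rintro ⟨g, s, hg, hg', e⟩
      rw [e, hb]
      exact hsafe g s hg hg' q hqs
    refine ⟨?_, hgen5⟩
    rcases hclass j hj with hg | ⟨p, hp, e⟩
    · have := hgen5 hg; omega
    · rw [e, dsq_add_leftD]
      refine one_le_dsq_of_neD fun hpq => hqn ?_
      rw [← hpq]; exact hp
  -- the closing vertices read through `path`
  have hpath_get : ∀ i, i ≤ K + 1 → diagCyc γ cl (2 * n + 1 + i) = b + path.getD i 0 := by
    intro i hi
    rcases Nat.eq_zero_or_pos i with rfl | hi0
    · rw [add_zero, diagCyc_of_le le_rfl, hL]; rfl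
    rcases Nat.lt_or_ge i (K + 1) with hlt | hge
    · obtain ⟨t, rfl⟩ : ∃ t, i = t + 1 := ⟨i - 1, by omega⟩
      rw [show 2 * n + 1 + (t + 1) = 2 * n + 2 + t by omega, diagCyc_cl (by omega), hpath, List.getD_cons_succ]
      congr 1
      rw [List.getD_eq_getElem?_getD, List.getD_eq_getElem?_getD, List.getElem?_append_left (by omega)]
    · have hi' : i = K + 1 := by omega
      subst hi'
      rw [show 2 * n + 1 + (K + 1) = 2 * n + 2 + K by ring, diagCyc_period, h0, hpath]
      congr 1
      rw [List.getD_cons_succ, List.getD_eq_getElem?_getD, List.getElem?_append_right (by omega)]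
      simp [hK]
  -- every closing vertex proper is `b + q` with `q ∈ cl`
  have hclv : ∀ i, 2 * n + 2 ≤ i → i < 2 * n + 2 + K →
      ∃ q ∈ cl, diagCyc γ cl i = b + q ∧ q = cl.getD (i - (2 * n + 2)) 0 := by
    intro i hi1 hi2
    refine ⟨cl.getD (i - (2 * n + 2)) 0, ?_, ?_, rfl⟩
    · rw [List.getD_eq_getElem' (by omega)]; exact List.getElem_mem _
    · rw [show i = 2 * n + 2 + (i - (2 * n + 2)) by omega, diagCyc_cl (by omega)]
      congr 2; omega
  -- injectivity
  have hinj : ∀ i j, i < 2 * n + 2 + K → j < 2 * n + 2 + K → diagCyc γ cl i = diagCyc γ cl j → i = j := by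
    intro i j hi hj e
    by_contra hij
    have key : ∀ i j, i < 2 * n + 2 + K → j < 2 * n + 2 + K → i ≠ j → diagCyc γ cl i = diagCyc γ cl j →
        i ≤ 2 * n + 1 → False := by
      intro i j hi hj hij e hiw
      rcases Nat.lt_or_ge j (2 * n + 2) with hjw | hjc
      · rw [diagCyc_of_le hiw, diagCyc_of_le (by omega)] at e
        exact hij (YBWalk.vtx_injective (γ := γ) (by omega) (by omega) hn e)
      · obtain ⟨q, hq, ej, -⟩ := hclv j hjc hj
        rw [diagCyc_of_le hiw, ej] at e
        have h1 := (hfar i hiw q hq).1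
        rw [e, dsq_selfD] at h1
        omega
    rcases Nat.lt_or_ge i (2 * n + 2) with hiw | hic
    · exact key i j hi hj hij e (by omega)
    rcases Nat.lt_or_ge j (2 * n + 2) with hjw | hjc
    · exact key j i hj hi (Ne.symm hij) e.symm (by omega)
    obtain ⟨q, -, ei, hqi⟩ := hclv i hic hi
    obtain ⟨q', -, ej, hqj⟩ := hclv j hjc hj
    rw [ei, ej] at e
    have hqq : q = q' := add_left_cancel e
    rw [hqi, hqj, List.getD_eq_getElem' (by omega), List.getD_eq_getElem' (by omega)] at hqq
    have := (List.Nodup.getElem_inj_iff hT2).1 hqq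
    omega
  -- subtendedness
  have hsub : ∀ k j, k < 2 * n + 2 + K → j < 2 * n + 2 + K → diagCyc γ cl j ≠ diagCyc γ cl k →
      diagCyc γ cl j ≠ diagCyc γ cl (k + 1) →
        0 < sdot (diagCyc γ cl k) (diagCyc γ cl (k + 1)) (diagCyc γ cl j) := by
    intro k j hk hj hne1 hne2
    by_cases hall : k + 1 ≤ 2 * n + 1 ∧ j ≤ 2 * n + 1
    · -- walk against walk
      have ek : diagCyc γ cl k = γ.vtx k := diagCyc_of_le (by omega)
      have ek1 : diagCyc γ cl (k + 1) = γ.vtx (k + 1) := diagCyc_of_le hall.1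
      have ej : diagCyc γ cl j = γ.vtx j := diagCyc_of_le hall.2
      rw [ej, ek] at hne1
      rw [ej, ek1] at hne2
      rw [ek, ek1, ej]
      refine YBWalk.subtended (γ := γ) (by omega) (by omega) ?_ ?_ hn
      · intro e; exact hne1 (by rw [e])
      · intro e; exact hne2 (by rw [e])
    apply sdot_pos_of_dsqD
    rcases Nat.lt_or_ge k (2 * n + 1) with hkw | hkc
    · -- a walk edge `[vtx k, vtx (k+1)]`; the vertex is a closing point `b + q`
      have hjc : 2 * n + 2 ≤ j := by
        by_contra hjc
        exact hall ⟨by omega, by omega⟩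
      obtain ⟨q, hq, ej, -⟩ := hclv j hjc hj
      have ek : diagCyc γ cl k = γ.vtx k := diagCyc_of_le (by omega)
      have ek1 : diagCyc γ cl (k + 1) = γ.vtx (k + 1) := diagCyc_of_le (by omega)
      rw [ek, ek1, ej]
      have hAB := dsq_vtx_succ_le_four γ (k := k) (by omega)
      obtain ⟨hA1, hA5⟩ := hfar k (by omega) q hq
      obtain ⟨hB1, hB5⟩ := hfar (k + 1) (by omega) q hq
      rcases hclass k (by omega) with hgA | ⟨p, hp, eA⟩
      · have := hA5 hgA; omega
      rcases hclass (k + 1) (by omega) with hgB | ⟨p', hp', eB⟩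
      · have := hB5 hgB; omega
      have hpp : p ≠ p' := by
        intro e
        have : γ.vtx k = γ.vtx (k + 1) := by rw [eA, eB, e]
        have := YBWalk.vtx_injective (γ := γ) (by omega) (by omega) hn this
        omega
      rw [eA, eB, dsq_add_leftD] at hAB
      rw [eA, eB, dsq_add_leftD, dsq_add_leftD, dsq_add_leftD]
      exact hT4 p hp p' hp' hpp hAB q hq
    · -- a closing edge `[path i, path (i+1)]`, `i = k - (2n+1)`
      set i := k - (2 * n + 1) with hi
      have hiK : i < K + 1 := by omega
      have ek : diagCyc γ cl k = b + path.getD i 0 := by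
        rw [show k = 2 * n + 1 + i by omega]; exact hpath_get i (by omega)
      have ek1 : diagCyc γ cl (k + 1) = b + path.getD (i + 1) 0 := by
        rcases Nat.lt_or_ge (k + 1) (2 * n + 2 + K) with hlt | hge
        · rw [show k + 1 = 2 * n + 1 + (i + 1) by omega]; exact hpath_get (i + 1) (by omega)
        · rw [show k + 1 = 0 + (2 * n + 2 + K) by omega, diagCyc_add, diagCyc_of_le (by omega), h0]
          have hi' : i + 1 = K + 1 := by omega
          rw [hi', hpath, List.getD_cons_succ, List.getD_eq_getElem?_getD, List.getElem?_append_right (by omega)]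
          simp [hK]
      obtain ⟨hABle, htab⟩ := hT3 i hiK
      rw [ek, ek1, dsq_add_leftD]
      rw [ek] at hne1
      rw [ek1] at hne2
      have hend : path.getD i 0 ∈ cl ∨ path.getD (i + 1) 0 ∈ cl := by
        rcases Nat.eq_zero_or_pos i with h0i | hi0
        · right
          rw [h0i, hpath, zero_add, List.getD_cons_succ, List.getD_eq_getElem?_getD,
            List.getElem?_append_left (by omega), ← List.getD_eq_getElem?_getD, List.getD_eq_getElem' (by omega)]
          exact List.getElem_mem _
        · left
          rw [hpath, show i = (i - 1) + 1 by omega, List.getD_cons_succ, List.getD_eq_getElem?_getD,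
            List.getElem?_append_left (by omega), ← List.getD_eq_getElem?_getD, List.getD_eq_getElem' (by omega)]
          exact List.getElem_mem _
      rcases Nat.lt_or_ge j (2 * n + 2) with hjw | hjc
      · rw [diagCyc_of_le (by omega)] at hne1 hne2 ⊢
        rcases hclass j (by omega) with hg | ⟨p, hp, eJ⟩
        · rcases hend with hA | hB
          · have h5 := (hfar j (by omega) _ hA).2 hg
            have h1 : 1 ≤ dsq (γ.vtx j) (b + path.getD (i + 1) 0) := one_le_dsq_of_neD hne2
            rw [dsq_commD] at h5 h1
            omega
          · have h5 := (hfar j (by omega) _ hB).2 hg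
            have h1 : 1 ≤ dsq (γ.vtx j) (b + path.getD i 0) := one_le_dsq_of_neD hne1
            rw [dsq_commD] at h5 h1
            omega
        · rw [eJ, dsq_add_leftD, dsq_add_leftD]
          rw [eJ] at hne1 hne2
          exact htab p (List.mem_append_left _ hp) (fun e => hne1 (by rw [e])) (fun e => hne2 (by rw [e]))
      · obtain ⟨q, hq, eJ, -⟩ := hclv j hjc hj
        rw [eJ, dsq_add_leftD, dsq_add_leftD]
        rw [eJ] at hne1 hne2
        exact htab q (List.mem_append_right _ hq) (fun e => hne1 (by rw [e])) (fun e => hne2 (by rw [e]))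
  exact hopf_cyclic_int (diagCyc γ cl) (N := 2 * n + 2 + K) (by omega) (fun j => diagCyc_add j) hinj hsub

/-- ★★ **The exterior angles of the closed polygon add up to the walk's right-angle winding plus the tabulated
closing turn** `triplesTurn (oP :: oL :: cl ++ [(8,6), (9,6)]) · π/4` (`oP`, `oL` the offsets of the last two walk
vertices). [cite: Hopf1935, Nr. 2 (Umlaufsatz, p. 53) and Nr. 4 eq. (22) (curves with corners, pp. 60–61)] -/
theorem sum_extAng_diagCyc (hh : holeFaceW w ∉ D) (hn : 0 < γ.arcs.length) (oP oL : ℤ × ℤ)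
    (hP : γ.vtx (2 * γ.arcs.length) = (farSW w).base + oP)
    (hL : γ.vtx (2 * γ.arcs.length + 1) = (farSW w).base + oL) (hcl : cl ≠ [])
    (hOK : triplesOK (oP :: oL :: (cl ++ [(8, 6), (9, 6)])) = true) :
    ∑ v ∈ Finset.range (2 * γ.arcs.length + 2 + cl.length), extAng (diagCyc γ cl) v =
      γ.winding (fun _ => π / 2) + (triplesTurn (oP :: oL :: (cl ++ [(8, 6), (9, 6)])) : ℝ) * (π / 4) := by
  set n := γ.arcs.length with hn'
  set K := cl.length with hK
  set b := (farSW w).base with hb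
  set pts : List (ℤ × ℤ) := oP :: oL :: (cl ++ [(8, 6), (9, 6)]) with hpts
  have hK0 : 0 < K := by rw [hK]; exact List.length_pos_iff.2 hcl
  have hptslen : pts.length = K + 4 := by simp [hpts, hK]
  have h0 : γ.vtx 0 = b + (8, 6) := by rw [YBWalk.vtx_zero, midPt_root_eq_farSW]
  have h1 : γ.vtx 1 = b + (9, 6) := vtx_one_eq_farSW hh γ hn
  have hwalk : ∑ v ∈ Finset.range (2 * n), extAng (diagCyc γ cl) v = γ.winding (fun _ => π / 2) := by
    rw [← YBWalk.sum_ext_angles_eq_winding (γ := γ)]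
    refine Finset.sum_congr rfl fun v hv => ?_
    rw [Finset.mem_range] at hv
    simp only [extAng, YBWalk.cvtx, diagCyc_of_le (show v ≤ 2 * n + 1 by omega),
      diagCyc_of_le (show v + 1 ≤ 2 * n + 1 by omega), diagCyc_of_le (show v + 2 ≤ 2 * n + 1 by omega)]
  have hget : ∀ i, i ≤ K + 3 → diagCyc γ cl (2 * n + i) = b + pts.getD i 0 := by
    intro i hi
    rcases (show i = 0 ∨ i = 1 ∨ (2 ≤ i ∧ i ≤ K + 1) ∨ i = K + 2 ∨ i = K + 3 by omega) with
      rfl | rfl | ⟨hi2, hi3⟩ | rfl | rfl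
    · rw [add_zero, diagCyc_of_le (by omega), hP]; rfl
    · rw [diagCyc_of_le (by omega), hL]; rfl
    · obtain ⟨t, rfl⟩ : ∃ t, i = t + 2 := ⟨i - 2, by omega⟩
      rw [show 2 * n + (t + 2) = 2 * n + 2 + t by omega, diagCyc_cl (by omega), hpts,
        List.getD_cons_succ, List.getD_cons_succ]
      congr 1
      rw [List.getD_eq_getElem?_getD, List.getD_eq_getElem?_getD, List.getElem?_append_left (by omega)]
    · rw [show 2 * n + (K + 2) = 2 * n + 2 + K by ring, diagCyc_period, h0, hpts, List.getD_cons_succ,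
        List.getD_cons_succ, List.getD_eq_getElem?_getD, List.getElem?_append_right (by omega)]
      simp [hK]
    · rw [show 2 * n + (K + 3) = 2 * n + 2 + K + 1 by ring, diagCyc_period_succ, h1, hpts, List.getD_cons_succ,
        List.getD_cons_succ, List.getD_eq_getElem?_getD, List.getElem?_append_right (by omega)]
      simp [hK]
  rw [show 2 * n + 2 + K = 2 * n + (K + 2) by ring, Finset.sum_range_add, hwalk, triplesTurn_eq_sum, hptslen,
    show K + 4 - 2 = K + 2 by omega, Finset.sum_mul]
  congr 1
  refine Finset.sum_congr rfl fun i hi => ?_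
  rw [Finset.mem_range] at hi
  have hOKi := turnOK_of_triplesOK hOK (i := i) (by rw [hptslen]; omega)
  have e0 := hget i (by omega)
  have e1 := hget (i + 1) (by omega)
  have e2 := hget (i + 2) (by omega)
  rw [show 2 * n + (i + 1) = 2 * n + i + 1 by ring] at e1
  rw [show 2 * n + (i + 2) = 2 * n + i + 2 by ring] at e2
  have key := extAng_eq_turnOct (diagCyc γ cl) (2 * n + i)
  rw [e0, e1, e2, add_sub_add_left_eq_sub, add_sub_add_left_eq_sub] at key
  exact key hOKi

end DiagPolygon

end YBWalk


/-! ## The prefix and the whole walk of a class-`B2a` walk at the diagonal cell -/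

section DiagCell

variable (w : Face)

/-- The root is not a side of the diagonal cell. [folklore] -/
private theorem farSW_side_ne_root (t : Side) : (farSW w).side t ≠ w.side .W := by
  obtain ⟨k, j⟩ := w
  cases t <;> simp only [farSW, Face.side, ne_eq, MidEdge.vert.injEq, reduceCtorEq, not_false_eq_true] <;> omega

/-- The diagonal cell is a rooted rhombus of the hole root as soon as it lies in the domain and the hole does not.
[cite: GlazmanManolescu2019, Lemma 2.1 (setting: a rhombus of the domain and a boundary root)] -/
theorem rootedFace_farSW {D : Set Face} {w : Face} (hf : farSW w ∈ D) (hh : holeFaceW w ∉ D) :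
    RootedFace D (w.side .W) (farSW w) := by
  refine ⟨hf, ?_⟩
  rw [root_faces_W]
  exact fun hb => hh hb.1

end DiagCell

namespace YBWalk

variable {D : Set Face} {a : MidEdge}

/-- The `i`-th arc read through `nth`. [cite: GlazmanManolescu2019, §1 (the lattice of rhombi and its mid-edges)] -/
private theorem arcFace_nth_eq_some_fcD {z : MidEdge} (γ : YBWalk D a z) {i : ℕ} (hi : i < γ.arcs.length) :
    arcFace (γ.nth i, γ.nth (i + 1)) = some (γ.fc i) := by
  have h1 := (YBWalk.arcFace_arcAt (γ := γ) hi).1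
  have hl := γ.length_eq
  rwa [YBWalk.arcAt_eq hi, ← γ.nth_eq_getElem (by omega), ← γ.nth_eq_getElem (by omega)] at h1

end YBWalk

/-- Two faces sharing a side: the sides are opposite. [folklore] -/
private theorem side_eq_opp_of_side_eqD {g f : Face} {s t : Side} (h : g.side s = f.side t) (hg : g ≠ f) :
    s = t.opp := by
  obtain ⟨k, j⟩ := g
  obtain ⟨k', j'⟩ := f
  have hne : ¬(k = k' ∧ j = j') := fun e => hg (Prod.ext e.1 e.2)
  cases s <;> cases t <;>
    simp only [Face.side, MidEdge.vert.injEq, MidEdge.slant.injEq, reduceCtorEq, Side.opp] at h ⊢ <;> omega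

/-- Opposite sides have opposite inward normals. [folklore] -/
private theorem nIn_oppD (s : Side) : s.opp.nIn = -s.nIn := by
  cases s <;> simp [Side.opp, Side.nIn]

/-- `opp` is an involution. [folklore] -/
private theorem side_opp_oppD (s : Side) : s.opp.opp = s := by cases s <;> rfl

namespace ΩG

variable {D : Set Face} {w : Face}

section PrefixD

variable (ω : ΩG D (w.side .W) (farSW w))

/-- The PREFIX of a class-`B2a` walk at the diagonal cell: its first `firstHitG` arcs.
[cite: Glazman2015WeightedSAW, Lemma 3.1 (proof, pp. 6–7: the classes of walks through a rhombus)] -/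
def preD (h : ω.IsB2a) : YBWalk D (w.side .W) (ω.2.nth ω.2.firstHitG) :=
  ω.2.take ω.2.firstHitG (ω.fh_lt h).le

variable {ω}

/-- The prefix has `firstHitG` arcs. [folklore] -/
private theorem preD_length (h : ω.IsB2a) : (ω.preD h).arcs.length = ω.2.firstHitG := YBWalk.take_length _ _ _

/-- The mid-edges of the prefix. [folklore] -/
private theorem preD_nth (h : ω.IsB2a) {i : ℕ} (hi : i ≤ ω.2.firstHitG) : (ω.preD h).nth i = ω.2.nth i :=
  YBWalk.take_nth _ _ _ hi

/-- **The turning of the prefix is `WP`.** [cite: GlazmanManolescu2019, Lemma 2.1 (proof: [Gl])] -/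
theorem preD_winding (h : ω.IsB2a) (Θ : ℤ → ℝ) : (ω.preD h).winding Θ = ω.WP Θ := by
  unfold YBWalk.winding ΩG.WP
  rw [preD, YBWalk.take_arcs]

/-- The prefix is not empty. [folklore] -/
private theorem fhD_pos (ω : ΩG D (w.side .W) (farSW w)) : 0 < ω.2.firstHitG := by
  by_contra h0
  push Not at h0
  have e := ω.2.nth_firstHitG
  rw [Nat.le_zero.1 h0, ω.2.nth_zero] at e
  exact farSW_side_ne_root w _ e.symm

/-- The faces of the prefix arcs lie in the domain and are neither the diagonal cell nor the hole.
[cite: Glazman2015WeightedSAW, Lemma 3.1 (proof, pp. 6–7: the classes of walks through a rhombus)] -/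
theorem preD_fc (hh : holeFaceW w ∉ D) (h : ω.IsB2a) {i : ℕ} (hi : i < ω.2.firstHitG) :
    (ω.preD h).fc i ∈ D ∧ (ω.preD h).fc i ≠ farSW w ∧ (ω.preD h).fc i ≠ holeFaceW w := by
  have hlen := preD_length (ω := ω) h
  have hD := (YBWalk.arcFace_arcAt (γ := ω.preD h) (i := i) (by rw [hlen]; exact hi)).2
  refine ⟨hD, fun e => ?_, fun e => hh (e ▸ hD)⟩
  have h1 := (ω.preD h).arcFace_nth_eq_some_fcD (i := i) (by rw [hlen]; exact hi)
  rw [preD_nth h hi.le, preD_nth h hi, e] at h1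
  exact ω.2.arcFace_ne_of_lt_firstHitG hi (by have := ω.fh_lt h; omega) h1

/-- The last arc of the prefix leaves its face through the side opposite to the first side `z₀` of the cell.
[cite: Glazman2015WeightedSAW, Lemma 3.1 (proof, pp. 6–7)] -/
theorem preD_sOut_last (hh : holeFaceW w ∉ D) (h : ω.IsB2a) :
    (ω.preD h).sOut (ω.2.firstHitG - 1) = ω.2.firstSideG.opp ∧
      ((ω.preD h).fc (ω.2.firstHitG - 1)).side ((ω.preD h).sOut (ω.2.firstHitG - 1)) =
        (farSW w).side ω.2.firstSideG := by
  have hlen := preD_length (ω := ω) h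
  have hfh := fhD_pos ω
  obtain ⟨-, ht, -⟩ := YBWalk.side_sIn (γ := ω.preD h) (i := ω.2.firstHitG - 1) (by rw [hlen]; omega)
  have e1 : ω.2.firstHitG - 1 + 1 = ω.2.firstHitG := by omega
  rw [← (ω.preD h).nth_eq_getElem (by rw [(ω.preD h).length_eq, hlen]; omega)] at ht
  simp only [e1] at ht
  rw [preD_nth h le_rfl] at ht
  have ht' := ht.trans ω.2.nth_firstHitG
  exact ⟨side_eq_opp_of_side_eqD ht' (preD_fc hh h (by omega)).2.1, ht'⟩

/-- The inner vertices of the prefix polyline are inner points of faces other than the cell and the hole.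
[folklore] -/
private theorem preD_vtx_generic (hh : holeFaceW w ∉ D) (h : ω.IsB2a) {j : ℕ} (hj1 : 1 ≤ j)
    (hj2 : j ≤ 2 * (ω.preD h).arcs.length) :
    (∃ g s, g ≠ farSW w ∧ g ≠ holeFaceW w ∧ (ω.preD h).vtx j = innerPt g s) ∨
      ∃ p ∈ ([] : List (ℤ × ℤ)), (ω.preD h).vtx j = (farSW w).base + p := by
  left
  have hlen := preD_length (ω := ω) h
  rcases YBWalk.index_cases (γ := ω.preD h) j (by omega) with h0 | ⟨i, hi, rfl⟩ | ⟨i, hi, rfl⟩ | h0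
  · omega
  · obtain ⟨-, h1, h2⟩ := preD_fc hh h (i := i) (by rw [← hlen]; exact hi)
    exact ⟨_, _, h1, h2, YBWalk.vtx_odd hi⟩
  · obtain ⟨-, h1, h2⟩ := preD_fc hh h (i := i) (by rw [← hlen]; exact hi)
    exact ⟨_, _, h1, h2, YBWalk.vtx_even hi⟩
  · omega

/-- The last vertex of the prefix polyline: the midpoint of the first side. [folklore] -/
private theorem preD_vtx_last (h : ω.IsB2a) :
    (ω.preD h).vtx (2 * (ω.preD h).arcs.length + 1) = (farSW w).base + ω.2.firstSideG.offset := by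
  rw [YBWalk.vtx_last, ω.2.nth_firstHitG, midPt_farSW_side]

/-- The last-but-one vertex of the prefix polyline: one unit outside the first side. [folklore] -/
private theorem preD_vtx_penult (hh : holeFaceW w ∉ D) (h : ω.IsB2a) :
    (ω.preD h).vtx (2 * (ω.preD h).arcs.length) =
      (farSW w).base + (ω.2.firstSideG.offset - ω.2.firstSideG.nIn) := by
  have hlen := preD_length (ω := ω) h
  have hfh := fhD_pos ω
  have e := YBWalk.vtx_even (γ := ω.preD h) (i := ω.2.firstHitG - 1) (by rw [hlen]; omega)
  rw [show 2 * (ω.2.firstHitG - 1) + 2 = 2 * ω.2.firstHitG by omega] at e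
  obtain ⟨hs, ht⟩ := preD_sOut_last hh h
  rw [hlen, e, YBWalk.ptOut, innerPt_eq, ht, hs, midPt_farSW_side, nIn_oppD, add_assoc, ← sub_eq_add_neg]

/-- ★★ **Hopf for the closed PREFIX polygon at the diagonal cell**: for every closing list passing the finite tables
(no special vertices: the prefix avoids the cell and the hole), `WP(π/2) + T·π/4 = ±2π`, `T` the tabulated closing
turn. [cite: Hopf1935, Nr. 2 (Umlaufsatz, p. 53) and Nr. 4 eq. (22) (curves with corners, pp. 60–61)]
[cite: GlazmanManolescu2019, Lemma 2.1 (proof: [Gl])] -/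
theorem WP_hopf_of_tables (hh : holeFaceW w ∉ D) (h : ω.IsB2a) (cl : List (ℤ × ℤ)) (hcl : cl ≠ [])
    (hT1 : ∀ q ∈ cl, q ∈ safeOffsets ∧ q ∉ ([] : List (ℤ × ℤ)) ++ [ω.2.firstSideG.offset, (8, 6)])
    (hT2 : cl.Nodup)
    (hT3 : ∀ i < cl.length + 1,
      dsq ((ω.2.firstSideG.offset :: (cl ++ [(8, 6)])).getD i 0)
          ((ω.2.firstSideG.offset :: (cl ++ [(8, 6)])).getD (i + 1) 0) ≤ 4 ∧
        ∀ p ∈ ([] : List (ℤ × ℤ)) ++ [ω.2.firstSideG.offset, (8, 6)] ++ cl,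
          p ≠ (ω.2.firstSideG.offset :: (cl ++ [(8, 6)])).getD i 0 →
          p ≠ (ω.2.firstSideG.offset :: (cl ++ [(8, 6)])).getD (i + 1) 0 →
            dsq ((ω.2.firstSideG.offset :: (cl ++ [(8, 6)])).getD i 0)
                ((ω.2.firstSideG.offset :: (cl ++ [(8, 6)])).getD (i + 1) 0) <
              dsq ((ω.2.firstSideG.offset :: (cl ++ [(8, 6)])).getD i 0) p +
                dsq ((ω.2.firstSideG.offset :: (cl ++ [(8, 6)])).getD (i + 1) 0) p)
    (hT4 : ∀ p ∈ ([] : List (ℤ × ℤ)) ++ [ω.2.firstSideG.offset, (8, 6)],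
      ∀ p' ∈ ([] : List (ℤ × ℤ)) ++ [ω.2.firstSideG.offset, (8, 6)], p ≠ p' → dsq p p' ≤ 4 →
        ∀ q ∈ cl, dsq p p' < dsq p q + dsq p' q)
    (hOK : triplesOK ((ω.2.firstSideG.offset - ω.2.firstSideG.nIn) :: ω.2.firstSideG.offset ::
      (cl ++ [(8, 6), (9, 6)])) = true) :
    ω.WP (fun _ => π / 2) + (triplesTurn ((ω.2.firstSideG.offset - ω.2.firstSideG.nIn) ::
        ω.2.firstSideG.offset :: (cl ++ [(8, 6), (9, 6)])) : ℝ) * (π / 4) = 2 * π ∨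
      ω.WP (fun _ => π / 2) + (triplesTurn ((ω.2.firstSideG.offset - ω.2.firstSideG.nIn) ::
        ω.2.firstSideG.offset :: (cl ++ [(8, 6), (9, 6)])) : ℝ) * (π / 4) = -(2 * π) := by
  have hlen := preD_length (ω := ω) h
  have hn : 0 < (ω.preD h).arcs.length := by rw [hlen]; exact fhD_pos ω
  have key := YBWalk.diagCyc_hopf (γ := ω.preD h) (cl := cl) hn (farSW w) safeOffsets [] ω.2.firstSideG.offset
    five_le_dsq_innerPt_safeOffsets (fun j hj1 hj2 => preD_vtx_generic hh h hj1 hj2) (preD_vtx_last h) hcl hT1 hT2 hT3 hT4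
  rwa [YBWalk.sum_extAng_diagCyc hh hn _ _ (preD_vtx_penult hh h) (preD_vtx_last h) hcl hOK, preD_winding] at key

end PrefixD

section WholeD

variable {ω : ΩG D (w.side .W) (farSW w)}

/-- In class `B2a` the walk has at least `firstHitG + 3` arcs. [cite: Glazman2015WeightedSAW, Lemma 3.1 (proof, pp. 6–7)] -/
theorem fhD_add_three_le (hr : RootedFace D (w.side .W) (farSW w)) (h : ω.IsB2a) :
    ω.2.firstHitG + 3 ≤ ω.2.arcs.length := by
  have := ω.2.firstHit_add_three_le_returnHitG hr h.1; rw [h.2] at this; exact this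

/-- **The arc inside the diagonal cell**: face `farSW w`, entry side `z₀`, exit side `z₁`.
[cite: Glazman2015WeightedSAW, Lemma 3.1 (proof, pp. 6–7: the classes of walks through a rhombus)] -/
theorem fc_firstHit_farSW (hr : RootedFace D (w.side .W) (farSW w)) (h : ω.IsB2a) :
    ω.2.fc ω.2.firstHitG = farSW w ∧ ω.2.sIn ω.2.firstHitG = ω.2.firstSideG ∧
      ω.2.sOut ω.2.firstHitG = ω.z1 hr h := by
  have hfh := ω.fh_lt h
  obtain ⟨hz01, -, -⟩ := ω.firstSide_exit_return_distinct hr h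
  have hlen := ω.2.length_eq
  obtain ⟨hs, ht, -⟩ := YBWalk.side_sIn (γ := ω.2) hfh
  rw [← ω.2.nth_eq_getElem (by omega), ω.2.nth_firstHitG] at hs
  rw [← ω.2.nth_eq_getElem (by omega), (ω.2.exitSide_specG hr hfh).1] at ht
  have hface : ω.2.fc ω.2.firstHitG = farSW w := by
    have h1 := ω.2.arcFace_nth_eq_some_fcD hfh
    rw [ω.2.nth_firstHitG, (ω.2.exitSide_specG hr hfh).1,
      arcFace_side_side (farSW w) ω.2.firstSideG (ω.2.exitSideG hr hfh) hz01] at h1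
    exact (Option.some_injective _ h1).symm
  refine ⟨hface, ?_, ?_⟩
  · rw [hface] at hs; exact Face.side_injective _ hs
  · rw [hface] at ht; exact Face.side_injective _ ht

/-- **The total turning splits at the cell**: `winding = WP + arcTurn(θ; z₀, z₁) + WE`.
[cite: GlazmanManolescu2019, Lemma 2.1 (proof: [Gl])] -/
theorem winding_eq_WP_add_farSW (hr : RootedFace D (w.side .W) (farSW w)) (h : ω.IsB2a) (Θ : ℤ → ℝ) :
    ω.2.winding Θ = ω.WP Θ + arcTurn (Θ (farSW w).1) ω.2.firstSideG (ω.z1 hr h) + ω.WE Θ := by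
  have hfh := ω.fh_lt h
  obtain ⟨hfc, hsIn, hsOut⟩ := fc_firstHit_farSW hr h
  have hsplit : ω.2.arcs = ω.2.arcs.take ω.2.firstHitG ++
      (ω.2.arcAt ω.2.firstHitG :: ω.2.arcs.drop (ω.2.firstHitG + 1)) := by
    rw [YBWalk.arcAt, List.getD_eq_getElem' hfh, ← List.drop_eq_getElem_cons hfh, List.take_append_drop]
  have e1 : (ω.2.fc ω.2.firstHitG).1 = (farSW w).1 := by rw [hfc]
  have e2 : sideIn (ω.2.arcAt ω.2.firstHitG) = ω.2.firstSideG := hsIn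
  have e3 : sideOut (ω.2.arcAt ω.2.firstHitG) = ω.z1 hr h := hsOut
  unfold YBWalk.winding ΩG.WP ΩG.WE
  conv_lhs => rw [hsplit]
  rw [List.map_append, List.map_cons, List.sum_append, List.sum_cons,
    arcTurnOf_eq_arcTurn (YBWalk.arcFace_arcAt (γ := ω.2) hfh).1, e1, e2, e3]
  ring

/-- The faces of the arcs other than the one inside the cell are neither the cell nor the hole.
[cite: Glazman2015WeightedSAW, Lemma 3.1 (proof, pp. 6–7)] -/
theorem fc_ne_farSW (hh : holeFaceW w ∉ D) (hr : RootedFace D (w.side .W) (farSW w)) (h : ω.IsB2a) {i : ℕ}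
    (hi : i < ω.2.arcs.length) (hne : i ≠ ω.2.firstHitG) :
    ω.2.fc i ∈ D ∧ ω.2.fc i ≠ farSW w ∧ ω.2.fc i ≠ holeFaceW w := by
  have hD := (YBWalk.arcFace_arcAt (γ := ω.2) hi).2
  refine ⟨hD, fun e => ?_, fun e => hh (e ▸ hD)⟩
  have h1 := ω.2.arcFace_nth_eq_some_fcD hi
  rw [e] at h1
  rcases Nat.lt_or_gt_of_ne hne with hlt | hgt
  · exact ω.2.arcFace_ne_of_lt_firstHitG hlt hi h1
  · exact ω.2.arcFace_ne_of_excursionG hr h.1 hgt (by rw [h.2]; exact hi) h1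

/-- The inner vertices of the whole walk: inner points of faces other than the cell and the hole, or the two inner
points of the arc inside the cell (`z₀.inOff`, `z₁.inOff`). [folklore] -/
private theorem vtx_generic_farSW (hh : holeFaceW w ∉ D) (hr : RootedFace D (w.side .W) (farSW w)) (h : ω.IsB2a)
    {j : ℕ} (hj1 : 1 ≤ j) (hj2 : j ≤ 2 * ω.2.arcs.length) :
    (∃ g s, g ≠ farSW w ∧ g ≠ holeFaceW w ∧ ω.2.vtx j = innerPt g s) ∨
      ∃ p ∈ [ω.2.firstSideG.inOff, (ω.z1 hr h).inOff], ω.2.vtx j = (farSW w).base + p := by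
  rcases YBWalk.index_cases (γ := ω.2) j (by omega) with h0 | ⟨i, hi, rfl⟩ | ⟨i, hi, rfl⟩ | h0
  · omega
  · by_cases hif : i = ω.2.firstHitG
    · subst hif
      obtain ⟨hfc, hsIn, -⟩ := fc_firstHit_farSW hr h
      right
      exact ⟨ω.2.firstSideG.inOff, by simp, by rw [YBWalk.vtx_odd hi, YBWalk.ptIn, hfc, hsIn, innerPt]⟩
    · obtain ⟨-, h1, h2⟩ := fc_ne_farSW hh hr h hi hif
      exact Or.inl ⟨_, _, h1, h2, YBWalk.vtx_odd hi⟩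
  · by_cases hif : i = ω.2.firstHitG
    · subst hif
      obtain ⟨hfc, -, hsOut⟩ := fc_firstHit_farSW hr h
      right
      exact ⟨(ω.z1 hr h).inOff, by simp, by rw [YBWalk.vtx_even hi, YBWalk.ptOut, hfc, hsOut, innerPt]⟩
    · obtain ⟨-, h1, h2⟩ := fc_ne_farSW hh hr h hi hif
      exact Or.inl ⟨_, _, h1, h2, YBWalk.vtx_even hi⟩
  · omega

/-- The last vertex of the whole walk: the midpoint of the return side. [folklore] -/
private theorem vtx_last_farSW (ω : ΩG D (w.side .W) (farSW w)) :
    ω.2.vtx (2 * ω.2.arcs.length + 1) = (farSW w).base + (ω.1).offset := by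
  rw [YBWalk.vtx_last, midPt_farSW_side]

/-- The last-but-one vertex of the whole walk: one unit outside the return side. [folklore] -/
private theorem vtx_penult_farSW (hh : holeFaceW w ∉ D) (hr : RootedFace D (w.side .W) (farSW w)) (h : ω.IsB2a) :
    ω.2.vtx (2 * ω.2.arcs.length) = (farSW w).base + ((ω.1).offset - (ω.1).nIn) := by
  have h3 := fhD_add_three_le hr h
  have hlen := ω.2.length_eq
  have e := YBWalk.vtx_even (γ := ω.2) (i := ω.2.arcs.length - 1) (by omega)
  rw [show 2 * (ω.2.arcs.length - 1) + 2 = 2 * ω.2.arcs.length by omega] at e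
  obtain ⟨-, ht, -⟩ := YBWalk.side_sIn (γ := ω.2) (i := ω.2.arcs.length - 1) (by omega)
  rw [← ω.2.nth_eq_getElem (by omega)] at ht
  simp only [show ω.2.arcs.length - 1 + 1 = ω.2.arcs.length by omega] at ht
  rw [ω.2.nth_length] at ht
  have hs := side_eq_opp_of_side_eqD ht (fc_ne_farSW hh hr h (by omega) (by omega)).2.1
  rw [e, YBWalk.ptOut, innerPt_eq, ht, hs, midPt_farSW_side, nIn_oppD, add_assoc, ← sub_eq_add_neg]

/-- ★★ **Hopf for the closed WHOLE-WALK polygon at the diagonal cell**: for every closing list passing the finite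
tables (special vertices: the two inner points of the arc inside the cell), `winding(π/2) + T·π/4 = ±2π`.
[cite: Hopf1935, Nr. 2 (Umlaufsatz, p. 53) and Nr. 4 eq. (22) (curves with corners, pp. 60–61)]
[cite: GlazmanManolescu2019, Lemma 2.1 (proof: [Gl])] -/
theorem winding_hopf_of_tables (hh : holeFaceW w ∉ D) (hr : RootedFace D (w.side .W) (farSW w)) (h : ω.IsB2a)
    (cl : List (ℤ × ℤ)) (hcl : cl ≠ [])
    (hT1 : ∀ q ∈ cl, q ∈ safeOffsets ∧
      q ∉ [ω.2.firstSideG.inOff, (ω.z1 hr h).inOff] ++ [(ω.1).offset, (8, 6)])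
    (hT2 : cl.Nodup)
    (hT3 : ∀ i < cl.length + 1,
      dsq (((ω.1).offset :: (cl ++ [(8, 6)])).getD i 0) (((ω.1).offset :: (cl ++ [(8, 6)])).getD (i + 1) 0) ≤ 4 ∧
        ∀ p ∈ [ω.2.firstSideG.inOff, (ω.z1 hr h).inOff] ++ [(ω.1).offset, (8, 6)] ++ cl,
          p ≠ ((ω.1).offset :: (cl ++ [(8, 6)])).getD i 0 →
          p ≠ ((ω.1).offset :: (cl ++ [(8, 6)])).getD (i + 1) 0 →
            dsq (((ω.1).offset :: (cl ++ [(8, 6)])).getD i 0) (((ω.1).offset :: (cl ++ [(8, 6)])).getD (i + 1) 0) <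
              dsq (((ω.1).offset :: (cl ++ [(8, 6)])).getD i 0) p +
                dsq (((ω.1).offset :: (cl ++ [(8, 6)])).getD (i + 1) 0) p)
    (hT4 : ∀ p ∈ [ω.2.firstSideG.inOff, (ω.z1 hr h).inOff] ++ [(ω.1).offset, (8, 6)],
      ∀ p' ∈ [ω.2.firstSideG.inOff, (ω.z1 hr h).inOff] ++ [(ω.1).offset, (8, 6)], p ≠ p' → dsq p p' ≤ 4 →
        ∀ q ∈ cl, dsq p p' < dsq p q + dsq p' q)
    (hOK : triplesOK (((ω.1).offset - (ω.1).nIn) :: (ω.1).offset :: (cl ++ [(8, 6), (9, 6)])) = true) :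
    ω.2.winding (fun _ => π / 2) +
        (triplesTurn (((ω.1).offset - (ω.1).nIn) :: (ω.1).offset :: (cl ++ [(8, 6), (9, 6)])) : ℝ) * (π / 4) =
          2 * π ∨
      ω.2.winding (fun _ => π / 2) +
        (triplesTurn (((ω.1).offset - (ω.1).nIn) :: (ω.1).offset :: (cl ++ [(8, 6), (9, 6)])) : ℝ) * (π / 4) =
          -(2 * π) := by
  have hn : 0 < ω.2.arcs.length := by have := ω.fh_lt h; omega
  have key := YBWalk.diagCyc_hopf (γ := ω.2) (cl := cl) hn (farSW w) safeOffsets _ (ω.1).offset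
    five_le_dsq_innerPt_safeOffsets (fun j hj1 hj2 => vtx_generic_farSW hh hr h hj1 hj2) (vtx_last_farSW ω) hcl hT1 hT2 hT3 hT4
  rwa [YBWalk.sum_extAng_diagCyc hh hn _ _ (vtx_penult_farSW hh hr h) (vtx_last_farSW ω) hcl hOK] at key

end WholeD

/-! ## § Turning at the diagonal cell: the instances (finite tables by `decide`) -/

section InstancesD

variable {ω : ΩG D (w.side .W) (farSW w)}

/-- ★★ **THE PREFIX TURNS BY ONE OF TWO VALUES** (Hopf's Umlaufsatz for the closed prefix polygon through the cell,
its corner with the hole, and the hole): at the diagonal cell `farSW w` of the hole root `w.side W`, first side `N`: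
`WP(π/2) ∈ {3π/2, −5π/2}`; `E`: `{3π, −π}`; `S`: `{5π/2, −3π/2}`; `W`: `{2π, −2π}`.
[cite: Hopf1935, Nr. 2 (Umlaufsatz, p. 53) and Nr. 4 eq. (22) (curves with corners, pp. 60–61)] [cite: GlazmanManolescu2019, Lemma 2.1 (proof: [Gl])] -/
theorem WP_farSW_pi_div_two_mem (hh : holeFaceW w ∉ D) (h : ω.IsB2a) :
    (ω.2.firstSideG = .N → ω.WP (fun _ => π / 2) = 3 * π / 2 ∨ ω.WP (fun _ => π / 2) = -(5 * π / 2)) ∧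
      (ω.2.firstSideG = .E → ω.WP (fun _ => π / 2) = 3 * π ∨ ω.WP (fun _ => π / 2) = -π) ∧
      (ω.2.firstSideG = .S → ω.WP (fun _ => π / 2) = 5 * π / 2 ∨ ω.WP (fun _ => π / 2) = -(3 * π / 2)) ∧
      (ω.2.firstSideG = .W → ω.WP (fun _ => π / 2) = 2 * π ∨ ω.WP (fun _ => π / 2) = -(2 * π)) := by
  have hπ := Real.pi_pos
  refine ⟨fun hz => ?_, fun hz => ?_, fun hz => ?_, fun hz => ?_⟩
  · have key := WP_hopf_of_tables (ω := ω) hh h [((3 : ℤ), (3 : ℤ)), (4, 4), (5, 5), (6, 6)] (by simp)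
      (by rw [hz]; decide) (by decide) (by rw [hz]; decide) (by rw [hz]; decide) (by rw [hz]; decide)
    rw [hz] at key
    have e : triplesTurn ((Side.N.offset - Side.N.nIn) :: Side.N.offset ::
        ([((3 : ℤ), (3 : ℤ)), (4, 4), (5, 5), (6, 6)] ++ [(8, 6), (9, 6)])) = 2 := by decide
    rw [e] at key
    push_cast at key
    rcases key with k | k
    · left; linarith
    · right; linarith
  · have key := WP_hopf_of_tables (ω := ω) hh h [((3 : ℤ), (3 : ℤ)), (4, 4), (5, 5), (6, 6)] (by simp)
      (by rw [hz]; decide) (by decide) (by rw [hz]; decide) (by rw [hz]; decide) (by rw [hz]; decide)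
    rw [hz] at key
    have e : triplesTurn ((Side.E.offset - Side.E.nIn) :: Side.E.offset ::
        ([((3 : ℤ), (3 : ℤ)), (4, 4), (5, 5), (6, 6)] ++ [(8, 6), (9, 6)])) = -4 := by decide
    rw [e] at key
    push_cast at key
    rcases key with k | k
    · left; linarith
    · right; linarith
  · have key := WP_hopf_of_tables (ω := ω) hh h [((2 : ℤ), (2 : ℤ)), (3, 3), (4, 4), (5, 5), (6, 6)] (by simp)
      (by rw [hz]; decide) (by decide) (by rw [hz]; decide) (by rw [hz]; decide) (by rw [hz]; decide)
    rw [hz] at key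
    have e : triplesTurn ((Side.S.offset - Side.S.nIn) :: Side.S.offset ::
        ([((2 : ℤ), (2 : ℤ)), (3, 3), (4, 4), (5, 5), (6, 6)] ++ [(8, 6), (9, 6)])) = -2 := by decide
    rw [e] at key
    push_cast at key
    rcases key with k | k
    · left; linarith
    · right; linarith
  · have key := WP_hopf_of_tables (ω := ω) hh h [((2 : ℤ), (2 : ℤ)), (3, 3), (4, 4), (5, 5), (6, 6)] (by simp)
      (by rw [hz]; decide) (by decide) (by rw [hz]; decide) (by rw [hz]; decide) (by rw [hz]; decide)
    rw [hz] at key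
    have e : triplesTurn ((Side.W.offset - Side.W.nIn) :: Side.W.offset ::
        ([((2 : ℤ), (2 : ℤ)), (3, 3), (4, 4), (5, 5), (6, 6)] ++ [(8, 6), (9, 6)])) = 0 := by decide
    rw [e] at key
    push_cast at key
    rcases key with k | k
    · left; linarith
    · right; linarith

/-- Hopf's Umlaufsatz for the closed whole-walk polygon, pattern `(N, S, E)` (first side, exit, return):
`winding(π/2) ∈ {3 * π, -π}`. [cite: Hopf1935, Nr. 2 (Umlaufsatz, p. 53) and Nr. 4 eq. (22) (curves with corners, pp. 60–61)] -/
theorem winding_farSW_NSE (hh : holeFaceW w ∉ D) (hr : RootedFace D (w.side .W) (farSW w)) (h : ω.IsB2a)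
    (hz0 : ω.2.firstSideG = .N) (hz1 : ω.z1 hr h = .S) (hz2 : ω.1 = .E) :
    ω.2.winding (fun _ => π / 2) = 3 * π ∨ ω.2.winding (fun _ => π / 2) = -π := by
  have hπ := Real.pi_pos
  have key := winding_hopf_of_tables hh hr h [((4 : ℤ), (4 : ℤ)), (5, 5), (6, 6)] (by simp)
    (by rw [hz0, hz1, hz2]; decide) (by decide) (by rw [hz0, hz1, hz2]; decide) (by rw [hz0, hz1, hz2]; decide)
    (by rw [hz2]; decide)
  have e : triplesTurn (((ω.1).offset - (ω.1).nIn) :: (ω.1).offset ::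
      ([((4 : ℤ), (4 : ℤ)), (5, 5), (6, 6)] ++ [(8, 6), (9, 6)])) = -4 := by rw [hz2]; decide
  rw [e] at key
  push_cast at key
  rcases key with k | k
  · left; linarith
  · right; linarith

/-- Hopf's Umlaufsatz for the closed whole-walk polygon, pattern `(N, W, E)` (first side, exit, return):
`winding(π/2) ∈ {3 * π, -π}`. [cite: Hopf1935, Nr. 2 (Umlaufsatz, p. 53) and Nr. 4 eq. (22) (curves with corners, pp. 60–61)] -/
theorem winding_farSW_NWE (hh : holeFaceW w ∉ D) (hr : RootedFace D (w.side .W) (farSW w)) (h : ω.IsB2a)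
    (hz0 : ω.2.firstSideG = .N) (hz1 : ω.z1 hr h = .W) (hz2 : ω.1 = .E) :
    ω.2.winding (fun _ => π / 2) = 3 * π ∨ ω.2.winding (fun _ => π / 2) = -π := by
  have hπ := Real.pi_pos
  have key := winding_hopf_of_tables hh hr h [((4 : ℤ), (4 : ℤ)), (5, 5), (6, 6)] (by simp)
    (by rw [hz0, hz1, hz2]; decide) (by decide) (by rw [hz0, hz1, hz2]; decide) (by rw [hz0, hz1, hz2]; decide)
    (by rw [hz2]; decide)
  have e : triplesTurn (((ω.1).offset - (ω.1).nIn) :: (ω.1).offset ::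
      ([((4 : ℤ), (4 : ℤ)), (5, 5), (6, 6)] ++ [(8, 6), (9, 6)])) = -4 := by rw [hz2]; decide
  rw [e] at key
  push_cast at key
  rcases key with k | k
  · left; linarith
  · right; linarith

/-- Hopf's Umlaufsatz for the closed whole-walk polygon, pattern `(N, W, S)` (first side, exit, return):
`winding(π/2) ∈ {5 * π / 2, -(3 * π / 2)}`. [cite: Hopf1935, Nr. 2 (Umlaufsatz, p. 53) and Nr. 4 eq. (22) (curves with corners, pp. 60–61)] -/
theorem winding_farSW_NWS (hh : holeFaceW w ∉ D) (hr : RootedFace D (w.side .W) (farSW w)) (h : ω.IsB2a)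
    (hz0 : ω.2.firstSideG = .N) (hz1 : ω.z1 hr h = .W) (hz2 : ω.1 = .S) :
    ω.2.winding (fun _ => π / 2) = 5 * π / 2 ∨ ω.2.winding (fun _ => π / 2) = -(3 * π / 2) := by
  have hπ := Real.pi_pos
  have key := winding_hopf_of_tables hh hr h [((3 : ℤ), (1 : ℤ)), (3, 3), (4, 4), (5, 5), (6, 6)] (by simp)
    (by rw [hz0, hz1, hz2]; decide) (by decide) (by rw [hz0, hz1, hz2]; decide) (by rw [hz0, hz1, hz2]; decide)
    (by rw [hz2]; decide)
  have e : triplesTurn (((ω.1).offset - (ω.1).nIn) :: (ω.1).offset ::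
      ([((3 : ℤ), (1 : ℤ)), (3, 3), (4, 4), (5, 5), (6, 6)] ++ [(8, 6), (9, 6)])) = -2 := by rw [hz2]; decide
  rw [e] at key
  push_cast at key
  rcases key with k | k
  · left; linarith
  · right; linarith

/-- Hopf's Umlaufsatz for the closed whole-walk polygon, pattern `(E, S, N)` (first side, exit, return):
`winding(π/2) ∈ {3 * π / 2, -(5 * π / 2)}`. [cite: Hopf1935, Nr. 2 (Umlaufsatz, p. 53) and Nr. 4 eq. (22) (curves with corners, pp. 60–61)] -/
theorem winding_farSW_ESN (hh : holeFaceW w ∉ D) (hr : RootedFace D (w.side .W) (farSW w)) (h : ω.IsB2a)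
    (hz0 : ω.2.firstSideG = .E) (hz1 : ω.z1 hr h = .S) (hz2 : ω.1 = .N) :
    ω.2.winding (fun _ => π / 2) = 3 * π / 2 ∨ ω.2.winding (fun _ => π / 2) = -(5 * π / 2) := by
  have hπ := Real.pi_pos
  have key := winding_hopf_of_tables hh hr h [((4 : ℤ), (4 : ℤ)), (5, 5), (6, 6)] (by simp)
    (by rw [hz0, hz1, hz2]; decide) (by decide) (by rw [hz0, hz1, hz2]; decide) (by rw [hz0, hz1, hz2]; decide)
    (by rw [hz2]; decide)
  have e : triplesTurn (((ω.1).offset - (ω.1).nIn) :: (ω.1).offset ::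
      ([((4 : ℤ), (4 : ℤ)), (5, 5), (6, 6)] ++ [(8, 6), (9, 6)])) = 2 := by rw [hz2]; decide
  rw [e] at key
  push_cast at key
  rcases key with k | k
  · left; linarith
  · right; linarith

/-- Hopf's Umlaufsatz for the closed whole-walk polygon, pattern `(E, S, W)` (first side, exit, return):
`winding(π/2) ∈ {2 * π, -(2 * π)}`. [cite: Hopf1935, Nr. 2 (Umlaufsatz, p. 53) and Nr. 4 eq. (22) (curves with corners, pp. 60–61)] -/
theorem winding_farSW_ESW (hh : holeFaceW w ∉ D) (hr : RootedFace D (w.side .W) (farSW w)) (h : ω.IsB2a)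
    (hz0 : ω.2.firstSideG = .E) (hz1 : ω.z1 hr h = .S) (hz2 : ω.1 = .W) :
    ω.2.winding (fun _ => π / 2) = 2 * π ∨ ω.2.winding (fun _ => π / 2) = -(2 * π) := by
  have hπ := Real.pi_pos
  have key := winding_hopf_of_tables hh hr h [((1 : ℤ), (3 : ℤ)), (3, 3), (4, 4), (5, 5), (6, 6)] (by simp)
    (by rw [hz0, hz1, hz2]; decide) (by decide) (by rw [hz0, hz1, hz2]; decide) (by rw [hz0, hz1, hz2]; decide)
    (by rw [hz2]; decide)
  have e : triplesTurn (((ω.1).offset - (ω.1).nIn) :: (ω.1).offset ::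
      ([((1 : ℤ), (3 : ℤ)), (3, 3), (4, 4), (5, 5), (6, 6)] ++ [(8, 6), (9, 6)])) = 0 := by rw [hz2]; decide
  rw [e] at key
  push_cast at key
  rcases key with k | k
  · left; linarith
  · right; linarith

/-- Hopf's Umlaufsatz for the closed whole-walk polygon, pattern `(E, W, N)` (first side, exit, return):
`winding(π/2) ∈ {3 * π / 2, -(5 * π / 2)}`. [cite: Hopf1935, Nr. 2 (Umlaufsatz, p. 53) and Nr. 4 eq. (22) (curves with corners, pp. 60–61)] -/
theorem winding_farSW_EWN (hh : holeFaceW w ∉ D) (hr : RootedFace D (w.side .W) (farSW w)) (h : ω.IsB2a)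
    (hz0 : ω.2.firstSideG = .E) (hz1 : ω.z1 hr h = .W) (hz2 : ω.1 = .N) :
    ω.2.winding (fun _ => π / 2) = 3 * π / 2 ∨ ω.2.winding (fun _ => π / 2) = -(5 * π / 2) := by
  have hπ := Real.pi_pos
  have key := winding_hopf_of_tables hh hr h [((4 : ℤ), (4 : ℤ)), (5, 5), (6, 6)] (by simp)
    (by rw [hz0, hz1, hz2]; decide) (by decide) (by rw [hz0, hz1, hz2]; decide) (by rw [hz0, hz1, hz2]; decide)
    (by rw [hz2]; decide)
  have e : triplesTurn (((ω.1).offset - (ω.1).nIn) :: (ω.1).offset ::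
      ([((4 : ℤ), (4 : ℤ)), (5, 5), (6, 6)] ++ [(8, 6), (9, 6)])) = 2 := by rw [hz2]; decide
  rw [e] at key
  push_cast at key
  rcases key with k | k
  · left; linarith
  · right; linarith

/-- Hopf's Umlaufsatz for the closed whole-walk polygon, pattern `(S, W, N)` (first side, exit, return):
`winding(π/2) ∈ {3 * π / 2, -(5 * π / 2)}`. [cite: Hopf1935, Nr. 2 (Umlaufsatz, p. 53) and Nr. 4 eq. (22) (curves with corners, pp. 60–61)] -/
theorem winding_farSW_SWN (hh : holeFaceW w ∉ D) (hr : RootedFace D (w.side .W) (farSW w)) (h : ω.IsB2a)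
    (hz0 : ω.2.firstSideG = .S) (hz1 : ω.z1 hr h = .W) (hz2 : ω.1 = .N) :
    ω.2.winding (fun _ => π / 2) = 3 * π / 2 ∨ ω.2.winding (fun _ => π / 2) = -(5 * π / 2) := by
  have hπ := Real.pi_pos
  have key := winding_hopf_of_tables hh hr h [((4 : ℤ), (4 : ℤ)), (5, 5), (6, 6)] (by simp)
    (by rw [hz0, hz1, hz2]; decide) (by decide) (by rw [hz0, hz1, hz2]; decide) (by rw [hz0, hz1, hz2]; decide)
    (by rw [hz2]; decide)
  have e : triplesTurn (((ω.1).offset - (ω.1).nIn) :: (ω.1).offset ::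
      ([((4 : ℤ), (4 : ℤ)), (5, 5), (6, 6)] ++ [(8, 6), (9, 6)])) = 2 := by rw [hz2]; decide
  rw [e] at key
  push_cast at key
  rcases key with k | k
  · left; linarith
  · right; linarith

/-- Hopf's Umlaufsatz for the closed whole-walk polygon, pattern `(S, N, E)` (first side, exit, return):
`winding(π/2) ∈ {3 * π, -π}`. [cite: Hopf1935, Nr. 2 (Umlaufsatz, p. 53) and Nr. 4 eq. (22) (curves with corners, pp. 60–61)] -/
theorem winding_farSW_SNE (hh : holeFaceW w ∉ D) (hr : RootedFace D (w.side .W) (farSW w)) (h : ω.IsB2a)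
    (hz0 : ω.2.firstSideG = .S) (hz1 : ω.z1 hr h = .N) (hz2 : ω.1 = .E) :
    ω.2.winding (fun _ => π / 2) = 3 * π ∨ ω.2.winding (fun _ => π / 2) = -π := by
  have hπ := Real.pi_pos
  have key := winding_hopf_of_tables hh hr h [((4 : ℤ), (4 : ℤ)), (5, 5), (6, 6)] (by simp)
    (by rw [hz0, hz1, hz2]; decide) (by decide) (by rw [hz0, hz1, hz2]; decide) (by rw [hz0, hz1, hz2]; decide)
    (by rw [hz2]; decide)
  have e : triplesTurn (((ω.1).offset - (ω.1).nIn) :: (ω.1).offset ::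
      ([((4 : ℤ), (4 : ℤ)), (5, 5), (6, 6)] ++ [(8, 6), (9, 6)])) = -4 := by rw [hz2]; decide
  rw [e] at key
  push_cast at key
  rcases key with k | k
  · left; linarith
  · right; linarith

/-- Hopf's Umlaufsatz for the closed whole-walk polygon, pattern `(S, E, W)` (first side, exit, return):
`winding(π/2) ∈ {2 * π, -(2 * π)}`. [cite: Hopf1935, Nr. 2 (Umlaufsatz, p. 53) and Nr. 4 eq. (22) (curves with corners, pp. 60–61)] -/
theorem winding_farSW_SEW (hh : holeFaceW w ∉ D) (hr : RootedFace D (w.side .W) (farSW w)) (h : ω.IsB2a)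
    (hz0 : ω.2.firstSideG = .S) (hz1 : ω.z1 hr h = .E) (hz2 : ω.1 = .W) :
    ω.2.winding (fun _ => π / 2) = 2 * π ∨ ω.2.winding (fun _ => π / 2) = -(2 * π) := by
  have hπ := Real.pi_pos
  have key := winding_hopf_of_tables hh hr h [((1 : ℤ), (3 : ℤ)), (3, 3), (4, 4), (5, 5), (6, 6)] (by simp)
    (by rw [hz0, hz1, hz2]; decide) (by decide) (by rw [hz0, hz1, hz2]; decide) (by rw [hz0, hz1, hz2]; decide)
    (by rw [hz2]; decide)
  have e : triplesTurn (((ω.1).offset - (ω.1).nIn) :: (ω.1).offset ::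
      ([((1 : ℤ), (3 : ℤ)), (3, 3), (4, 4), (5, 5), (6, 6)] ++ [(8, 6), (9, 6)])) = 0 := by rw [hz2]; decide
  rw [e] at key
  push_cast at key
  rcases key with k | k
  · left; linarith
  · right; linarith

/-- Hopf's Umlaufsatz for the closed whole-walk polygon, pattern `(W, S, E)` (first side, exit, return):
`winding(π/2) ∈ {3 * π, -π}`. [cite: Hopf1935, Nr. 2 (Umlaufsatz, p. 53) and Nr. 4 eq. (22) (curves with corners, pp. 60–61)] -/
theorem winding_farSW_WSE (hh : holeFaceW w ∉ D) (hr : RootedFace D (w.side .W) (farSW w)) (h : ω.IsB2a)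
    (hz0 : ω.2.firstSideG = .W) (hz1 : ω.z1 hr h = .S) (hz2 : ω.1 = .E) :
    ω.2.winding (fun _ => π / 2) = 3 * π ∨ ω.2.winding (fun _ => π / 2) = -π := by
  have hπ := Real.pi_pos
  have key := winding_hopf_of_tables hh hr h [((4 : ℤ), (4 : ℤ)), (5, 5), (6, 6)] (by simp)
    (by rw [hz0, hz1, hz2]; decide) (by decide) (by rw [hz0, hz1, hz2]; decide) (by rw [hz0, hz1, hz2]; decide)
    (by rw [hz2]; decide)
  have e : triplesTurn (((ω.1).offset - (ω.1).nIn) :: (ω.1).offset ::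
      ([((4 : ℤ), (4 : ℤ)), (5, 5), (6, 6)] ++ [(8, 6), (9, 6)])) = -4 := by rw [hz2]; decide
  rw [e] at key
  push_cast at key
  rcases key with k | k
  · left; linarith
  · right; linarith

/-- Hopf's Umlaufsatz for the closed whole-walk polygon, pattern `(W, N, E)` (first side, exit, return):
`winding(π/2) ∈ {3 * π, -π}`. [cite: Hopf1935, Nr. 2 (Umlaufsatz, p. 53) and Nr. 4 eq. (22) (curves with corners, pp. 60–61)] -/
theorem winding_farSW_WNE (hh : holeFaceW w ∉ D) (hr : RootedFace D (w.side .W) (farSW w)) (h : ω.IsB2a)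
    (hz0 : ω.2.firstSideG = .W) (hz1 : ω.z1 hr h = .N) (hz2 : ω.1 = .E) :
    ω.2.winding (fun _ => π / 2) = 3 * π ∨ ω.2.winding (fun _ => π / 2) = -π := by
  have hπ := Real.pi_pos
  have key := winding_hopf_of_tables hh hr h [((4 : ℤ), (4 : ℤ)), (5, 5), (6, 6)] (by simp)
    (by rw [hz0, hz1, hz2]; decide) (by decide) (by rw [hz0, hz1, hz2]; decide) (by rw [hz0, hz1, hz2]; decide)
    (by rw [hz2]; decide)
  have e : triplesTurn (((ω.1).offset - (ω.1).nIn) :: (ω.1).offset ::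
      ([((4 : ℤ), (4 : ℤ)), (5, 5), (6, 6)] ++ [(8, 6), (9, 6)])) = -4 := by rw [hz2]; decide
  rw [e] at key
  push_cast at key
  rcases key with k | k
  · left; linarith
  · right; linarith

/-- Hopf's Umlaufsatz for the closed whole-walk polygon, pattern `(W, S, N)` (first side, exit, return):
`winding(π/2) ∈ {3 * π / 2, -(5 * π / 2)}`. [cite: Hopf1935, Nr. 2 (Umlaufsatz, p. 53) and Nr. 4 eq. (22) (curves with corners, pp. 60–61)] -/
theorem winding_farSW_WSN (hh : holeFaceW w ∉ D) (hr : RootedFace D (w.side .W) (farSW w)) (h : ω.IsB2a)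
    (hz0 : ω.2.firstSideG = .W) (hz1 : ω.z1 hr h = .S) (hz2 : ω.1 = .N) :
    ω.2.winding (fun _ => π / 2) = 3 * π / 2 ∨ ω.2.winding (fun _ => π / 2) = -(5 * π / 2) := by
  have hπ := Real.pi_pos
  have key := winding_hopf_of_tables hh hr h [((4 : ℤ), (4 : ℤ)), (5, 5), (6, 6)] (by simp)
    (by rw [hz0, hz1, hz2]; decide) (by decide) (by rw [hz0, hz1, hz2]; decide) (by rw [hz0, hz1, hz2]; decide)
    (by rw [hz2]; decide)
  have e : triplesTurn (((ω.1).offset - (ω.1).nIn) :: (ω.1).offset ::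
      ([((4 : ℤ), (4 : ℤ)), (5, 5), (6, 6)] ++ [(8, 6), (9, 6)])) = 2 := by rw [hz2]; decide
  rw [e] at key
  push_cast at key
  rcases key with k | k
  · left; linarith
  · right; linarith

end InstancesD

/-! ## § Turning at the diagonal cell: pinning by the sign law, pattern by pattern -/

section CombineD

variable {ω : ΩG D (w.side .W) (farSW w)}

/-- The excursion winding of a WOUND walk from the sign law: `WE − excursionWinding = 4π·ε(z₀; z₁, z₂)`.
[cite: GlazmanManolescu2019, Lemma 2.1 (statement, "in the form given in [Gl]")] [cite: Glazman2015WeightedSAW, Lemma 3.1 (proof, pp. 6–7)] -/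
theorem WE_sub_eq_of_wound_farSW (hr : RootedFace D (w.side .W) (farSW w)) (h : ω.IsB2a) (θ : ℝ)
    (hW : ω.WE (fun _ => θ) ≠ excursionWinding θ ω.2.firstSideG (ω.z1 hr h) ω.1) :
    ω.WE (fun _ => θ) - excursionWinding θ ω.2.firstSideG (ω.z1 hr h) ω.1 =
      4 * π * chordSign ω.2.firstSideG (ω.z1 hr h) ω.1 := by
  rcases ω.sign_law hr h θ with ⟨hWE, -⟩ | ⟨hWE, -⟩
  · exact absurd hWE hW
  · exact hWE

/-- ★ Pattern `(N, S, E)`: a WOUND class-`B2a` walk at the diagonal cell with this pattern has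
`WP(π/2) = 3 * π / 2`. [cite: Hopf1935, Nr. 2 (Umlaufsatz, p. 53) and Nr. 4 eq. (22) (curves with corners, pp. 60–61)]
[cite: GlazmanManolescu2019, Lemma 2.1 (proof: [Gl])] [cite: DuminilCopinSmirnov2012, proof of Lemma 1 (the winding bookkeeping)] -/
theorem WP_farSW_NSE (hh : holeFaceW w ∉ D) (hr : RootedFace D (w.side .W) (farSW w)) (h : ω.IsB2a)
    (hz0 : ω.2.firstSideG = .N) (hz1 : ω.z1 hr h = .S) (hz2 : ω.1 = .E)
    (hW : ω.WE (fun _ => π / 2) ≠ excursionWinding (π / 2) ω.2.firstSideG (ω.z1 hr h) ω.1) :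
    ω.WP (fun _ => π / 2) = 3 * π / 2 := by
  have hπ := Real.pi_pos
  have hC := (WP_farSW_pi_div_two_mem hh h).1 hz0
  have hP := winding_farSW_NSE hh hr h hz0 hz1 hz2
  rw [winding_eq_WP_add_farSW hr h] at hP
  have hWE := WE_sub_eq_of_wound_farSW hr h (π / 2) hW
  rw [hz0, hz1] at hP
  rw [hz0, hz1, hz2] at hWE
  have haT : arcTurn ((fun _ : ℤ => π / 2) (farSW w).1) Side.N Side.S = 0 := rfl
  have heW : excursionWinding (π / 2) Side.N Side.S Side.E = 2 * π - π / 2 := rfl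
  have hcs : chordSign Side.N Side.S Side.E = -1 := by decide
  rw [haT] at hP
  rw [heW, hcs] at hWE
  push_cast at hWE
  rcases hC with hC | hC <;> rcases hP with hP | hP <;> first | exact hC | (exfalso; linarith)

/-- ★ Pattern `(N, W, E)`: a WOUND class-`B2a` walk at the diagonal cell with this pattern has
`WP(π/2) = 3 * π / 2`. [cite: Hopf1935, Nr. 2 (Umlaufsatz, p. 53) and Nr. 4 eq. (22) (curves with corners, pp. 60–61)]
[cite: GlazmanManolescu2019, Lemma 2.1 (proof: [Gl])] [cite: DuminilCopinSmirnov2012, proof of Lemma 1 (the winding bookkeeping)] -/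
theorem WP_farSW_NWE (hh : holeFaceW w ∉ D) (hr : RootedFace D (w.side .W) (farSW w)) (h : ω.IsB2a)
    (hz0 : ω.2.firstSideG = .N) (hz1 : ω.z1 hr h = .W) (hz2 : ω.1 = .E)
    (hW : ω.WE (fun _ => π / 2) ≠ excursionWinding (π / 2) ω.2.firstSideG (ω.z1 hr h) ω.1) :
    ω.WP (fun _ => π / 2) = 3 * π / 2 := by
  have hπ := Real.pi_pos
  have hC := (WP_farSW_pi_div_two_mem hh h).1 hz0
  have hP := winding_farSW_NWE hh hr h hz0 hz1 hz2
  rw [winding_eq_WP_add_farSW hr h] at hP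
  have hWE := WE_sub_eq_of_wound_farSW hr h (π / 2) hW
  rw [hz0, hz1] at hP
  rw [hz0, hz1, hz2] at hWE
  have haT : arcTurn ((fun _ : ℤ => π / 2) (farSW w).1) Side.N Side.W = -(π / 2) := rfl
  have heW : excursionWinding (π / 2) Side.N Side.W Side.E = 2 * π := rfl
  have hcs : chordSign Side.N Side.W Side.E = -1 := by decide
  rw [haT] at hP
  rw [heW, hcs] at hWE
  push_cast at hWE
  rcases hC with hC | hC <;> rcases hP with hP | hP <;> first | exact hC | (exfalso; linarith)

/-- ★ Pattern `(N, W, S)`: a WOUND class-`B2a` walk at the diagonal cell with this pattern has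
`WP(π/2) = 3 * π / 2`. [cite: Hopf1935, Nr. 2 (Umlaufsatz, p. 53) and Nr. 4 eq. (22) (curves with corners, pp. 60–61)]
[cite: GlazmanManolescu2019, Lemma 2.1 (proof: [Gl])] [cite: DuminilCopinSmirnov2012, proof of Lemma 1 (the winding bookkeeping)] -/
theorem WP_farSW_NWS (hh : holeFaceW w ∉ D) (hr : RootedFace D (w.side .W) (farSW w)) (h : ω.IsB2a)
    (hz0 : ω.2.firstSideG = .N) (hz1 : ω.z1 hr h = .W) (hz2 : ω.1 = .S)
    (hW : ω.WE (fun _ => π / 2) ≠ excursionWinding (π / 2) ω.2.firstSideG (ω.z1 hr h) ω.1) :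
    ω.WP (fun _ => π / 2) = 3 * π / 2 := by
  have hπ := Real.pi_pos
  have hC := (WP_farSW_pi_div_two_mem hh h).1 hz0
  have hP := winding_farSW_NWS hh hr h hz0 hz1 hz2
  rw [winding_eq_WP_add_farSW hr h] at hP
  have hWE := WE_sub_eq_of_wound_farSW hr h (π / 2) hW
  rw [hz0, hz1] at hP
  rw [hz0, hz1, hz2] at hWE
  have haT : arcTurn ((fun _ : ℤ => π / 2) (farSW w).1) Side.N Side.W = -(π / 2) := rfl
  have heW : excursionWinding (π / 2) Side.N Side.W Side.S = π + π / 2 := rfl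
  have hcs : chordSign Side.N Side.W Side.S = -1 := by decide
  rw [haT] at hP
  rw [heW, hcs] at hWE
  push_cast at hWE
  rcases hC with hC | hC <;> rcases hP with hP | hP <;> first | exact hC | (exfalso; linarith)

/-- ★ Pattern `(E, S, N)`: a WOUND class-`B2a` walk at the diagonal cell with this pattern has
`WP(π/2) = -π`. [cite: Hopf1935, Nr. 2 (Umlaufsatz, p. 53) and Nr. 4 eq. (22) (curves with corners, pp. 60–61)]
[cite: GlazmanManolescu2019, Lemma 2.1 (proof: [Gl])] [cite: DuminilCopinSmirnov2012, proof of Lemma 1 (the winding bookkeeping)] -/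
theorem WP_farSW_ESN (hh : holeFaceW w ∉ D) (hr : RootedFace D (w.side .W) (farSW w)) (h : ω.IsB2a)
    (hz0 : ω.2.firstSideG = .E) (hz1 : ω.z1 hr h = .S) (hz2 : ω.1 = .N)
    (hW : ω.WE (fun _ => π / 2) ≠ excursionWinding (π / 2) ω.2.firstSideG (ω.z1 hr h) ω.1) :
    ω.WP (fun _ => π / 2) = -π := by
  have hπ := Real.pi_pos
  have hC := (WP_farSW_pi_div_two_mem hh h).2.1 hz0
  have hP := winding_farSW_ESN hh hr h hz0 hz1 hz2
  rw [winding_eq_WP_add_farSW hr h] at hP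
  have hWE := WE_sub_eq_of_wound_farSW hr h (π / 2) hW
  rw [hz0, hz1] at hP
  rw [hz0, hz1, hz2] at hWE
  have haT : arcTurn ((fun _ : ℤ => π / 2) (farSW w).1) Side.E Side.S = π / 2 := rfl
  have heW : excursionWinding (π / 2) Side.E Side.S Side.N = -2 * π := rfl
  have hcs : chordSign Side.E Side.S Side.N = 1 := by decide
  rw [haT] at hP
  rw [heW, hcs] at hWE
  push_cast at hWE
  rcases hC with hC | hC <;> rcases hP with hP | hP <;> first | exact hC | (exfalso; linarith)

/-- ★ Pattern `(E, S, W)`: a WOUND class-`B2a` walk at the diagonal cell with this pattern has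
`WP(π/2) = -π`. [cite: Hopf1935, Nr. 2 (Umlaufsatz, p. 53) and Nr. 4 eq. (22) (curves with corners, pp. 60–61)]
[cite: GlazmanManolescu2019, Lemma 2.1 (proof: [Gl])] [cite: DuminilCopinSmirnov2012, proof of Lemma 1 (the winding bookkeeping)] -/
theorem WP_farSW_ESW (hh : holeFaceW w ∉ D) (hr : RootedFace D (w.side .W) (farSW w)) (h : ω.IsB2a)
    (hz0 : ω.2.firstSideG = .E) (hz1 : ω.z1 hr h = .S) (hz2 : ω.1 = .W)
    (hW : ω.WE (fun _ => π / 2) ≠ excursionWinding (π / 2) ω.2.firstSideG (ω.z1 hr h) ω.1) :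
    ω.WP (fun _ => π / 2) = -π := by
  have hπ := Real.pi_pos
  have hC := (WP_farSW_pi_div_two_mem hh h).2.1 hz0
  have hP := winding_farSW_ESW hh hr h hz0 hz1 hz2
  rw [winding_eq_WP_add_farSW hr h] at hP
  have hWE := WE_sub_eq_of_wound_farSW hr h (π / 2) hW
  rw [hz0, hz1] at hP
  rw [hz0, hz1, hz2] at hWE
  have haT : arcTurn ((fun _ : ℤ => π / 2) (farSW w).1) Side.E Side.S = π / 2 := rfl
  have heW : excursionWinding (π / 2) Side.E Side.S Side.W = -π - π / 2 := rfl
  have hcs : chordSign Side.E Side.S Side.W = 1 := by decide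
  rw [haT] at hP
  rw [heW, hcs] at hWE
  push_cast at hWE
  rcases hC with hC | hC <;> rcases hP with hP | hP <;> first | exact hC | (exfalso; linarith)

/-- ★ Pattern `(E, W, N)`: a WOUND class-`B2a` walk at the diagonal cell with this pattern has
`WP(π/2) = -π`. [cite: Hopf1935, Nr. 2 (Umlaufsatz, p. 53) and Nr. 4 eq. (22) (curves with corners, pp. 60–61)]
[cite: GlazmanManolescu2019, Lemma 2.1 (proof: [Gl])] [cite: DuminilCopinSmirnov2012, proof of Lemma 1 (the winding bookkeeping)] -/
theorem WP_farSW_EWN (hh : holeFaceW w ∉ D) (hr : RootedFace D (w.side .W) (farSW w)) (h : ω.IsB2a)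
    (hz0 : ω.2.firstSideG = .E) (hz1 : ω.z1 hr h = .W) (hz2 : ω.1 = .N)
    (hW : ω.WE (fun _ => π / 2) ≠ excursionWinding (π / 2) ω.2.firstSideG (ω.z1 hr h) ω.1) :
    ω.WP (fun _ => π / 2) = -π := by
  have hπ := Real.pi_pos
  have hC := (WP_farSW_pi_div_two_mem hh h).2.1 hz0
  have hP := winding_farSW_EWN hh hr h hz0 hz1 hz2
  rw [winding_eq_WP_add_farSW hr h] at hP
  have hWE := WE_sub_eq_of_wound_farSW hr h (π / 2) hW
  rw [hz0, hz1] at hP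
  rw [hz0, hz1, hz2] at hWE
  have haT : arcTurn ((fun _ : ℤ => π / 2) (farSW w).1) Side.E Side.W = 0 := rfl
  have heW : excursionWinding (π / 2) Side.E Side.W Side.N = -2 * π + π / 2 := rfl
  have hcs : chordSign Side.E Side.W Side.N = 1 := by decide
  rw [haT] at hP
  rw [heW, hcs] at hWE
  push_cast at hWE
  rcases hC with hC | hC <;> rcases hP with hP | hP <;> first | exact hC | (exfalso; linarith)

/-- ★ Pattern `(S, W, N)`: a WOUND class-`B2a` walk at the diagonal cell with this pattern has
`WP(π/2) = -(3 * π / 2)`. [cite: Hopf1935, Nr. 2 (Umlaufsatz, p. 53) and Nr. 4 eq. (22) (curves with corners, pp. 60–61)]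
[cite: GlazmanManolescu2019, Lemma 2.1 (proof: [Gl])] [cite: DuminilCopinSmirnov2012, proof of Lemma 1 (the winding bookkeeping)] -/
theorem WP_farSW_SWN (hh : holeFaceW w ∉ D) (hr : RootedFace D (w.side .W) (farSW w)) (h : ω.IsB2a)
    (hz0 : ω.2.firstSideG = .S) (hz1 : ω.z1 hr h = .W) (hz2 : ω.1 = .N)
    (hW : ω.WE (fun _ => π / 2) ≠ excursionWinding (π / 2) ω.2.firstSideG (ω.z1 hr h) ω.1) :
    ω.WP (fun _ => π / 2) = -(3 * π / 2) := by
  have hπ := Real.pi_pos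
  have hC := (WP_farSW_pi_div_two_mem hh h).2.2.1 hz0
  have hP := winding_farSW_SWN hh hr h hz0 hz1 hz2
  rw [winding_eq_WP_add_farSW hr h] at hP
  have hWE := WE_sub_eq_of_wound_farSW hr h (π / 2) hW
  rw [hz0, hz1] at hP
  rw [hz0, hz1, hz2] at hWE
  have haT : arcTurn ((fun _ : ℤ => π / 2) (farSW w).1) Side.S Side.W = π - π / 2 := rfl
  have heW : excursionWinding (π / 2) Side.S Side.W Side.N = -2 * π + π / 2 := rfl
  have hcs : chordSign Side.S Side.W Side.N = 1 := by decide
  rw [haT] at hP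
  rw [heW, hcs] at hWE
  push_cast at hWE
  rcases hC with hC | hC <;> rcases hP with hP | hP <;> first | exact hC | (exfalso; linarith)

/-- ★ Pattern `(S, N, E)` is IMPOSSIBLE: no class-`B2a` walk at the diagonal cell of a hole root has first
side `S`, exit side `N` and return side `E` — the two Umlaufsätze and the sign law leave no consistent value
of the prefix turning, wound or not. [cite: Hopf1935, Nr. 2 (Umlaufsatz, p. 53) and Nr. 4 eq. (22) (curves with corners, pp. 60–61)]
[cite: GlazmanManolescu2019, Lemma 2.1 (proof: [Gl])] [cite: DuminilCopinSmirnov2012, proof of Lemma 1 (the winding bookkeeping)] -/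
theorem farSW_no_SNE (hh : holeFaceW w ∉ D) (hr : RootedFace D (w.side .W) (farSW w)) (h : ω.IsB2a)
    (hz0 : ω.2.firstSideG = .S) (hz1 : ω.z1 hr h = .N) (hz2 : ω.1 = .E) : False := by
  have hπ := Real.pi_pos
  have hC := (WP_farSW_pi_div_two_mem hh h).2.2.1 hz0
  have hP := winding_farSW_SNE hh hr h hz0 hz1 hz2
  rw [winding_eq_WP_add_farSW hr h] at hP
  rw [hz0, hz1] at hP
  have haT : arcTurn ((fun _ : ℤ => π / 2) (farSW w).1) Side.S Side.N = 0 := rfl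
  have heW : excursionWinding (π / 2) Side.S Side.N Side.E = -π - π / 2 := rfl
  have hcs : chordSign Side.S Side.N Side.E = 1 := by decide
  rw [haT] at hP
  rcases ω.sign_law hr h (π / 2) with ⟨hWE, -⟩ | ⟨hWE, -⟩ <;> rw [hz0, hz1, hz2, heW] at hWE
  · rcases hC with hC | hC <;> rcases hP with hP | hP <;> linarith
  · rw [hcs] at hWE
    push_cast at hWE
    rcases hC with hC | hC <;> rcases hP with hP | hP <;> linarith

/-- ★ Pattern `(S, E, W)` is IMPOSSIBLE: no class-`B2a` walk at the diagonal cell of a hole root has first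
side `S`, exit side `E` and return side `W` — the two Umlaufsätze and the sign law leave no consistent value
of the prefix turning, wound or not. [cite: Hopf1935, Nr. 2 (Umlaufsatz, p. 53) and Nr. 4 eq. (22) (curves with corners, pp. 60–61)]
[cite: GlazmanManolescu2019, Lemma 2.1 (proof: [Gl])] [cite: DuminilCopinSmirnov2012, proof of Lemma 1 (the winding bookkeeping)] -/
theorem farSW_no_SEW (hh : holeFaceW w ∉ D) (hr : RootedFace D (w.side .W) (farSW w)) (h : ω.IsB2a)
    (hz0 : ω.2.firstSideG = .S) (hz1 : ω.z1 hr h = .E) (hz2 : ω.1 = .W) : False := by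
  have hπ := Real.pi_pos
  have hC := (WP_farSW_pi_div_two_mem hh h).2.2.1 hz0
  have hP := winding_farSW_SEW hh hr h hz0 hz1 hz2
  rw [winding_eq_WP_add_farSW hr h] at hP
  rw [hz0, hz1] at hP
  have haT : arcTurn ((fun _ : ℤ => π / 2) (farSW w).1) Side.S Side.E = -(π / 2) := rfl
  have heW : excursionWinding (π / 2) Side.S Side.E Side.W = 2 * π := rfl
  have hcs : chordSign Side.S Side.E Side.W = -1 := by decide
  rw [haT] at hP
  rcases ω.sign_law hr h (π / 2) with ⟨hWE, -⟩ | ⟨hWE, -⟩ <;> rw [hz0, hz1, hz2, heW] at hWE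
  · rcases hC with hC | hC <;> rcases hP with hP | hP <;> linarith
  · rw [hcs] at hWE
    push_cast at hWE
    rcases hC with hC | hC <;> rcases hP with hP | hP <;> linarith

/-- ★ Pattern `(W, S, E)`: a WOUND class-`B2a` walk at the diagonal cell with this pattern has
`WP(π/2) = 2 * π`. [cite: Hopf1935, Nr. 2 (Umlaufsatz, p. 53) and Nr. 4 eq. (22) (curves with corners, pp. 60–61)]
[cite: GlazmanManolescu2019, Lemma 2.1 (proof: [Gl])] [cite: DuminilCopinSmirnov2012, proof of Lemma 1 (the winding bookkeeping)] -/
theorem WP_farSW_WSE (hh : holeFaceW w ∉ D) (hr : RootedFace D (w.side .W) (farSW w)) (h : ω.IsB2a)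
    (hz0 : ω.2.firstSideG = .W) (hz1 : ω.z1 hr h = .S) (hz2 : ω.1 = .E)
    (hW : ω.WE (fun _ => π / 2) ≠ excursionWinding (π / 2) ω.2.firstSideG (ω.z1 hr h) ω.1) :
    ω.WP (fun _ => π / 2) = 2 * π := by
  have hπ := Real.pi_pos
  have hC := (WP_farSW_pi_div_two_mem hh h).2.2.2 hz0
  have hP := winding_farSW_WSE hh hr h hz0 hz1 hz2
  rw [winding_eq_WP_add_farSW hr h] at hP
  have hWE := WE_sub_eq_of_wound_farSW hr h (π / 2) hW
  rw [hz0, hz1] at hP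
  rw [hz0, hz1, hz2] at hWE
  have haT : arcTurn ((fun _ : ℤ => π / 2) (farSW w).1) Side.W Side.S = π / 2 - π := rfl
  have heW : excursionWinding (π / 2) Side.W Side.S Side.E = 2 * π - π / 2 := rfl
  have hcs : chordSign Side.W Side.S Side.E = -1 := by decide
  rw [haT] at hP
  rw [heW, hcs] at hWE
  push_cast at hWE
  rcases hC with hC | hC <;> rcases hP with hP | hP <;> first | exact hC | (exfalso; linarith)

/-- ★ Pattern `(W, N, E)` is IMPOSSIBLE: no class-`B2a` walk at the diagonal cell of a hole root has first
side `W`, exit side `N` and return side `E` — the two Umlaufsätze and the sign law leave no consistent value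
of the prefix turning, wound or not. [cite: Hopf1935, Nr. 2 (Umlaufsatz, p. 53) and Nr. 4 eq. (22) (curves with corners, pp. 60–61)]
[cite: GlazmanManolescu2019, Lemma 2.1 (proof: [Gl])] [cite: DuminilCopinSmirnov2012, proof of Lemma 1 (the winding bookkeeping)] -/
theorem farSW_no_WNE (hh : holeFaceW w ∉ D) (hr : RootedFace D (w.side .W) (farSW w)) (h : ω.IsB2a)
    (hz0 : ω.2.firstSideG = .W) (hz1 : ω.z1 hr h = .N) (hz2 : ω.1 = .E) : False := by
  have hπ := Real.pi_pos
  have hC := (WP_farSW_pi_div_two_mem hh h).2.2.2 hz0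
  have hP := winding_farSW_WNE hh hr h hz0 hz1 hz2
  rw [winding_eq_WP_add_farSW hr h] at hP
  rw [hz0, hz1] at hP
  have haT : arcTurn ((fun _ : ℤ => π / 2) (farSW w).1) Side.W Side.N = π / 2 := rfl
  have heW : excursionWinding (π / 2) Side.W Side.N Side.E = -π - π / 2 := rfl
  have hcs : chordSign Side.W Side.N Side.E = 1 := by decide
  rw [haT] at hP
  rcases ω.sign_law hr h (π / 2) with ⟨hWE, -⟩ | ⟨hWE, -⟩ <;> rw [hz0, hz1, hz2, heW] at hWE
  · rcases hC with hC | hC <;> rcases hP with hP | hP <;> linarith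
  · rw [hcs] at hWE
    push_cast at hWE
    rcases hC with hC | hC <;> rcases hP with hP | hP <;> linarith

/-- ★ Pattern `(W, S, N)` is IMPOSSIBLE: no class-`B2a` walk at the diagonal cell of a hole root has first
side `W`, exit side `S` and return side `N` — the two Umlaufsätze and the sign law leave no consistent value
of the prefix turning, wound or not. [cite: Hopf1935, Nr. 2 (Umlaufsatz, p. 53) and Nr. 4 eq. (22) (curves with corners, pp. 60–61)]
[cite: GlazmanManolescu2019, Lemma 2.1 (proof: [Gl])] [cite: DuminilCopinSmirnov2012, proof of Lemma 1 (the winding bookkeeping)] -/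
theorem farSW_no_WSN (hh : holeFaceW w ∉ D) (hr : RootedFace D (w.side .W) (farSW w)) (h : ω.IsB2a)
    (hz0 : ω.2.firstSideG = .W) (hz1 : ω.z1 hr h = .S) (hz2 : ω.1 = .N) : False := by
  have hπ := Real.pi_pos
  have hC := (WP_farSW_pi_div_two_mem hh h).2.2.2 hz0
  have hP := winding_farSW_WSN hh hr h hz0 hz1 hz2
  rw [winding_eq_WP_add_farSW hr h] at hP
  rw [hz0, hz1] at hP
  have haT : arcTurn ((fun _ : ℤ => π / 2) (farSW w).1) Side.W Side.S = π / 2 - π := rfl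
  have heW : excursionWinding (π / 2) Side.W Side.S Side.N = 2 * π := rfl
  have hcs : chordSign Side.W Side.S Side.N = -1 := by decide
  rw [haT] at hP
  rcases ω.sign_law hr h (π / 2) with ⟨hWE, -⟩ | ⟨hWE, -⟩ <;> rw [hz0, hz1, hz2, heW] at hWE
  · rcases hC with hC | hC <;> rcases hP with hP | hP <;> linarith
  · rw [hcs] at hWE
    push_cast at hWE
    rcases hC with hC | hC <;> rcases hP with hP | hP <;> linarith

end CombineD

/-! ## § Turning at the diagonal cell: assembly (all patterns, by reversal) -/

section MainD

variable {ω : ΩG D (w.side .W) (farSW w)}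

/-- **The forced prefix turning at the diagonal cell**, by first side: `N ↦ 3π/2`, `E ↦ −π`, `S ↦ −3π/2`, `W ↦ 2π`
(at `θ = π/2`). [cite: GlazmanManolescu2019, Lemma 2.1 (proof: [Gl])] -/
def diagTurn : Side → ℝ
  | .N => 3 * π / 2
  | .E => -π
  | .S => -(3 * π / 2)
  | .W => 2 * π

/-- The twelve directly treated patterns `(z₀, z₁, z₂)` (one orientation per class; the other orientation is the
reversed companion's). [folklore] -/
def diagPatterns : List (Side × Side × Side) :=
  [(.N, .S, .E), (.N, .W, .E), (.N, .W, .S), (.E, .S, .N), (.E, .S, .W), (.E, .W, .N),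
   (.S, .W, .N), (.S, .N, .E), (.S, .E, .W), (.W, .S, .E), (.W, .N, .E), (.W, .S, .N)]

/-- Every pattern of three distinct sides is treated directly or through its reversal. [folklore] -/
private theorem diagPatterns_cover : ∀ a b c : Side, a ≠ b → a ≠ c → b ≠ c →
    (a, b, c) ∈ diagPatterns ∨ (a, c, b) ∈ diagPatterns := by decide

/-- ★★ The directly treated patterns: a WOUND walk has `WP(π/2) = diagTurn z₀` (the four impossible patterns included,
vacuously). [cite: Hopf1935, Nr. 2 (Umlaufsatz, p. 53) and Nr. 4 eq. (22) (curves with corners, pp. 60–61)]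
[cite: GlazmanManolescu2019, Lemma 2.1 (proof: [Gl])] -/
theorem WP_farSW_eq_of_mem_diagPatterns (hh : holeFaceW w ∉ D) (hr : RootedFace D (w.side .W) (farSW w))
    (h : ω.IsB2a) (hmem : (ω.2.firstSideG, ω.z1 hr h, ω.1) ∈ diagPatterns)
    (hW : ω.WE (fun _ => π / 2) ≠ excursionWinding (π / 2) ω.2.firstSideG (ω.z1 hr h) ω.1) :
    ω.WP (fun _ => π / 2) = diagTurn ω.2.firstSideG := by
  simp only [diagPatterns, List.mem_cons, Prod.mk.injEq, List.mem_nil_iff, or_false] at hmem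
  rcases hmem with ⟨h0, h1, h2⟩ | ⟨h0, h1, h2⟩ | ⟨h0, h1, h2⟩ | ⟨h0, h1, h2⟩ | ⟨h0, h1, h2⟩ | ⟨h0, h1, h2⟩ |
      ⟨h0, h1, h2⟩ | ⟨h0, h1, h2⟩ | ⟨h0, h1, h2⟩ | ⟨h0, h1, h2⟩ | ⟨h0, h1, h2⟩ | ⟨h0, h1, h2⟩
  · rw [WP_farSW_NSE hh hr h h0 h1 h2 hW, h0]; rfl
  · rw [WP_farSW_NWE hh hr h h0 h1 h2 hW, h0]; rfl
  · rw [WP_farSW_NWS hh hr h h0 h1 h2 hW, h0]; rfl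
  · rw [WP_farSW_ESN hh hr h h0 h1 h2 hW, h0]; rfl
  · rw [WP_farSW_ESW hh hr h h0 h1 h2 hW, h0]; rfl
  · rw [WP_farSW_EWN hh hr h h0 h1 h2 hW, h0]; rfl
  · rw [WP_farSW_SWN hh hr h h0 h1 h2 hW, h0]; rfl
  · exact (farSW_no_SNE hh hr h h0 h1 h2).elim
  · exact (farSW_no_SEW hh hr h h0 h1 h2).elim
  · rw [WP_farSW_WSE hh hr h h0 h1 h2 hW, h0]; rfl
  · exact (farSW_no_WNE hh hr h h0 h1 h2).elim
  · exact (farSW_no_WSN hh hr h h0 h1 h2).elim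

/-- ★★★ **THE TURNING RIGIDITY AT THE DIAGONAL CELL (θ = π/2).** For every WOUND class-`B2a` walk at the diagonal
cell `farSW w = (w.1 − 2, w.2 − 1)` of the hole root `w.side W` (hole `(w.1 − 1, w.2) ∉ D`), the right-angle turning
of the prefix is ONE number fixed by the first side alone: `3π/2` (`N`, over the hole), `−π` (`E`, under the hole),
`−3π/2` (`S`, from below), `2π` (`W`, once around). No orientation or winding-number input is used: two discrete
Umlaufsätze (prefix polygon, whole-walk polygon) and the sign law. [cite: Hopf1935, Nr. 2 (Umlaufsatz, p. 53) and Nr. 4 eq. (22) (curves with corners, pp. 60–61)]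
[cite: GlazmanManolescu2019, Lemma 2.1 (proof: [Gl])] [cite: DuminilCopinSmirnov2012, proof of Lemma 1 («we used the fact that a is on the boundary and Ω is simply connected»)] -/
theorem WP_farSW_pi_div_two_eq_of_wound (hh : holeFaceW w ∉ D) (hr : RootedFace D (w.side .W) (farSW w))
    (h : ω.IsB2a) (hW : ω.WE (fun _ => π / 2) ≠ excursionWinding (π / 2) ω.2.firstSideG (ω.z1 hr h) ω.1) :
    ω.WP (fun _ => π / 2) = diagTurn ω.2.firstSideG := by
  obtain ⟨hz01, hz02, hz12⟩ := ω.firstSide_exit_return_distinct hr h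
  rcases diagPatterns_cover _ _ _ hz01 hz02 hz12 with hd | hd
  · exact WP_farSW_eq_of_mem_diagPatterns hh hr h hd hW
  · have h'' := ω.rev_isB2a hr h
    have e1 : (ω.rev hr).z1 hr h'' = ω.1 := by unfold ΩG.z1; exact ω.rev_exitSide hr h
    have e2 : (ω.rev hr).1 = ω.z1 hr h := ω.rev_fst hr h
    have e0 : (ω.rev hr).2.firstSideG = ω.2.firstSideG := ω.rev_firstSide hr h
    have hWr : (ω.rev hr).WE (fun _ => π / 2) ≠
        excursionWinding (π / 2) (ω.rev hr).2.firstSideG ((ω.rev hr).z1 hr h'') (ω.rev hr).1 := by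
      rw [ω.rev_WE (fun _ => π / 2) hr h, e0, e1, e2, excursionWinding_swap]
      intro e; apply hW; linarith
    have key := WP_farSW_eq_of_mem_diagPatterns (ω := ω.rev hr) hh hr h'' (by rw [e0, e1, e2]; exact hd) hWr
    rwa [ω.rev_WP (fun _ => π / 2) hr h, e0] at key

/-- ★★ **ENTRY–EXIT EXCLUSION AT THE DIAGONAL CELL.** A class-`B2a` walk (wound or not) at the diagonal cell
`farSW w` of the hole root that entered from `S` never uses the side `E` (neither as exit nor as return side), and one
that entered from `W` never uses `N`: the prefix and the diagonal closing separate the excursion's start from the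
cells `E`/`N` of `d`. [cite: Hopf1935, Nr. 2 (Umlaufsatz, p. 53) and Nr. 4 eq. (22) (curves with corners, pp. 60–61)]
[cite: GlazmanManolescu2019, Lemma 2.1 (proof: [Gl])] -/
theorem farSW_entry_exit_exclusion (hh : holeFaceW w ∉ D) (hr : RootedFace D (w.side .W) (farSW w))
    (h : ω.IsB2a) :
    (ω.2.firstSideG = .S → ω.z1 hr h ≠ .E ∧ ω.1 ≠ .E) ∧ (ω.2.firstSideG = .W → ω.z1 hr h ≠ .N ∧ ω.1 ≠ .N) := by
  obtain ⟨hz01, hz02, hz12⟩ := ω.firstSide_exit_return_distinct hr h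
  have h'' := ω.rev_isB2a hr h
  have e1 : (ω.rev hr).z1 hr h'' = ω.1 := by unfold ΩG.z1; exact ω.rev_exitSide hr h
  have e2 : (ω.rev hr).1 = ω.z1 hr h := ω.rev_fst hr h
  have e0 : (ω.rev hr).2.firstSideG = ω.2.firstSideG := ω.rev_firstSide hr h
  -- the four impossible patterns, directly and reversed
  have direct : ∀ (ω' : ΩG D (w.side .W) (farSW w)) (h' : ω'.IsB2a),
      ¬(ω'.2.firstSideG = .S ∧ ω'.z1 hr h' = .N ∧ ω'.1 = .E) ∧ ¬(ω'.2.firstSideG = .S ∧ ω'.z1 hr h' = .E ∧ ω'.1 = .W) ∧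
      ¬(ω'.2.firstSideG = .W ∧ ω'.z1 hr h' = .N ∧ ω'.1 = .E) ∧ ¬(ω'.2.firstSideG = .W ∧ ω'.z1 hr h' = .S ∧ ω'.1 = .N) :=
    fun ω' h' => ⟨fun hc => farSW_no_SNE hh hr h' hc.1 hc.2.1 hc.2.2, fun hc => farSW_no_SEW hh hr h' hc.1 hc.2.1 hc.2.2,
      fun hc => farSW_no_WNE hh hr h' hc.1 hc.2.1 hc.2.2, fun hc => farSW_no_WSN hh hr h' hc.1 hc.2.1 hc.2.2⟩
  obtain ⟨d1, d2, d3, d4⟩ := direct ω h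
  obtain ⟨r1, r2, r3, r4⟩ := direct (ω.rev hr) h''
  rw [e0, e1, e2] at r1 r2 r3 r4
  constructor
  · intro hS
    constructor
    · intro hE
      -- return side is N or W
      rcases hω : ω.1 with _ | _ | _ | _
      · -- W: pattern (S, E, W) impossible
        exact d2 ⟨hS, hE, hω⟩
      · rw [hE, hω] at hz12; exact hz12 rfl
      · rw [hS, hω] at hz02; exact hz02 rfl
      · -- N: reversed pattern (S, N, E) impossible
        exact r1 ⟨hS, hω, hE⟩
    · intro hE
      rcases hω : ω.z1 hr h with _ | _ | _ | _
      · -- exit W: reversed (S, E, W)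
        exact r2 ⟨hS, hE, hω⟩
      · rw [hE, hω] at hz12; exact hz12 rfl
      · rw [hS, hω] at hz01; exact hz01 rfl
      · exact d1 ⟨hS, hω, hE⟩
  · intro hWst
    constructor
    · intro hN
      rcases hω : ω.1 with _ | _ | _ | _
      · rw [hWst, hω] at hz02; exact hz02 rfl
      · exact d3 ⟨hWst, hN, hω⟩
      · exact r4 ⟨hWst, hω, hN⟩
      · rw [hN, hω] at hz12; exact hz12 rfl
    · intro hN
      rcases hω : ω.z1 hr h with _ | _ | _ | _
      · rw [hWst, hω] at hz01; exact hz01 rfl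
      · exact r3 ⟨hWst, hN, hω⟩
      · exact d4 ⟨hWst, hω, hN⟩
      · rw [hN, hω] at hz12; exact hz12 rfl

/-- **Woundness does not depend on the angle.** [cite: GlazmanManolescu2019, Lemma 2.1 (proof: [Gl])] -/
theorem WE_sub_excursionWinding_const_farSW (hr : RootedFace D (w.side .W) (farSW w)) (h : ω.IsB2a) (θ : ℝ) :
    ω.WE (fun _ => θ) - excursionWinding θ ω.2.firstSideG (ω.z1 hr h) ω.1 =
      ω.WE (fun _ => π / 2) - excursionWinding (π / 2) ω.2.firstSideG (ω.z1 hr h) ω.1 := by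
  obtain ⟨hz01, hz02, hz12⟩ := ω.firstSide_exit_return_distinct hr h
  have e1 := ω.WE_eq_WE_pi_div_two_add hr h (fun _ => θ)
  have e2 := excursionWinding_theta θ hz01 hz02 hz12
  unfold ΩG.z1 at e2 ⊢
  rw [e1, e2]; ring

/-- **The prefix turning at a general angle**: `WP(θ) = WP(π/2) + (θ − π/2)·slantInd(z₀)` (the root is a vertical
mid-edge; `slantInd = 1` for the slanted first sides `N`, `S`, `0` for `E`, `W`). [cite: GlazmanManolescu2019, Lemma 2.1 (proof: [Gl])] -/
theorem WP_farSW_const (h : ω.IsB2a) (θ : ℝ) :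
    ω.WP (fun _ => θ) = ω.WP (fun _ => π / 2) + (θ - π / 2) * ω.2.firstSideG.slantInd := by
  have e : slantPot (fun _ => θ) (ω.2.nth ω.2.firstHitG) = (θ - π / 2) * ω.2.firstSideG.slantInd := by
    rw [ω.2.nth_firstHitG, slantPot_side]
  have e0 : slantPot (fun _ : ℤ => θ) (w.side .W) = 0 := by rw [slantPot_side]; simp [Side.slantInd]
  rw [← preD_winding h, ← preD_winding h, YBWalk.winding_eq_winding_pi_div_two_add (fun _ => θ) (ω.preD h), e, e0]
  ring

/-- ★★★ **THE TURNING RIGIDITY AT THE DIAGONAL CELL, every angle.** For every WOUND class-`B2a` walk at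
`farSW w` (hole `holeFaceW w ∉ D`): first side `N` ⇒ `WP(θ) = π + θ`; `E` ⇒ `WP(θ) = −π`; `S` ⇒ `WP(θ) = θ − 2π`;
`W` ⇒ `WP(θ) = 2π`. (Net corners and co-corners `(1, 2)… `: `(a, b) = (2, 1), (−1, −1), (−1, −2), (2, 2)` in the
lane's bookkeeping `WP = aθ + b(π − θ)`.) [cite: Hopf1935, Nr. 2 (Umlaufsatz, p. 53) and Nr. 4 eq. (22) (curves with corners, pp. 60–61)]
[cite: GlazmanManolescu2019, Lemma 2.1 (proof: [Gl])] [cite: DuminilCopinSmirnov2012, proof of Lemma 1 («we used the fact that a is on the boundary and Ω is simply connected»)] -/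
theorem WP_farSW_eq_of_wound (hh : holeFaceW w ∉ D) (hr : RootedFace D (w.side .W) (farSW w)) (h : ω.IsB2a)
    (θ : ℝ) (hW : ω.WE (fun _ => θ) ≠ excursionWinding θ ω.2.firstSideG (ω.z1 hr h) ω.1) :
    (ω.2.firstSideG = .N → ω.WP (fun _ => θ) = π + θ) ∧ (ω.2.firstSideG = .E → ω.WP (fun _ => θ) = -π) ∧
      (ω.2.firstSideG = .S → ω.WP (fun _ => θ) = θ - 2 * π) ∧ (ω.2.firstSideG = .W → ω.WP (fun _ => θ) = 2 * π) := by
  have hW' : ω.WE (fun _ => π / 2) ≠ excursionWinding (π / 2) ω.2.firstSideG (ω.z1 hr h) ω.1 := by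
    intro e; apply hW
    have := WE_sub_excursionWinding_const_farSW (ω := ω) hr h θ
    linarith
  have key := WP_farSW_pi_div_two_eq_of_wound hh hr h hW'
  have htr := WP_farSW_const (ω := ω) h θ
  refine ⟨fun hz => ?_, fun hz => ?_, fun hz => ?_, fun hz => ?_⟩ <;> rw [htr, key, hz] <;>
    simp only [diagTurn, Side.slantInd] <;> ring

end MainD

end ΩG

/-! ## § The DIAGONAL-CELL LAW: the class directions

With the turning pinned, Part A's `classTerm_dichotomy` makes the signed class term of every wound walk at the diagonal
cell EXPLICIT: `extWeight · v(θ) · diagDir(θ; z₀, z₁, z₂)`, a unit complex number depending only on the first side and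
the unordered pair {exit, return}. The eight directions (sixteen ordered patterns; the eight excluded ones never
occur): `N`: `{S,W} ↦ 1`, `{E,S} ↦ e^{iπ/8}`, `{E,W} ↦ e^{i(3θ/8 − π/8)}`; `E`: `{N,S} ↦ e^{−i7π/8}`,
`{S,W} ↦ e^{i(3θ/8 − π)}`, `{N,W} ↦ e^{i(3θ/8 − 9π/8)}`; `S`: `{N,W} ↦ −1`; `W`: `{E,S} ↦ e^{i3θ/8}`. -/

section LawAlgebra

/-- The unit direction `e^{ix}`. [folklore] -/
private theorem norm_cexp_real_mul_I (x : ℝ) : ‖Complex.exp (((x : ℝ) : ℂ) * Complex.I)‖ = 1 :=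
  Complex.norm_exp_ofReal_mul_I x

/-- Two phases multiply by adding the angles. [folklore] -/
private theorem cexp_mul_cexpD (a b : ℝ) :
    Complex.exp (((a : ℝ) : ℂ) * Complex.I) * Complex.exp (((b : ℝ) : ℂ) * Complex.I) =
      Complex.exp ((((a + b : ℝ)) : ℂ) * Complex.I) := by
  rw [← Complex.exp_add]; congr 1; push_cast; ring

/-- Angles differing by a multiple of `2π` give the same phase. [folklore] -/
private theorem cexp_I_eq_of_int (a b : ℝ) (n : ℤ) (h : a = b + n * (2 * π)) :
    Complex.exp (((a : ℝ) : ℂ) * Complex.I) = Complex.exp (((b : ℝ) : ℂ) * Complex.I) := by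
  rw [Complex.exp_eq_exp_iff_exists_int]
  exact ⟨n, by rw [h]; push_cast; ring⟩

/-- `e^{iπ/2} = i`. [folklore] -/
private theorem cexp_pi_div_twoD : Complex.exp ((((π / 2 : ℝ)) : ℂ) * Complex.I) = Complex.I := by
  rw [Complex.exp_mul_I]; push_cast
  rw [Complex.cos_pi_div_two, Complex.sin_pi_div_two]; simp

/-- `i · e^{ix} = e^{i(x + π/2)}`. [folklore] -/
private theorem I_mul_cexpD (x : ℝ) :
    Complex.I * Complex.exp (((x : ℝ) : ℂ) * Complex.I) = Complex.exp ((((x + π / 2 : ℝ)) : ℂ) * Complex.I) := by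
  rw [show (((x + π / 2 : ℝ)) : ℂ) * Complex.I = ((x : ℝ) : ℂ) * Complex.I + (((π / 2 : ℝ)) : ℂ) * Complex.I by
    push_cast; ring, Complex.exp_add, cexp_pi_div_twoD]; ring

/-- `−e^{ix} = e^{i(x + π)}`. [folklore] -/
private theorem neg_cexpD (x : ℝ) :
    -Complex.exp (((x : ℝ) : ℂ) * Complex.I) = Complex.exp ((((x + π : ℝ)) : ℂ) * Complex.I) := by
  rw [show (((x + π : ℝ)) : ℂ) * Complex.I = ((x : ℝ) : ℂ) * Complex.I + ((π : ℝ) : ℂ) * Complex.I by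
    push_cast; ring, Complex.exp_add, Complex.exp_pi_mul_I]; ring

/-- **The class directions at the diagonal cell** `diagDir θ z₀ z₁ z₂` (symmetric in the exit/return sides; junk `0` on
the excluded and degenerate patterns). [cite: GlazmanManolescu2019, Lemma 2.1 (statement, "in the form given in [Gl]")]
[cite: Glazman2015WeightedSAW, Lemma 3.1, eq. (1) (the weight v(θ))] -/
def diagDir (θ : ℝ) : Side → Side → Side → ℂ
  | .N, .S, .W => 1
  | .N, .W, .S => 1
  | .N, .E, .S => Complex.exp ((((π / 8 : ℝ)) : ℂ) * Complex.I)
  | .N, .S, .E => Complex.exp ((((π / 8 : ℝ)) : ℂ) * Complex.I)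
  | .N, .E, .W => Complex.exp ((((3 * θ / 8 - π / 8 : ℝ)) : ℂ) * Complex.I)
  | .N, .W, .E => Complex.exp ((((3 * θ / 8 - π / 8 : ℝ)) : ℂ) * Complex.I)
  | .E, .N, .S => Complex.exp ((((-(7 * π / 8) : ℝ)) : ℂ) * Complex.I)
  | .E, .S, .N => Complex.exp ((((-(7 * π / 8) : ℝ)) : ℂ) * Complex.I)
  | .E, .S, .W => Complex.exp ((((3 * θ / 8 - π : ℝ)) : ℂ) * Complex.I)
  | .E, .W, .S => Complex.exp ((((3 * θ / 8 - π : ℝ)) : ℂ) * Complex.I)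
  | .E, .N, .W => Complex.exp ((((3 * θ / 8 - 9 * π / 8 : ℝ)) : ℂ) * Complex.I)
  | .E, .W, .N => Complex.exp ((((3 * θ / 8 - 9 * π / 8 : ℝ)) : ℂ) * Complex.I)
  | .S, .W, .N => -1
  | .S, .N, .W => -1
  | .W, .E, .S => Complex.exp ((((3 * θ / 8 : ℝ)) : ℂ) * Complex.I)
  | .W, .S, .E => Complex.exp ((((3 * θ / 8 : ℝ)) : ℂ) * Complex.I)
  | _, _, _ => 0

/-- The class directions are symmetric in the exit and return sides. [cite: GlazmanManolescu2019, Lemma 2.1 (statement, "in the form given in [Gl]"); lane plumbing] -/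
theorem diagDir_swap (θ : ℝ) (z₀ z₁ z₂ : Side) : diagDir θ z₀ z₂ z₁ = diagDir θ z₀ z₁ z₂ := by
  cases z₀ <;> cases z₁ <;> cases z₂ <;> rfl

/-- The realizable class directions have modulus `1`. [cite: Glazman2015WeightedSAW, Lemma 3.1, eq. (1) (the weight v(θ)); lane plumbing] -/
theorem norm_diagDir {θ : ℝ} {z₀ z₁ z₂ : Side} (h01 : z₀ ≠ z₁) (h02 : z₀ ≠ z₂) (h12 : z₁ ≠ z₂)
    (hS : z₀ = .S → z₁ ≠ .E ∧ z₂ ≠ .E) (hW : z₀ = .W → z₁ ≠ .N ∧ z₂ ≠ .N) : ‖diagDir θ z₀ z₁ z₂‖ = 1 := by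
  revert h01 h02 h12 hS hW
  cases z₀ <;> cases z₁ <;> cases z₂ <;> intro h01 h02 h12 hS hW <;> simp only [diagDir] <;>
    first
    | exact absurd rfl h01
    | exact absurd rfl h02
    | exact absurd rfl h12
    | exact absurd rfl (hS rfl).1
    | exact absurd rfl (hS rfl).2
    | exact absurd rfl (hW rfl).1
    | exact absurd rfl (hW rfl).2
    | exact norm_cexp_real_mul_I _
    | simp

/-- The prefix turning at angle `θ`, by first side (the values of `ΩG.WP_farSW_eq_of_wound`). [cite: GlazmanManolescu2019, Lemma 2.1 (proof: [Gl])] -/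
def diagTurnAt (θ : ℝ) : Side → ℝ
  | .N => π + θ
  | .E => -π
  | .S => θ - 2 * π
  | .W => 2 * π

/-- `N`, class `{E, S}`: direction `e^{iπ/8}`. [cite: Glazman2015WeightedSAW, Lemma 3.1, eq. (1) (the weight v(θ))] [cite: GlazmanManolescu2019, Lemma 2.1 (proof: [Gl])] -/
theorem diag_term_N_E_S (θ : ℝ) :
    phase (π + θ) * ((chordSign .N .E .S : ℂ) * backBracket θ .N .E .S .W) =
      (weightV θ : ℂ) * Complex.exp ((((π / 8 : ℝ)) : ℂ) * Complex.I) := by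
  have hcs : ((chordSign .N .E .S : ℤ) : ℂ) = 1 := by rw [show chordSign .N .E .S = 1 by decide]; simp
  rw [backBracket_N_E_S_W, phase, hcs]
  have f : Complex.exp ((((-(5 / 8 * (π + θ))) : ℝ) : ℂ) * Complex.I) *
      Complex.exp ((((5 * θ / 8 - 5 * π / 4 : ℝ)) : ℂ) * Complex.I) = Complex.exp ((((π / 8 : ℝ)) : ℂ) * Complex.I) := by
    rw [cexp_mul_cexpD]; exact cexp_I_eq_of_int _ _ (-1) (by push_cast; ring)
  linear_combination (weightV θ : ℂ) * f
/-- `N`, class `{E, W}`: direction `e^{i(3θ/8 − π/8)}`. [cite: Glazman2015WeightedSAW, Lemma 3.1, eq. (1) (the weight v(θ))] [cite: GlazmanManolescu2019, Lemma 2.1 (proof: [Gl])] -/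
theorem diag_term_N_E_W (θ : ℝ) :
    phase (π + θ) * ((chordSign .N .E .W : ℂ) * backBracket θ .N .E .W .S) =
      (weightV θ : ℂ) * Complex.exp ((((3 * θ / 8 - π / 8 : ℝ)) : ℂ) * Complex.I) := by
  have hcs : ((chordSign .N .E .W : ℤ) : ℂ) = 1 := by rw [show chordSign .N .E .W = 1 by decide]; simp
  rw [backBracket_N_E_W_S, phase, hcs]
  have f : Complex.I * Complex.exp (((θ : ℝ) : ℂ) * Complex.I) *
      Complex.exp ((((-(5 / 8 * (π + θ))) : ℝ) : ℂ) * Complex.I) =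
        Complex.exp ((((3 * θ / 8 - π / 8 : ℝ)) : ℂ) * Complex.I) := by
    rw [I_mul_cexpD, cexp_mul_cexpD]; exact cexp_I_eq_of_int _ _ 0 (by push_cast; ring)
  linear_combination (weightV θ : ℂ) * f
/-- `N`, class `{W, S}`: direction `1` (the far cell's over-route value). [cite: Glazman2015WeightedSAW, Lemma 3.1, eq. (1) (the weight v(θ))] [cite: GlazmanManolescu2019, Lemma 2.1 (proof: [Gl])] -/
theorem diag_term_N_W_S (θ : ℝ) :
    phase (π + θ) * ((chordSign .N .W .S : ℂ) * backBracket θ .N .W .S .E) = (weightV θ : ℂ) * 1 := by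
  have hcs : ((chordSign .N .W .S : ℤ) : ℂ) = -1 := by rw [show chordSign .N .W .S = -1 by decide]; simp
  rw [backBracket_N_W_S_E, phase, hcs]
  have f : Complex.exp ((((-(5 / 8 * (π + θ))) : ℝ) : ℂ) * Complex.I) *
      Complex.exp ((((5 * θ / 8 + 5 * π / 8 : ℝ)) : ℂ) * Complex.I) = 1 := by
    rw [cexp_mul_cexpD, show (-(5 / 8 * (π + θ)) + (5 * θ / 8 + 5 * π / 8) : ℝ) = 0 by ring]; simp
  linear_combination (weightV θ : ℂ) * f
/-- `E`, class `{N, S}`: direction `e^{−i7π/8}`. [cite: Glazman2015WeightedSAW, Lemma 3.1, eq. (1) (the weight v(θ))] [cite: GlazmanManolescu2019, Lemma 2.1 (proof: [Gl])] -/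
theorem diag_term_E_N_S (θ : ℝ) :
    phase (-π) * ((chordSign .E .N .S : ℂ) * backBracket θ .E .N .S .W) =
      (weightV θ : ℂ) * Complex.exp ((((-(7 * π / 8) : ℝ)) : ℂ) * Complex.I) := by
  have hcs : ((chordSign .E .N .S : ℤ) : ℂ) = -1 := by rw [show chordSign .E .N .S = -1 by decide]; simp
  rw [backBracket_E_N_S_W, phase, hcs]
  have f : Complex.I * Complex.exp ((((-(5 / 8 * -π)) : ℝ) : ℂ) * Complex.I) =
      Complex.exp ((((-(7 * π / 8) : ℝ)) : ℂ) * Complex.I) := by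
    rw [I_mul_cexpD]; exact cexp_I_eq_of_int _ _ 1 (by push_cast; ring)
  linear_combination (weightV θ : ℂ) * f
/-- `E`, class `{S, W}`: direction `e^{i(3θ/8 − π)}`. [cite: Glazman2015WeightedSAW, Lemma 3.1, eq. (1) (the weight v(θ))] [cite: GlazmanManolescu2019, Lemma 2.1 (proof: [Gl])] -/
theorem diag_term_E_S_W (θ : ℝ) :
    phase (-π) * ((chordSign .E .S .W : ℂ) * backBracket θ .E .S .W .N) =
      (weightV θ : ℂ) * Complex.exp ((((3 * θ / 8 - π : ℝ)) : ℂ) * Complex.I) := by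
  have hcs : ((chordSign .E .S .W : ℤ) : ℂ) = 1 := by rw [show chordSign .E .S .W = 1 by decide]; simp
  rw [backBracket_E_S_W_N, phase, hcs]
  have f : -(Complex.exp ((((-(5 / 8 * -π)) : ℝ) : ℂ) * Complex.I) *
      Complex.exp ((((3 * θ / 8 - 5 * π / 8 : ℝ)) : ℂ) * Complex.I)) =
        Complex.exp ((((3 * θ / 8 - π : ℝ)) : ℂ) * Complex.I) := by
    rw [cexp_mul_cexpD, neg_cexpD]; exact cexp_I_eq_of_int _ _ 1 (by push_cast; ring)
  linear_combination (weightV θ : ℂ) * f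
/-- `E`, class `{N, W}`: direction `e^{i(3θ/8 − 9π/8)}`. [cite: Glazman2015WeightedSAW, Lemma 3.1, eq. (1) (the weight v(θ))] [cite: GlazmanManolescu2019, Lemma 2.1 (proof: [Gl])] -/
theorem diag_term_E_N_W (θ : ℝ) :
    phase (-π) * ((chordSign .E .N .W : ℂ) * backBracket θ .E .N .W .S) =
      (weightV θ : ℂ) * Complex.exp ((((3 * θ / 8 - 9 * π / 8 : ℝ)) : ℂ) * Complex.I) := by
  have hcs : ((chordSign .E .N .W : ℤ) : ℂ) = -1 := by rw [show chordSign .E .N .W = -1 by decide]; simp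
  rw [backBracket_E_N_W_S, phase, hcs]
  have f : -(Complex.exp ((((-(5 / 8 * -π)) : ℝ) : ℂ) * Complex.I) *
      Complex.exp ((((3 * θ / 8 + 5 * π / 4 : ℝ)) : ℂ) * Complex.I)) =
        Complex.exp ((((3 * θ / 8 - 9 * π / 8 : ℝ)) : ℂ) * Complex.I) := by
    rw [cexp_mul_cexpD, neg_cexpD]; exact cexp_I_eq_of_int _ _ 2 (by push_cast; ring)
  linear_combination (weightV θ : ℂ) * f
/-- `S`, class `{W, N}`: direction `−1` (the far cell's under-route value; the far-cell file's `farCellW_termS`).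
[cite: Glazman2015WeightedSAW, Lemma 3.1, eq. (1) (the weight v(θ))] [cite: GlazmanManolescu2019, Lemma 2.1 (proof: [Gl])] -/
theorem diag_term_S_W_N (θ : ℝ) :
    phase (θ - 2 * π) * ((chordSign .S .W .N : ℂ) * backBracket θ .S .W .N .E) = (weightV θ : ℂ) * (-1) := by
  rw [farCellW_termS θ (z₁ := .W) (z₂ := .N) (z₃ := .E) (by decide) (by decide) (by decide) (by decide) (by decide)
    ⟨by decide, by decide, by decide⟩]
  ring

/-- `W`, class `{E, S}`: direction `e^{i3θ/8}`. [cite: Glazman2015WeightedSAW, Lemma 3.1, eq. (1) (the weight v(θ))] [cite: GlazmanManolescu2019, Lemma 2.1 (proof: [Gl])] -/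
theorem diag_term_W_E_S (θ : ℝ) :
    phase (2 * π) * ((chordSign .W .E .S : ℂ) * backBracket θ .W .E .S .N) =
      (weightV θ : ℂ) * Complex.exp ((((3 * θ / 8 : ℝ)) : ℂ) * Complex.I) := by
  have hcs : ((chordSign .W .E .S : ℤ) : ℂ) = 1 := by rw [show chordSign .W .E .S = 1 by decide]; simp
  rw [backBracket_W_E_S_N, phase, hcs]
  have f : -(Complex.I * (Complex.exp ((((-(5 / 8 * (2 * π))) : ℝ) : ℂ) * Complex.I) *
      Complex.exp ((((3 * θ / 8 - π / 4 : ℝ)) : ℂ) * Complex.I))) =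
        Complex.exp ((((3 * θ / 8 : ℝ)) : ℂ) * Complex.I) := by
    rw [cexp_mul_cexpD, I_mul_cexpD, neg_cexpD]; exact cexp_I_eq_of_int _ _ 0 (by push_cast; ring)
  linear_combination (weightV θ : ℂ) * f
/-- The eight directly listed realizable patterns. [folklore] -/
def diagRealPatterns : List (Side × Side × Side) :=
  [(.N, .E, .S), (.N, .E, .W), (.N, .W, .S), (.E, .N, .S), (.E, .S, .W), (.E, .N, .W), (.S, .W, .N), (.W, .E, .S)]

/-- Every non-excluded pattern of three distinct sides is listed directly or reversed. [folklore] -/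
private theorem diagRealPatterns_cover : ∀ a b c : Side, a ≠ b → a ≠ c → b ≠ c →
    (a, b, c) ∈ diagRealPatterns ∨ (a, c, b) ∈ diagRealPatterns ∨
      (a = .S ∧ (b = .E ∨ c = .E)) ∨ (a = .W ∧ (b = .N ∨ c = .N)) := by decide

/-- ★ **The class term algebra at the diagonal cell**, listed patterns: `phase(WP)·ε(z₀; z₁, z₂)·backBracket =
v(θ)·diagDir(θ; z₀, z₁, z₂)`. [cite: GlazmanManolescu2019, Lemma 2.1 (statement, "in the form given in [Gl]")]
[cite: Glazman2015WeightedSAW, Lemma 3.1, eq. (1) (the weight v(θ))] -/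
theorem diag_term_of_mem (θ : ℝ) {z₀ z₁ z₂ z₃ : Side} (hmem : (z₀, z₁, z₂) ∈ diagRealPatterns)
    (h3 : z₃ ≠ z₀ ∧ z₃ ≠ z₁ ∧ z₃ ≠ z₂) :
    phase (diagTurnAt θ z₀) * ((chordSign z₀ z₁ z₂ : ℂ) * backBracket θ z₀ z₁ z₂ z₃) =
      (weightV θ : ℂ) * diagDir θ z₀ z₁ z₂ := by
  obtain ⟨h3a, h3b, h3c⟩ := h3
  simp only [diagRealPatterns, List.mem_cons, Prod.mk.injEq, List.mem_nil_iff, or_false] at hmem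
  rcases hmem with ⟨rfl, rfl, rfl⟩ | ⟨rfl, rfl, rfl⟩ | ⟨rfl, rfl, rfl⟩ | ⟨rfl, rfl, rfl⟩ | ⟨rfl, rfl, rfl⟩ |
      ⟨rfl, rfl, rfl⟩ | ⟨rfl, rfl, rfl⟩ | ⟨rfl, rfl, rfl⟩
  · obtain rfl : z₃ = .W := by revert h3a h3b h3c; cases z₃ <;> simp
    exact diag_term_N_E_S θ
  · obtain rfl : z₃ = .S := by revert h3a h3b h3c; cases z₃ <;> simp
    exact diag_term_N_E_W θ
  · obtain rfl : z₃ = .E := by revert h3a h3b h3c; cases z₃ <;> simp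
    exact diag_term_N_W_S θ
  · obtain rfl : z₃ = .W := by revert h3a h3b h3c; cases z₃ <;> simp
    exact diag_term_E_N_S θ
  · obtain rfl : z₃ = .N := by revert h3a h3b h3c; cases z₃ <;> simp
    exact diag_term_E_S_W θ
  · obtain rfl : z₃ = .S := by revert h3a h3b h3c; cases z₃ <;> simp
    exact diag_term_E_N_W θ
  · obtain rfl : z₃ = .E := by revert h3a h3b h3c; cases z₃ <;> simp
    exact diag_term_S_W_N θ
  · obtain rfl : z₃ = .N := by revert h3a h3b h3c; cases z₃ <;> simp
    exact diag_term_W_E_S θ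

/-- ★★ **THE CLASS TERM ALGEBRA AT THE DIAGONAL CELL, all realizable patterns** (the reversed orientation carries
the same signed direction, `ΩG.chordSign_mul_backBracket_swap`). [cite: GlazmanManolescu2019, Lemma 2.1 (statement, "in the form given in [Gl]")]
[cite: Glazman2015WeightedSAW, Lemma 3.1, eq. (1) (the weight v(θ))] -/
theorem diag_term (θ : ℝ) {z₀ z₁ z₂ z₃ : Side} (h01 : z₀ ≠ z₁) (h02 : z₀ ≠ z₂) (h12 : z₁ ≠ z₂)
    (h3 : z₃ ≠ z₀ ∧ z₃ ≠ z₁ ∧ z₃ ≠ z₂) (hS : z₀ = .S → z₁ ≠ .E ∧ z₂ ≠ .E) (hW : z₀ = .W → z₁ ≠ .N ∧ z₂ ≠ .N) :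
    phase (diagTurnAt θ z₀) * ((chordSign z₀ z₁ z₂ : ℂ) * backBracket θ z₀ z₁ z₂ z₃) =
      (weightV θ : ℂ) * diagDir θ z₀ z₁ z₂ := by
  rcases diagRealPatterns_cover _ _ _ h01 h02 h12 with hd | hd | hx | hx
  · exact diag_term_of_mem θ hd h3
  · rw [← ΩG.chordSign_mul_backBracket_swap θ h01 h02 (Ne.symm h3.1) h12 (Ne.symm h3.2.1) (Ne.symm h3.2.2),
      ← diagDir_swap]
    exact diag_term_of_mem θ hd ⟨h3.1, h3.2.2, h3.2.1⟩
  · rcases hx.2 with e | e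
    · exact absurd e (hS hx.1).1
    · exact absurd e (hS hx.1).2
  · rcases hx.2 with e | e
    · exact absurd e (hW hx.1).1
    · exact absurd e (hW hx.1).2

end LawAlgebra

namespace ΩG

variable {D : Set Face} {w : Face}

section LawD

open Classical in
/-- **The diagonal class term of a walk**: for a class-`B2a` walk at the diagonal cell that is WOUND, its exterior
weight times its class direction `diagDir(θ; z₀, z₁, z₂)`; else `0`. [cite: GlazmanManolescu2019, Lemma 2.1 (statement, "in the form given in [Gl]")]
[cite: Glazman2015WeightedSAW, Lemma 3.1 (proof, pp. 6–7)] -/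
noncomputable def diagClassTerm (θ : ℝ) (hr : RootedFace D (w.side .W) (farSW w)) (ω : ΩG D (w.side .W) (farSW w)) : ℂ :=
  if h : ω.IsB2a then
    (if ω.WE (fun _ => θ) ≠ excursionWinding θ ω.2.firstSideG (ω.z1 hr h) ω.1 then
      (ω.2.extWeight (fun _ => θ) (farSW w) : ℂ) * diagDir θ ω.2.firstSideG (ω.z1 hr h) ω.1 else 0)
  else 0

/-- ★★★ **THE CLASS TERM AT THE DIAGONAL CELL IS EXPLICIT**: for every class-`B2a` walk at `farSW w`,
`classTerm = v(θ) · diagClassTerm` — zero if unwound, `v(θ)·extWeight·diagDir(θ; z₀, z₁, z₂)` if wound.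
[cite: GlazmanManolescu2019, Lemma 2.1 (statement, "in the form given in [Gl]")] [cite: Glazman2015WeightedSAW, Lemma 3.1 (proof, pp. 6–7)]
[cite: Hopf1935, Nr. 2 (Umlaufsatz, p. 53) and Nr. 4 eq. (22) (curves with corners, pp. 60–61)] -/
theorem classTerm_farSW (hh : holeFaceW w ∉ D) {θ : ℝ} (ω : ΩG D (w.side .W) (farSW w))
    (hr : RootedFace D (w.side .W) (farSW w)) (h : ω.IsB2a) :
    ω.classTerm (fun _ => θ) hr = (weightV θ : ℂ) * diagClassTerm θ hr ω := by
  rcases ω.classTerm_dichotomy hr h θ with ⟨hWE, h0⟩ | ⟨hWE, hct⟩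
  · rw [h0, diagClassTerm, dif_pos h, if_neg (fun H => H hWE)]; simp
  · obtain ⟨hz01, hz02, hz12⟩ := ω.firstSide_exit_return_distinct hr h
    have h3 := ω.z₃_spec hr h
    obtain ⟨hexS, hexW⟩ := farSW_entry_exit_exclusion hh hr h
    obtain ⟨hN, hE, hS, hW⟩ := WP_farSW_eq_of_wound hh hr h θ hWE
    have hWP : ω.WP (fun _ => θ) = diagTurnAt θ ω.2.firstSideG := by
      rcases hz : ω.2.firstSideG with _ | _ | _ | _
      · rw [hW hz]; rfl
      · rw [hE hz]; rfl
      · rw [hS hz]; rfl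
      · rw [hN hz]; rfl
    rw [hct, diagClassTerm, dif_pos h, if_pos hWE, hWP, mul_assoc, mul_assoc,
      diag_term θ hz01 hz02 hz12 ⟨h3.1, h3.2.1, h3.2.2⟩ hexS hexW]
    ring

/-- The modulus of the diagonal class term of a class-`B2a` walk is at most its exterior weight.
[cite: GlazmanManolescu2019, eq. (1) (the weights are non-negative)] -/
theorem norm_diagClassTerm_le (hh : holeFaceW w ∉ D) {θ : ℝ} (hθ : θ ∈ Set.Icc (π / 3) (2 * π / 3))
    (hr : RootedFace D (w.side .W) (farSW w)) (ω : ΩG D (w.side .W) (farSW w)) (h : ω.IsB2a) :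
    ‖diagClassTerm θ hr ω‖ ≤ ω.2.extWeight (fun _ => θ) (farSW w) := by
  have hext : 0 ≤ ω.2.extWeight (fun _ => θ) (farSW w) := Finset.prod_nonneg fun _ _ => localWeight_nonneg hθ _
  unfold diagClassTerm
  rw [dif_pos h]
  split_ifs with hWE
  · obtain ⟨hz01, hz02, hz12⟩ := ω.firstSide_exit_return_distinct hr h
    obtain ⟨hexS, hexW⟩ := farSW_entry_exit_exclusion hh hr h
    rw [norm_mul, norm_diagDir hz01 hz02 hz12 hexS hexW, mul_one, Complex.norm_real, Real.norm_eq_abs,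
      abs_of_nonneg hext]
  · simpa using hext

variable [Finite D]

/-- ★★ **The grouped sum at the diagonal cell**: `Σ_{B2a(d)} classTerm = v(θ) · Σ diagClassTerm`.
[cite: GlazmanManolescu2019, Lemma 2.1 (statement, "in the form given in [Gl]")] [cite: Glazman2015WeightedSAW, Lemma 3.1 (proof, pp. 6–7)] -/
theorem sum_classTerm_farSW (hh : holeFaceW w ∉ D) {θ : ℝ} (hr : RootedFace D (w.side .W) (farSW w)) :
    ∑ ω ∈ setB2a D (w.side .W) (farSW w), ω.classTerm (fun _ => θ) hr =
      (weightV θ : ℂ) * ∑ ω ∈ setB2a D (w.side .W) (farSW w), diagClassTerm θ hr ω := by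
  rw [Finset.mul_sum]
  refine Finset.sum_congr rfl fun ω hω => ?_
  simp only [setB2a, Finset.mem_filter, Finset.mem_univ, true_and] at hω
  exact ω.classTerm_farSW hh hr hω

end LawD

end ΩG

end Literature.Probability.RandomPlanarGeometry.SAW.YangBaxter

/-! ## § THE DIAGONAL-CELL LAW -/

namespace Literature.Barriers.CriticalPhenomena.PlaquetteWalk

open Literature.Probability.RandomPlanarGeometry.SAW.YangBaxter
open Real Complex

/-- ★★★★ **THE DIAGONAL-CELL LAW.** For every `θ ∈ [π/3, 2π/3]`, every finite face list `Dl`, every plaquette `w`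
whose `W`-neighbour (the hole `h`) is not in the domain while the cell `d = (w.1 − 2, w.2 − 1)` diagonally below-left
of the hole is: the Yang–Baxter vertex functional of the hole root `w.side W` at `d` is
`VF_D(w.side W, d) = i · v(θ) · Σ_{ω wound, class B2a at d} extWeight(ω) · diagDir(θ; z₀(ω), z₁(ω), z₂(ω))`,
each wound walk contributing its exterior weight along ONE OF EIGHT EXPLICIT UNIT DIRECTIONS fixed by its first side
and its {exit, return} pair (`diagDir`). Unconditional: the turning rigidity at `d` is `ΩG.WP_farSW_eq_of_wound`.
[cite: GlazmanManolescu2019, Lemma 2.1 (statement, "in the form given in [Gl]")] [cite: Glazman2015WeightedSAW, Lemma 3.1 (proof, pp. 6–7: the classes of walks through a rhombus)]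
[cite: DuminilCopinSmirnov2012, proof of Lemma 1] [cite: Hopf1935, Nr. 2 (Umlaufsatz, p. 53) and Nr. 4 eq. (22) (curves with corners, pp. 60–61)] -/
theorem vertexFunctional_printed_farSW_eq {θ : ℝ} (hθ : θ ∈ Set.Icc (π / 3) (2 * π / 3))
    (Dl : List Face) (w : Face) (hf : farSW w ∈ Dl) (hh : holeFaceW w ∉ dom Dl)
    (hr : RootedFace (dom Dl) (w.side .W) (farSW w)) :
    vertexFunctional (printedWeights θ) tFiveEighths (ybCoeff θ) Dl (w.side .W) (farSW w) =
      Complex.I * (weightV θ : ℂ) * ∑ ω ∈ ΩG.setB2a (dom Dl) (w.side .W) (farSW w), ΩG.diagClassTerm θ hr ω := by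
  have _ := hf
  rw [vertexFunctional_printed_eq_phase_mul_lem21Defect, ← ΩG.sum_g_eq_lem21Defect,
    ΩG.sum_g_eq_I_mul_sum_classTerm (fun _ => θ) hr (fun _ => hθ), ΩG.sum_classTerm_farSW hh hr, slantPot_sideW]
  have e0 : Complex.exp (((-(5 / 8 * (0 : ℝ)) : ℝ) : ℂ) * Complex.I) = 1 := by simp
  rw [e0, one_mul, mul_assoc]

/-- ★★ **The diagonal-cell bound**: `‖VF_D(w.side W, d)‖ ≤ v(θ) · Σ_{B2a(d)} extWeight` — every wound walk
contributes with modulus exactly `v(θ)·extWeight`, every unwound one nothing. [cite: GlazmanManolescu2019, Lemma 2.1 (statement, "in the form given in [Gl]")]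
[cite: Glazman2015WeightedSAW, Lemma 3.1, eq. (1) (the weight v(θ))] -/
theorem norm_vertexFunctional_printed_farSW_le {θ : ℝ} (hθ : θ ∈ Set.Icc (π / 3) (2 * π / 3))
    (Dl : List Face) (w : Face) (hf : farSW w ∈ Dl) (hh : holeFaceW w ∉ dom Dl)
    (hr : RootedFace (dom Dl) (w.side .W) (farSW w)) :
    ‖vertexFunctional (printedWeights θ) tFiveEighths (ybCoeff θ) Dl (w.side .W) (farSW w)‖ ≤
      weightV θ * ∑ ω ∈ ΩG.setB2a (dom Dl) (w.side .W) (farSW w), ω.2.extWeight (fun _ => θ) (farSW w) := by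
  rw [vertexFunctional_printed_farSW_eq hθ Dl w hf hh hr, norm_mul, norm_mul, Complex.norm_I, one_mul,
    Complex.norm_real, Real.norm_eq_abs, abs_of_nonneg (weightV_nonneg hθ)]
  refine mul_le_mul_of_nonneg_left ((norm_sum_le _ _).trans (Finset.sum_le_sum fun ω hω => ?_)) (weightV_nonneg hθ)
  simp only [ΩG.setB2a, Finset.mem_filter, Finset.mem_univ, true_and] at hω
  exact ΩG.norm_diagClassTerm_le hh hθ hr ω hω

end Literature.Barriers.CriticalPhenomena.PlaquetteWalk

/-! ## § The one-sided cones at the diagonal cell: two sufficient-half instances of the encircling criterion -/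

namespace Literature.Probability.RandomPlanarGeometry.SAW.YangBaxter

open Real Complex

section ConeD

/-- The real part of a rotated unit direction: `Re(e^{ia}·e^{ix}) = cos(a + x)`. [folklore] -/
private theorem re_cexp_mul_cexp (a x : ℝ) :
    (Complex.exp (((a : ℝ) : ℂ) * Complex.I) * Complex.exp (((x : ℝ) : ℂ) * Complex.I)).re = Real.cos (a + x) := by
  rw [← Complex.exp_add, show ((a : ℝ) : ℂ) * Complex.I + ((x : ℝ) : ℂ) * Complex.I = (((a + x : ℝ)) : ℂ) * Complex.I by
    push_cast; ring, Complex.exp_ofReal_mul_I_re]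

/-- `Re(e^{ia}) = cos a`. [folklore] -/
private theorem re_cexp (a : ℝ) : (Complex.exp (((a : ℝ) : ℂ) * Complex.I)).re = Real.cos a :=
  Complex.exp_ofReal_mul_I_re a

/-- ★ **The `N/W` cone**: every class direction of a walk that entered the diagonal cell from `N` or from `W` has
POSITIVE real part after rotation by `e^{−iπ/8}` (the four directions `1, e^{iπ/8}, e^{i(3θ/8 − π/8)}, e^{i3θ/8}` lie in
the cone `[0, π/4]` for `θ ∈ [π/3, 2π/3]`). [cite: Glazman2015WeightedSAW, Lemma 3.1, eq. (1) (the weight v(θ)); lane plumbing] -/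
theorem re_rot_diagDir_pos_of_N_or_W {θ : ℝ} (hθ : θ ∈ Set.Icc (π / 3) (2 * π / 3)) {z₀ z₁ z₂ : Side}
    (h01 : z₀ ≠ z₁) (h02 : z₀ ≠ z₂) (h12 : z₁ ≠ z₂) (hW : z₀ = .W → z₁ ≠ .N ∧ z₂ ≠ .N)
    (hz : z₀ = .N ∨ z₀ = .W) :
    0 < (Complex.exp ((((-(π / 8) : ℝ)) : ℂ) * Complex.I) * diagDir θ z₀ z₁ z₂).re := by
  have hπ := Real.pi_pos
  obtain ⟨h1, h2⟩ := hθ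
  have c1 : 0 < Real.cos (-(π / 8)) := Real.cos_pos_of_mem_Ioo ⟨by linarith, by linarith⟩
  have c2 : 0 < Real.cos (-(π / 8) + π / 8) := by rw [show -(π / 8) + π / 8 = (0 : ℝ) by ring, Real.cos_zero]; exact one_pos
  have c3 : 0 < Real.cos (-(π / 8) + (3 * θ / 8 - π / 8)) := Real.cos_pos_of_mem_Ioo ⟨by linarith, by linarith⟩
  have c4 : 0 < Real.cos (-(π / 8) + 3 * θ / 8) := Real.cos_pos_of_mem_Ioo ⟨by linarith, by linarith⟩
  revert h01 h02 h12 hW hz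
  cases z₀ <;> cases z₁ <;> cases z₂ <;> intro h01 h02 h12 hW hz <;> simp only [diagDir] <;>
    first
    | exact absurd rfl h01
    | exact absurd rfl h02
    | exact absurd rfl h12
    | exact absurd rfl (hW rfl).1
    | exact absurd rfl (hW rfl).2
    | (exfalso; rcases hz with hz | hz <;> exact absurd hz (by decide))
    | (rw [re_cexp_mul_cexp]; first | exact c2 | exact c3 | exact c4)
    | (rw [mul_one, re_cexp]; exact c1)

/-- ★ **The `E/S` cone**: every class direction of a walk that entered from `E` or from `S` has positive real part
after rotation by `e^{−i9π/8}` (the directions `e^{−i7π/8}, e^{i(3θ/8 − π)}, e^{i(3θ/8 − 9π/8)}, −1` lie in the cone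
`[π, 5π/4]`). [cite: Glazman2015WeightedSAW, Lemma 3.1, eq. (1) (the weight v(θ)); lane plumbing] -/
theorem re_rot_diagDir_pos_of_E_or_S {θ : ℝ} (hθ : θ ∈ Set.Icc (π / 3) (2 * π / 3)) {z₀ z₁ z₂ : Side}
    (h01 : z₀ ≠ z₁) (h02 : z₀ ≠ z₂) (h12 : z₁ ≠ z₂) (hS : z₀ = .S → z₁ ≠ .E ∧ z₂ ≠ .E)
    (hz : z₀ = .E ∨ z₀ = .S) :
    0 < (Complex.exp ((((-(9 * π / 8) : ℝ)) : ℂ) * Complex.I) * diagDir θ z₀ z₁ z₂).re := by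
  have hπ := Real.pi_pos
  obtain ⟨h1, h2⟩ := hθ
  have c1 : 0 < Real.cos (-(9 * π / 8) + -(7 * π / 8)) := by
    rw [show -(9 * π / 8) + -(7 * π / 8) = 0 - 2 * π by ring, Real.cos_sub_two_pi, Real.cos_zero]; exact one_pos
  have c2 : 0 < Real.cos (-(9 * π / 8) + (3 * θ / 8 - π)) := by
    rw [show -(9 * π / 8) + (3 * θ / 8 - π) = (3 * θ / 8 - π / 8) - 2 * π by ring, Real.cos_sub_two_pi]
    exact Real.cos_pos_of_mem_Ioo ⟨by linarith, by linarith⟩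
  have c3 : 0 < Real.cos (-(9 * π / 8) + (3 * θ / 8 - 9 * π / 8)) := by
    rw [show -(9 * π / 8) + (3 * θ / 8 - 9 * π / 8) = (3 * θ / 8 - π / 4) - 2 * π by ring, Real.cos_sub_two_pi]
    exact Real.cos_pos_of_mem_Ioo ⟨by linarith, by linarith⟩
  have c4 : 0 < (Complex.exp ((((-(9 * π / 8) : ℝ)) : ℂ) * Complex.I) * (-1)).re := by
    rw [mul_neg_one, Complex.neg_re, re_cexp, show -(9 * π / 8) = -(π / 8) - π by ring, Real.cos_sub_pi, neg_neg]
    exact Real.cos_pos_of_mem_Ioo ⟨by linarith, by linarith⟩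
  revert h01 h02 h12 hS hz
  cases z₀ <;> cases z₁ <;> cases z₂ <;> intro h01 h02 h12 hS hz <;> simp only [diagDir] <;>
    first
    | exact absurd rfl h01
    | exact absurd rfl h02
    | exact absurd rfl h12
    | exact absurd rfl (hS rfl).1
    | exact absurd rfl (hS rfl).2
    | (exfalso; rcases hz with hz | hz <;> exact absurd hz (by decide))
    | (rw [re_cexp_mul_cexp]; first | exact c1 | exact c2 | exact c3)
    | exact c4

end ConeD

namespace ΩG

variable {D : Set Face} {w : Face}

/-- On the OPEN range every local weight of a walk is positive (twin of the catalogue's `YBWalk.localWeight_kindsIn_pos`,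
re-derived to keep this leaf light). [cite: GlazmanManolescu2019, §1, eq. (1) and Fig. 1] -/
private theorem localWeight_kindsIn_posD {θ : ℝ} (hθ : θ ∈ Set.Ioo (π / 3) (2 * π / 3)) {D : Set Face}
    {a z : MidEdge} (γ : YBWalk D a z) (f : Face) : 0 < localWeight θ (γ.kindsIn f) := by
  have hθ' : θ ∈ Set.Ioo 0 π := ⟨by linarith [hθ.1, Real.pi_pos], by linarith [hθ.2, Real.pi_pos]⟩
  have e : γ.kindsIn f = Literature.Barriers.CriticalPhenomena.PlaquetteWalk.kindsL γ.mids f := rfl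
  rw [e]
  rcases Literature.Barriers.CriticalPhenomena.PlaquetteWalk.kindsL_shape γ f with h | h | h | h | h | h <;> rw [h] <;>
    simp only [localWeight]
  · exact one_pos
  · exact weightU1_pos_of_mem_Ioo hθ'
  · exact weightU2_pos_of_mem_Ioo hθ'
  · exact weightV_pos_of_mem_Ioo hθ'
  · rw [weightW1_eq_weightU1_mul]
    refine mul_pos (weightU1_pos_of_mem_Ioo hθ') (sub_pos.2 ?_)
    rw [← Real.sin_pi_div_two_sub]
    exact Real.sin_lt_sin_of_lt_of_le_pi_div_two (by linarith [hθ.1, Real.pi_pos]) (by linarith [hθ.1, Real.pi_pos])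
      (by linarith [hθ.2])
  · rw [weightW2_eq_sqrt_two_mul]
    refine mul_pos (mul_pos (Real.sqrt_pos.2 (by norm_num)) (weightU2_pos_of_mem_Ioo hθ')) ?_
    exact Real.sin_pos_of_pos_of_lt_pi (by linarith [hθ.1]) (by linarith [hθ.2, Real.pi_pos])

/-- The diagonal class term of an UNWOUND class-`B2a` walk vanishes. [cite: GlazmanManolescu2019, Lemma 2.1 (statement, "in the form given in [Gl]")] -/
theorem diagClassTerm_eq_zero_of_not_wound {θ : ℝ} (hr : RootedFace D (w.side .W) (farSW w))
    (ω : ΩG D (w.side .W) (farSW w)) (h : ω.IsB2a)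
    (hw : ¬ω.WE (fun _ => θ) ≠ excursionWinding θ ω.2.firstSideG (ω.z1 hr h) ω.1) : diagClassTerm θ hr ω = 0 := by
  rw [diagClassTerm, dif_pos h, if_neg hw]

/-- ★ The rotated diagonal class term of a wound walk entering from `N` or `W` has positive real part; an unwound
walk contributes `0`. [cite: GlazmanManolescu2019, Lemma 2.1 (statement, "in the form given in [Gl]")] [cite: Glazman2015WeightedSAW, Lemma 3.1, eq. (1)] -/
theorem re_rot_diagClassTerm_of_N_or_W (hh : holeFaceW w ∉ D) {θ : ℝ} (hθ : θ ∈ Set.Ioo (π / 3) (2 * π / 3))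
    (hr : RootedFace D (w.side .W) (farSW w)) (ω : ΩG D (w.side .W) (farSW w)) (h : ω.IsB2a)
    (hz : ω.2.firstSideG = .N ∨ ω.2.firstSideG = .W) :
    0 ≤ (Complex.exp ((((-(π / 8) : ℝ)) : ℂ) * Complex.I) * diagClassTerm θ hr ω).re ∧
      (ω.WE (fun _ => θ) ≠ excursionWinding θ ω.2.firstSideG (ω.z1 hr h) ω.1 →
        0 < (Complex.exp ((((-(π / 8) : ℝ)) : ℂ) * Complex.I) * diagClassTerm θ hr ω).re) := by
  have hθ' : θ ∈ Set.Icc (π / 3) (2 * π / 3) := Set.Ioo_subset_Icc_self hθ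
  obtain ⟨hz01, hz02, hz12⟩ := ω.firstSide_exit_return_distinct hr h
  obtain ⟨-, hexW⟩ := farSW_entry_exit_exclusion hh hr h
  have hext : 0 < ω.2.extWeight (fun _ => θ) (farSW w) := Finset.prod_pos fun g _ => localWeight_kindsIn_posD hθ ω.2 g
  have hdir := re_rot_diagDir_pos_of_N_or_W hθ' hz01 hz02 hz12 hexW hz
  have key : ∀ hw : ω.WE (fun _ => θ) ≠ excursionWinding θ ω.2.firstSideG (ω.z1 hr h) ω.1,
      (Complex.exp ((((-(π / 8) : ℝ)) : ℂ) * Complex.I) * diagClassTerm θ hr ω).re =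
        ω.2.extWeight (fun _ => θ) (farSW w) *
          (Complex.exp ((((-(π / 8) : ℝ)) : ℂ) * Complex.I) * diagDir θ ω.2.firstSideG (ω.z1 hr h) ω.1).re := by
    intro hw
    rw [diagClassTerm, dif_pos h, if_pos hw, show Complex.exp ((((-(π / 8) : ℝ)) : ℂ) * Complex.I) *
        ((ω.2.extWeight (fun _ => θ) (farSW w) : ℂ) * diagDir θ ω.2.firstSideG (ω.z1 hr h) ω.1) =
        (ω.2.extWeight (fun _ => θ) (farSW w) : ℂ) *
          (Complex.exp ((((-(π / 8) : ℝ)) : ℂ) * Complex.I) * diagDir θ ω.2.firstSideG (ω.z1 hr h) ω.1) by ring,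
      Complex.re_ofReal_mul]
  constructor
  · by_cases hw : ω.WE (fun _ => θ) ≠ excursionWinding θ ω.2.firstSideG (ω.z1 hr h) ω.1
    · rw [key hw]; exact (mul_pos hext hdir).le
    · rw [diagClassTerm, dif_pos h, if_neg hw, mul_zero, Complex.zero_re]
  · intro hw
    rw [key hw]; exact mul_pos hext hdir

/-- ★ The `E/S` twin. [cite: GlazmanManolescu2019, Lemma 2.1 (statement, "in the form given in [Gl]")] [cite: Glazman2015WeightedSAW, Lemma 3.1, eq. (1)] -/
theorem re_rot_diagClassTerm_of_E_or_S (hh : holeFaceW w ∉ D) {θ : ℝ} (hθ : θ ∈ Set.Ioo (π / 3) (2 * π / 3))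
    (hr : RootedFace D (w.side .W) (farSW w)) (ω : ΩG D (w.side .W) (farSW w)) (h : ω.IsB2a)
    (hz : ω.2.firstSideG = .E ∨ ω.2.firstSideG = .S) :
    0 ≤ (Complex.exp ((((-(9 * π / 8) : ℝ)) : ℂ) * Complex.I) * diagClassTerm θ hr ω).re ∧
      (ω.WE (fun _ => θ) ≠ excursionWinding θ ω.2.firstSideG (ω.z1 hr h) ω.1 →
        0 < (Complex.exp ((((-(9 * π / 8) : ℝ)) : ℂ) * Complex.I) * diagClassTerm θ hr ω).re) := by
  have hθ' : θ ∈ Set.Icc (π / 3) (2 * π / 3) := Set.Ioo_subset_Icc_self hθ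
  obtain ⟨hz01, hz02, hz12⟩ := ω.firstSide_exit_return_distinct hr h
  obtain ⟨hexS, -⟩ := farSW_entry_exit_exclusion hh hr h
  have hext : 0 < ω.2.extWeight (fun _ => θ) (farSW w) := Finset.prod_pos fun g _ => localWeight_kindsIn_posD hθ ω.2 g
  have hdir := re_rot_diagDir_pos_of_E_or_S hθ' hz01 hz02 hz12 hexS hz
  have key : ∀ hw : ω.WE (fun _ => θ) ≠ excursionWinding θ ω.2.firstSideG (ω.z1 hr h) ω.1,
      (Complex.exp ((((-(9 * π / 8) : ℝ)) : ℂ) * Complex.I) * diagClassTerm θ hr ω).re =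
        ω.2.extWeight (fun _ => θ) (farSW w) *
          (Complex.exp ((((-(9 * π / 8) : ℝ)) : ℂ) * Complex.I) * diagDir θ ω.2.firstSideG (ω.z1 hr h) ω.1).re := by
    intro hw
    rw [diagClassTerm, dif_pos h, if_pos hw, show Complex.exp ((((-(9 * π / 8) : ℝ)) : ℂ) * Complex.I) *
        ((ω.2.extWeight (fun _ => θ) (farSW w) : ℂ) * diagDir θ ω.2.firstSideG (ω.z1 hr h) ω.1) =
        (ω.2.extWeight (fun _ => θ) (farSW w) : ℂ) *
          (Complex.exp ((((-(9 * π / 8) : ℝ)) : ℂ) * Complex.I) * diagDir θ ω.2.firstSideG (ω.z1 hr h) ω.1) by ring,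
      Complex.re_ofReal_mul]
  constructor
  · by_cases hw : ω.WE (fun _ => θ) ≠ excursionWinding θ ω.2.firstSideG (ω.z1 hr h) ω.1
    · rw [key hw]; exact (mul_pos hext hdir).le
    · rw [diagClassTerm, dif_pos h, if_neg hw, mul_zero, Complex.zero_re]
  · intro hw
    rw [key hw]; exact mul_pos hext hdir

end ΩG

end Literature.Probability.RandomPlanarGeometry.SAW.YangBaxter

namespace Literature.Barriers.CriticalPhenomena.PlaquetteWalk

open Literature.Probability.RandomPlanarGeometry.SAW.YangBaxter
open Real Complex

/-- ★★★ **THE `N/W` CONE LAW AT THE DIAGONAL CELL** (a sufficient-half instance of the lane's encircling criterion at a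
plaquette other than the root's own): on the open range `θ ∈ (π/3, 2π/3)`, if every WOUND class-`B2a` walk at the
diagonal cell `d` entered it from `N` or from `W` (none from `E` or `S`) and at least one wound walk exists, then the
Yang–Baxter vertex identity FAILS at `d`: `VF_D(w.side W, d) ≠ 0` — the four `N/W` class directions lie in a cone of
opening `π/4`, so no cancellation is possible. [cite: GlazmanManolescu2019, Lemma 2.1 (statement, "in the form given in [Gl]")]
[cite: Glazman2015WeightedSAW, Lemma 3.1 (proof, pp. 6–7)] [cite: Hopf1935, Nr. 2 (Umlaufsatz, p. 53) and Nr. 4 eq. (22) (curves with corners, pp. 60–61)] -/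
theorem vertexFunctional_printed_farSW_ne_zero_of_N_or_W {θ : ℝ} (hθ : θ ∈ Set.Ioo (π / 3) (2 * π / 3))
    (Dl : List Face) (w : Face) (hf : farSW w ∈ Dl) (hh : holeFaceW w ∉ dom Dl)
    (hr : RootedFace (dom Dl) (w.side .W) (farSW w))
    (hNW : ∀ (ω : ΩG (dom Dl) (w.side .W) (farSW w)) (h : ω.IsB2a),
      ω.WE (fun _ => θ) ≠ excursionWinding θ ω.2.firstSideG (ω.z1 hr h) ω.1 → ω.2.firstSideG = .N ∨ ω.2.firstSideG = .W)
    (hex : ∃ (ω : ΩG (dom Dl) (w.side .W) (farSW w)) (h : ω.IsB2a),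
      ω.WE (fun _ => θ) ≠ excursionWinding θ ω.2.firstSideG (ω.z1 hr h) ω.1) :
    vertexFunctional (printedWeights θ) tFiveEighths (ybCoeff θ) Dl (w.side .W) (farSW w) ≠ 0 := by
  classical
  have hθ' := Set.Ioo_subset_Icc_self hθ
  have hv : (weightV θ : ℂ) ≠ 0 := by
    have hθ0 : θ ∈ Set.Ioo 0 π := ⟨by linarith [hθ.1, Real.pi_pos], by linarith [hθ.2, Real.pi_pos]⟩
    exact_mod_cast (weightV_pos_of_mem_Ioo hθ0).ne'
  rw [vertexFunctional_printed_farSW_eq hθ' Dl w hf hh hr]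
  refine mul_ne_zero (mul_ne_zero Complex.I_ne_zero hv) fun h0 => ?_
  set ρ : ℂ := Complex.exp ((((-(π / 8) : ℝ)) : ℂ) * Complex.I) with hρ
  have hsum : 0 < (ρ * ∑ ω ∈ ΩG.setB2a (dom Dl) (w.side .W) (farSW w), ΩG.diagClassTerm θ hr ω).re := by
    rw [Finset.mul_sum, Complex.re_sum]
    obtain ⟨ω₀, h₀, hW₀⟩ := hex
    have hmem : ω₀ ∈ ΩG.setB2a (dom Dl) (w.side .W) (farSW w) := by
      simp only [ΩG.setB2a, Finset.mem_filter, Finset.mem_univ, true_and]; exact h₀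
    have hterm : ∀ ω ∈ ΩG.setB2a (dom Dl) (w.side .W) (farSW w), 0 ≤ (ρ * ΩG.diagClassTerm θ hr ω).re := by
      intro ω hω
      simp only [ΩG.setB2a, Finset.mem_filter, Finset.mem_univ, true_and] at hω
      have hB : ω.IsB2a := hω
      by_cases hw : ω.WE (fun _ => θ) ≠ excursionWinding θ ω.2.firstSideG (ω.z1 hr hB) ω.1
      · exact (ΩG.re_rot_diagClassTerm_of_N_or_W hh hθ hr ω hB (hNW ω hB hw)).1
      · rw [ΩG.diagClassTerm_eq_zero_of_not_wound hr ω hB hw, mul_zero, Complex.zero_re]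
    refine lt_of_lt_of_le ?_ (Finset.single_le_sum hterm hmem)
    exact (ΩG.re_rot_diagClassTerm_of_N_or_W hh hθ hr ω₀ h₀ (hNW ω₀ h₀ hW₀)).2 hW₀
  rw [h0, mul_zero, Complex.zero_re] at hsum
  exact lt_irrefl _ hsum

/-- ★★★ **THE `E/S` CONE LAW AT THE DIAGONAL CELL**: the twin with all wound walks entering from `E` or `S`.
[cite: GlazmanManolescu2019, Lemma 2.1 (statement, "in the form given in [Gl]")] [cite: Glazman2015WeightedSAW, Lemma 3.1 (proof, pp. 6–7)]
[cite: Hopf1935, Nr. 2 (Umlaufsatz, p. 53) and Nr. 4 eq. (22) (curves with corners, pp. 60–61)] -/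
theorem vertexFunctional_printed_farSW_ne_zero_of_E_or_S {θ : ℝ} (hθ : θ ∈ Set.Ioo (π / 3) (2 * π / 3))
    (Dl : List Face) (w : Face) (hf : farSW w ∈ Dl) (hh : holeFaceW w ∉ dom Dl)
    (hr : RootedFace (dom Dl) (w.side .W) (farSW w))
    (hES : ∀ (ω : ΩG (dom Dl) (w.side .W) (farSW w)) (h : ω.IsB2a),
      ω.WE (fun _ => θ) ≠ excursionWinding θ ω.2.firstSideG (ω.z1 hr h) ω.1 → ω.2.firstSideG = .E ∨ ω.2.firstSideG = .S)
    (hex : ∃ (ω : ΩG (dom Dl) (w.side .W) (farSW w)) (h : ω.IsB2a),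
      ω.WE (fun _ => θ) ≠ excursionWinding θ ω.2.firstSideG (ω.z1 hr h) ω.1) :
    vertexFunctional (printedWeights θ) tFiveEighths (ybCoeff θ) Dl (w.side .W) (farSW w) ≠ 0 := by
  classical
  have hθ' := Set.Ioo_subset_Icc_self hθ
  have hv : (weightV θ : ℂ) ≠ 0 := by
    have hθ0 : θ ∈ Set.Ioo 0 π := ⟨by linarith [hθ.1, Real.pi_pos], by linarith [hθ.2, Real.pi_pos]⟩
    exact_mod_cast (weightV_pos_of_mem_Ioo hθ0).ne'
  rw [vertexFunctional_printed_farSW_eq hθ' Dl w hf hh hr]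
  refine mul_ne_zero (mul_ne_zero Complex.I_ne_zero hv) fun h0 => ?_
  set ρ : ℂ := Complex.exp ((((-(9 * π / 8) : ℝ)) : ℂ) * Complex.I) with hρ
  have hsum : 0 < (ρ * ∑ ω ∈ ΩG.setB2a (dom Dl) (w.side .W) (farSW w), ΩG.diagClassTerm θ hr ω).re := by
    rw [Finset.mul_sum, Complex.re_sum]
    obtain ⟨ω₀, h₀, hW₀⟩ := hex
    have hmem : ω₀ ∈ ΩG.setB2a (dom Dl) (w.side .W) (farSW w) := by
      simp only [ΩG.setB2a, Finset.mem_filter, Finset.mem_univ, true_and]; exact h₀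
    have hterm : ∀ ω ∈ ΩG.setB2a (dom Dl) (w.side .W) (farSW w), 0 ≤ (ρ * ΩG.diagClassTerm θ hr ω).re := by
      intro ω hω
      simp only [ΩG.setB2a, Finset.mem_filter, Finset.mem_univ, true_and] at hω
      have hB : ω.IsB2a := hω
      by_cases hw : ω.WE (fun _ => θ) ≠ excursionWinding θ ω.2.firstSideG (ω.z1 hr hB) ω.1
      · exact (ΩG.re_rot_diagClassTerm_of_E_or_S hh hθ hr ω hB (hES ω hB hw)).1
      · rw [ΩG.diagClassTerm_eq_zero_of_not_wound hr ω hB hw, mul_zero, Complex.zero_re]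
    refine lt_of_lt_of_le ?_ (Finset.single_le_sum hterm hmem)
    exact (ΩG.re_rot_diagClassTerm_of_E_or_S hh hθ hr ω₀ h₀ (hES ω₀ h₀ hW₀)).2 hW₀
  rw [h0, mul_zero, Complex.zero_re] at hsum
  exact lt_irrefl _ hsum

end Literature.Barriers.CriticalPhenomena.PlaquetteWalk
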